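import Summits.FinalStateConjecture.FinalStateConjecture.Theorems.BartnikGapSettlingBondiBartnikRigidityKillingDomainCausal
import Literature.Geometry.Lorentzian.KerrDataEmbedding
import Literature.Geometry.Lorentzian.KerrDataProofs
import Literature.Geometry.Lorentzian.KerrSliceFacts
import Literature.Geometry.Lorentzian.CauchyDevelopmentComap
import Literature.Geometry.Lorentzian.DataEmbeddingNormalSmooth
import Literature.Geometry.Lorentzian.CauchyProblemLocalUniqueness
import Literature.Geometry.Lorentzian.CauchyProblemMGHDExistence
import Literature.Geometry.Lorentzian.OpensCausality
import Literature.Geometry.Lorentzian.KerrSchildChartCovariance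
import Literature.Geometry.Lorentzian.KerrHyperboloidalLeaves
import Literature.Geometry.Lorentzian.HypersurfaceRestriction
import Literature.Geometry.Manifold.EmbeddingRangeDiffeomorph
import Literature.Geometry.Manifold.InverseFunctionTheorem
import HarnessLib
import Summits.FinalStateConjecture.FinalStateConjecture.Theorems.SwallowTheDatumKerrShieldedSettlesStubCollarCauchy
import Literature.Geometry.Lorentzian.CausalityChronologyProofs
import Literature.Geometry.Lorentzian.CausalityClosedProofs
import Mathlib.Analysis.Convex.Topology
import Summits.FinalStateConjecture.FinalStateConjecture.Theorems.BartnikGapSettlingBondiBartnikRigidityDirectMethodDefs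
import Literature.Geometry.Lorentzian.CauchyHypersurfaceCausalProofs
import Literature.Geometry.Lorentzian.CausalCurveLift
import Literature.Geometry.Lorentzian.CommonDevelopmentEmbedding
import Summits.FinalStateConjecture.FinalStateConjecture.Theorems.SwallowTheDatumSubdataDevelopmentsEmbedNcbDomain
import Summits.FinalStateConjecture.FinalStateConjecture.Theorems.SwallowTheDatumSubdataDevelopmentsEmbedHmaxGlue
import Summits.FinalStateConjecture.FinalStateConjecture.Theorems.SwallowTheDatumSubdataDevelopmentsEmbedRealise
import Literature.Geometry.Lorentzian.CauchyDevelopmentGlobalHyperbolicityProofs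
import Literature.Geometry.Lorentzian.DataEmbeddingConstraints
import Literature.Geometry.Lorentzian.HypersurfaceNaturality
import Literature.Geometry.Lorentzian.ChartSecondFundamentalForm
import Literature.Geometry.Lorentzian.MultiCentreRadiationZone
import Literature.Geometry.Lorentzian.BackgroundChartCalculus

/-! ## merged part 0: `stub_slabCauchyRigidity.lean` -/


/-!
# F1 `stub_slabCauchyRigidity` (slab-jet Cauchy rigidity) — line `direct-method-on-the-cone`,
# crux `BondiBartnikRigidity` (stmt-FinalStateConjecture-10807): typing audit, corrected statement,
# route decomposition and checked reduction (worker F1, wave 2 of lead a2)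

See `stub_slabCauchyRigidity.report.md` next to this file.  Summary:

* the REGISTERED `K2Route.SlabCauchyRigidity` is mis-stated twice: (T) no hypothesis pins the time
  orientation of the collar chart `Φ₀` (the time-reversed exact Kerr development refutes the
  conclusion `Ψ = Φ₀` on the slab + image in `J⁺(C)`), and (R) for `a ≠ 0` the region
  `slabDiamond = {0 < t*, t* + r < 3M}` is NOT inside the Kerr domain of dependence of the slab
  (`{v = t* + r = const}` is TIMELIKE off the axis: `g⁻¹(dv, dv) = a² sin²θ / Σ > 0`), so the
  conclusion asserts Kerrness of a region the hypotheses do not determine;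
* the corrected statement `SlabCauchyRigidity'` below adds the orientation clause (H8) and replaces
  the diamond by `slabDiamond' = {0 < t*, 3 t* + 2 r < 6 M}` (inside `D⁺_Kerr(slab°)` for every
  `|a| < M` since `|ṙ| < √2 |ṫ*|` along causal curves of the star chart `{r > M}`; it still contains
  the K1 shell box `{0 < t* < M/4, 2M < r < 5M/2}`);
* the route: `SlabCauchyRigidity'` ⟸ (A) `SlabSubdatum` (steps (a)+(b): the exact `1`-jet makes the
  slab a Kerr sub-datum of `D`) ∧ (C) `KerrSlabLensCauchy` (step (c): the open slab is a Cauchy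
  hypersurface of an explicit lens of the Kerr star chart) ∧ (D) `SubdataDevelopmentsEmbedLit`
  (step (d): localisation, Literature-vocabulary body of route item 10053 of `SwallowTheDatum`,
  conditionally closed in the tree) ∧ (E) `SubdevelopmentFuturePlacement` (step (e)).
-/

noncomputable section

-- D-0017: single-problem summit, `Summit.<S>.<S>.…` by design (cf. lakefile `weak.linter.dupNamespace`).
set_option linter.dupNamespace false
set_option maxSynthPendingDepth 3

open Set Filter Function Topology TopologicalSpace Bundle
open Literature.Geometry.Lorentzian
open scoped Manifold ContDiff Topology ENNReal

namespace Summit.FinalStateConjecture.FinalStateConjecture.Theorems.BondiBartnikRigidity.DirectMethod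

namespace F1Route

/-! ### Discharging the Kerr chart facts -/

/-- The Kerr chart facts hold (theorems of the tree). -/
theorem kerrFacts : Kerr.Facts :=
  ⟨Kerr.isConnected_region_holds, Kerr.contMDiff_bilin_holds, Kerr.contMDiff_timeVector_holds⟩


/-! ### Kerr-side sets (unboosted star chart `Kerr.region a M`) -/

/-- The OPEN Kerr-side slab `slab° = {t* = 0, r < 3M}` (within `{r > M}`). -/
def slabKo (M a : ℝ) : Set (Kerr.region a M) := {y | y.1 0 = 0 ∧ Kerr.radius a y.1 < 3 * M}


/-- The Kerr-side SLAB LENS `V_K = {6M − 2r − 3t* > 0} ∩ {6M − 2r + 3t* > 0} ∩ {2t* + r − M > 0}`: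
an open neighbourhood of `slab°` in which (route statement (C)) `slab°` is a Cauchy hypersurface;
its three boundary functions are monotone along future causal curves of the star chart because
`|ṙ| < √2 |ṫ*|` there (`|∇r|²_δ = (r² + a²)/Σ < 2` for `|a| < M < r`, and `|ẋ|_δ ≤ ẋ⁰` for
`g`-causal `ẋ` since `H ≥ 0`). -/
def lensK (M a : ℝ) : Set (Kerr.region a M) :=
  {y | 0 < 6 * M - 2 * Kerr.radius a y.1 - 3 * y.1 0 ∧ 0 < 6 * M - 2 * Kerr.radius a y.1 + 3 * y.1 0 ∧
    0 < 2 * y.1 0 + (Kerr.radius a y.1 - M)}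


/-- The future part `{t* > 0}` of the lens: the Kerr-side corrected diamond
`Δ'_K = {0 < t*, 3t* + 2r < 6M}`. -/
def diamondK (M a : ℝ) : Set (Kerr.region a M) :=
  {y | 0 < y.1 0 ∧ 0 < 6 * M - 2 * Kerr.radius a y.1 - 3 * y.1 0}


theorem slabKo_subset_lensK {M a : ℝ} : slabKo M a ⊆ lensK M a := by
  intro y hy
  obtain ⟨h0, hr⟩ := hy
  have hM : M < Kerr.radius a y.1 := (le_max_left M 0).trans_lt y.2
  refine ⟨by rw [h0]; linarith, by rw [h0]; linarith, by rw [h0]; linarith⟩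


theorem diamondK_subset_lensK {M a : ℝ} : diamondK M a ⊆ lensK M a := by
  intro y hy
  obtain ⟨h0, h1⟩ := hy
  have hM : M < Kerr.radius a y.1 := (le_max_left M 0).trans_lt y.2
  exact ⟨h1, by linarith, by linarith⟩


theorem isOpen_lensK (M a : ℝ) : IsOpen (lensK M a) := by
  have hr : Continuous fun y : Kerr.region a M => Kerr.radius a y.1 :=
    (Kerr.continuous_radius a).comp continuous_subtype_val
  have h0 : Continuous fun x : E4 => x 0 := PiLp.continuous_apply 2 _ 0
  have ht : Continuous fun y : Kerr.region a M => y.1 0 := h0.comp continuous_subtype_val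
  simp only [lensK, Set.setOf_and]
  refine (isOpen_lt continuous_const ?_).inter ((isOpen_lt continuous_const ?_).inter
    (isOpen_lt continuous_const ?_)) <;> fun_prop


/-- Pull-back of a Kerr-side set to the domain of a background along the rest-frame map
`x ↦ Λ⁻¹(x − c)` (verbatim `pullK` of the route file `…StationaryKerrCollarRoute.lean`, renamed
here only because that module is imported by the final form of this file). -/
def pullK' (mo : lorentzGroup × E4) (M a : ℝ) (B : ModelBackground) (S : Set (Kerr.region a M)) :
    Set B.domain :=
  {x | ∃ h : poincareInv mo.1 mo.2 x.1 ∈ Kerr.region a M, (⟨poincareInv mo.1 mo.2 x.1, h⟩ : Kerr.region a M) ∈ S}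


/-! ### Background-side corrected regions -/

/-- The CORRECTED future inner diamond `Δ' = {0 < t*, 3t* + 2r < 6M}` of the thick slab: inside
the Kerr future domain of dependence of the open slab for every `|a| < M` (the registered
`slabDiamond = {0 < t*, t* + r < 3M}` is not, for `a ≠ 0`). -/
def slabDiamond' (B : ModelBackground) (M : ℝ) : Set B.domain :=
  {x | 0 < B.time x.1 ∧ 3 * B.time x.1 + 2 * B.radius x.1 < 6 * M}


/-- `Δ'` together with the open slab: `{0 ≤ t*, 3t* + 2r < 6M}`. -/
def slabDiamondWithSlab' (B : ModelBackground) (M : ℝ) : Set B.domain :=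
  {x | 0 ≤ B.time x.1 ∧ 3 * B.time x.1 + 2 * B.radius x.1 < 6 * M}


theorem slabDiamond'_eq_pullK' {mo : lorentzGroup × E4} {M a : ℝ} {B : ModelBackground}
    (hB : B = starBackground mo.1 mo.2 M a (fun x => Kerr.radius a (poincareInv mo.1 mo.2 x))) :
    slabDiamond' B M = pullK' mo M a B (diamondK M a) := by
  subst hB
  ext x
  constructor
  · intro hx
    obtain ⟨h0, h1⟩ : 0 < poincareInv mo.1 mo.2 x.1 0 ∧
        3 * (poincareInv mo.1 mo.2 x.1 0) + 2 * Kerr.radius a (poincareInv mo.1 mo.2 x.1) < 6 * M := hx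
    exact ⟨x.2, h0, by change 0 < 6 * M - 2 * Kerr.radius a (poincareInv mo.1 mo.2 x.1) - 3 * _; linarith⟩
  · rintro ⟨hmem, hd⟩
    obtain ⟨h0, h1⟩ : 0 < poincareInv mo.1 mo.2 x.1 0 ∧
        0 < 6 * M - 2 * Kerr.radius a (poincareInv mo.1 mo.2 x.1) - 3 * (poincareInv mo.1 mo.2 x.1 0) := hd
    exact ⟨h0, by change 3 * (poincareInv mo.1 mo.2 x.1 0) + 2 * Kerr.radius a _ < 6 * M; linarith⟩



/-! ### The open slab as an abstract `3`-manifold and its Kerr-side embedding -/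

/-- The OPEN THICK SLAB `N = {y ∈ Kerr.slice a M | r_a(0, y) < 3M}` = `{M < r < 3M}` as an open
sub-manifold of the Kerr–Schild slice `Kerr.slice a M` (itself an open subset of `E3`). -/
def slabW (M a : ℝ) : Opens (Kerr.slice a M) :=
  ⟨{y | Kerr.radius a (E4.ofTimeSpace 0 (y : E3)) < 3 * M},
    isOpen_lt (((Kerr.continuous_radius a).comp (E4.continuous_ofTimeSpace 0)).comp
      continuous_subtype_val) continuous_const⟩


/-- The Kerr-side embedding `y ↦ (0, y)` of the open slab into the star chart `Kerr.region a M`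
(restriction of `Kerr.sliceEmbed`). -/
def ψN (M a : ℝ) : slabW M a → Kerr.region a M := Kerr.sliceEmbed a M ∘ Subtype.val


/-- The Kerr future unit normal along the open slab (restriction of `Kerr.sliceNormal`). -/
def νN (M a : ℝ) : NormalField 𝓘(ℝ, E4) (ψN M a) := fun y => Kerr.sliceNormal M a M y.1


theorem coe_ψN (M a : ℝ) (y : slabW M a) : (ψN M a y : E4) = E4.ofTimeSpace 0 (y : E3) := rfl


theorem ψN_mem_slabKo (M a : ℝ) (y : slabW M a) : ψN M a y ∈ slabKo M a :=
  ⟨rfl, y.2⟩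


/-! ### The four route statements -/

section Statements

/-- **(A) `SlabSubdatum`** — steps (a)+(b) of the paper proof: the exact `1`-jet of a
future-oriented collar chart on the thick slab makes the open slab a KERR SUB-DATUM of `D`: there
is a smooth open embedding `Φ_N : N → X` with injective differentials such that
`ι ∘ Φ_N = Φ₀ ∘ (y ↦ Λ(0,y) + c)` and, pointwise, `Φ_N^* h = ψ_N^* g_{M,a}` and
`Φ_N^* k = K_ν(ψ_N)` (the Kerr slab data).  (a) is the smooth factorisation through the embedded
hypersurface `ι(X)` (`Literature.Geometry.Manifold.exists_contMDiff_comp_eq_of_range_subset`);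
(b): order `0` of the jet gives `h`, order `1` gives the Christoffel symbols and hence `K` at slab
points, the future unit normal being pinned by (H8) (`TimeOrientation.eq_of_isFutureUnitNormal`).
MISSING in the tree (true on paper).  Route-posited statement of the line; nothing is asserted. [conjecture] [folklore] -/
def SlabSubdatum : Prop :=
  ∀ [Kerr.Facts] [Kerr.SliceFacts] (k' : ℕ), 1 ≤ k' →
    ∀ (X : Type) [TopologicalSpace X] [ChartedSpace E3 X] [IsManifold (𝓡 3) ∞ X]
      [T2Space X] [SecondCountableTopology X] [ConnectedSpace X]
      (D : InitialDataSet (𝓡 3) X) (𝒱 : VacuumCauchyDevelopment D)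
      (M a : ℝ) (mo : lorentzGroup × E4) (B : ModelBackground) (Φ₀ : B.domain → 𝒱.carrier),
    0 < M → |a| < M →
    B = starBackground mo.1 mo.2 M a (fun x => Kerr.radius a (poincareInv mo.1 mo.2 x)) →
    (ContMDiffOn 𝓘(ℝ, E4) (𝓡 4) ∞ Φ₀
        {x | -1 < B.time x.1 ∧ B.time x.1 < 1 ∧ B.radius x.1 < 3 * M + 1} ∧
      IsOpenEmbedding ({x | -1 < B.time x.1 ∧ B.time x.1 < 1 ∧
        B.radius x.1 < 3 * M + 1}.restrict Φ₀)) →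
    𝒱.toSpacetime.truncDeviationCk B Φ₀ k' (3 * M) 0 ≤ 0 →
    Φ₀ '' B.truncTimeSlab (3 * M) 0 ⊆ range 𝒱.embed →
    (∀ x ∈ B.truncTimeSlab (3 * M) 0, 𝒱.timeOrientation.IsFutureDirected
      (mfderiv 𝓘(ℝ, E4) (𝓡 4) Φ₀ x
        ((mo.1 : E4 ≃L[ℝ] E4) (Kerr.timeVector M a (poincareInv mo.1 mo.2 x.1))))) →
    ∃ ΦN : slabW M a → X, ContMDiff (𝓡 3) (𝓡 3) ((((⊤ : ℕ∞) : WithTop ℕ∞)) + 1) ΦN ∧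
      (∀ u, Injective (mfderiv (𝓡 3) (𝓡 3) ΦN u)) ∧ IsOpenEmbedding ΦN ∧
      (∀ y : slabW M a, ∃ hx : ((mo.1 : E4 ≃L[ℝ] E4) (E4.ofTimeSpace 0 (y : E3)) + mo.2) ∈ B.domain,
          𝒱.embed (ΦN y) = Φ₀ ⟨_, hx⟩) ∧
      (∀ (y : slabW M a) (v w : E3),
          D.h.inner (ΦN y) (mfderiv (𝓡 3) (𝓡 3) ΦN y v) (mfderiv (𝓡 3) (𝓡 3) ΦN y w) =
            Kerr.bilin M a (ψN M a y : E4) (mfderiv 𝓘(ℝ, E3) 𝓘(ℝ, E4) (ψN M a) y v)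
              (mfderiv 𝓘(ℝ, E3) 𝓘(ℝ, E4) (ψN M a) y w)) ∧
      (∀ [(Kerr.smoothMetric M a M).HasLeviCivita] (y : slabW M a) (v w : E3),
          D.k (ΦN y) (mfderiv (𝓡 3) (𝓡 3) ΦN y v) (mfderiv (𝓡 3) (𝓡 3) ΦN y w) =
            (Kerr.smoothMetric M a M).secondFundamentalForm 𝓘(ℝ, E3) (ψN M a) (νN M a) y v w)


/-- **(C) `KerrSlabLensCauchy`** — step (c): in the Kerr star chart `{r > M}` (`0 < M`,
`|a| < M`) the open slab `slab° = {t* = 0, r < 3M}` and the lens `V_K` (`lensK`) are connected,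
`slab°` is a CAUCHY HYPERSURFACE of the open sub-spacetime `V_K`, and the future part
`{t* > 0} ∩ V_K` (`diamondK`) lies in the chronological future of `slab°` inside `V_K`.  Proof
on paper (order theory of three clocks, template `SwallowTheDatum….stub_collarCauchy`): along
future timelike curves of the chart `t*` increases, `|ṙ| < √2 ṫ*`, so `6M − 2r − 3t*` decreases
and `6M − 2r + 3t*`, `2t* + r − M` increase; in `{r < r₊}` `r` increases to the past; endpoints
exist by the Minkowski comparison `η(v,v) ≤ g(v,v)` (`MinkowskiCauchy`).  MISSING (closable;
Kerr causal geometry shared with K2c `stub_kerrLateBoxPlacement`).  Route-posited statement of the line; nothing is asserted. [conjecture] [folklore] -/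
def KerrSlabLensCauchy : Prop :=
  ∀ [Kerr.Facts] (M a : ℝ) (hM : 0 < M), |a| < M →
    IsConnected (slabW M a : Set (Kerr.slice a M)) ∧ IsConnected (lensK M a) ∧
    ((Kerr.spacetime M a M hM.le).metric.restrict PseudoRiemannianMetric.contMDiff_restrict_holds
        ⟨lensK M a, isOpen_lensK M a⟩).IsCauchyHypersurface
      ((Kerr.spacetime M a M hM.le).timeOrientation.restrict
        PseudoRiemannianMetric.contMDiff_restrict_holds
        (Kerr.spacetime M a M hM.le).timeOrientation.contMDiff_restrict_holds
        ⟨lensK M a, isOpen_lensK M a⟩)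
      (Subtype.val ⁻¹' slabKo M a) ∧
    (Subtype.val ⁻¹' diamondK M a : Set (⟨lensK M a, isOpen_lensK M a⟩ : Opens (Kerr.region a M))) ⊆
      ((Kerr.spacetime M a M hM.le).metric.restrict PseudoRiemannianMetric.contMDiff_restrict_holds
        ⟨lensK M a, isOpen_lensK M a⟩).chronologicalFuture
      ((Kerr.spacetime M a M hM.le).timeOrientation.restrict
        PseudoRiemannianMetric.contMDiff_restrict_holds
        (Kerr.spacetime M a M hM.le).timeOrientation.contMDiff_restrict_holds
        ⟨lensK M a, isOpen_lensK M a⟩)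
      (Subtype.val ⁻¹' slabKo M a)


/-- **(D) `SubdataDevelopmentsEmbedLit`** — step (d), THE LOCALISATION PRINCIPLE (Literature
vocabulary; verbatim the body of route item `SubdataDevelopmentsEmbed`, stmt-FinalStateConjecture-10053,
of route `SwallowTheDatum`): every vacuum Cauchy development of the sub-datum `Φ^* D` along a
smooth open embedding `Φ : N → X` with injective differentials embeds, over `Φ`, into every
MAXIMAL vacuum Cauchy development of `D`.  In the tree it is CONDITIONALLY CLOSED three ways:
`subdataDevelopmentsEmbed_of_choquetBruhatGeroch : choquetBruhat_geroch_exists_mghd_cauchy → …`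
(`…SubdataDevelopmentsEmbedLocalisationHolds.lean`),
`subdataDevelopmentsEmbed_of_locallyUnique_of_sbierski : hawkingEllis_locallyUnique_vacuumDevelopment →
sbierski_commonDevelopment_lt_of_hasCorrespondingBoundaryPoints → …` (`…TwoFacts.lean`),
`subdataDevelopmentsEmbed_of_locallyUnique_of_ncb` (`…Final.lean`) — all stated over the Theses
name, hence re-stated here. (ref: HawkingEllis1973CUP, §7.6) (ref: ChoquetBruhatGeroch1969CMP, Thm. 3)  Route-posited statement of the line; nothing is asserted. [conjecture] [folklore] -/
def SubdataDevelopmentsEmbedLit : Prop :=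
  ∀ (X : Type) [TopologicalSpace X] [ChartedSpace E3 X] [IsManifold (𝓡 3) ∞ X] [T2Space X]
    [SecondCountableTopology X] [ConnectedSpace X] (D : InitialDataSet (𝓡 3) X)
    (𝒟 : VacuumCauchyDevelopment D), 𝒟.IsMaximal →
    ∀ (N : Type) [TopologicalSpace N] [ChartedSpace E3 N] [IsManifold (𝓡 3) ∞ N] [ConnectedSpace N]
      (Φ : N → X) (hΦ : ContMDiff (𝓡 3) (𝓡 3) ((((⊤ : ℕ∞) : WithTop ℕ∞)) + 1) Φ)
      (hΦ' : ∀ u, Injective (mfderiv (𝓡 3) (𝓡 3) Φ u)), IsOpenEmbedding Φ →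
      ∀ 𝒟' : VacuumCauchyDevelopment (D.comap Φ hΦ hΦ'),
      ∃ χ : 𝒟'.carrier → 𝒟.carrier, ContMDiff (𝓡 4) (𝓡 4) ∞ χ ∧ IsOpenEmbedding χ ∧
        𝒟'.metric.IsIsometricImmersion 𝒟.metric.toPseudoRiemannianMetric χ ∧
        𝒟'.timeOrientation.PreservesTimeOrientation χ 𝒟.timeOrientation ∧
        χ ∘ 𝒟'.embed = 𝒟.embed ∘ Φ


/-- **(E) `SubdevelopmentFuturePlacement`** — step (e) in general form: if a Cauchy development
`𝒦` (of any datum on any `N`) embeds isometrically, openly and future-preservingly into a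
spacetime `𝒮` by `χ`, then `χ` maps the chronological future of the Cauchy hypersurface of `𝒦`
into the FAITHFUL future domain of dependence `D⁺_𝒮(χ(ι_𝒦 N))` (`futureDomain`): a past-endless
causal curve of `𝒮` through `χ y` has a portion in the open set `χ(𝒦)` that is past-endless in
`χ(𝒦) ≅ 𝒦`, and in `𝒦` every past-endless causal curve through a point of `I⁺(ι N)` meets
`ι N` (O'Neill 1983, Lemma 14.29, one-sided form).  MISSING (pure causal theory; closable from
`OpensCausality`, `CauchyHypersurfaceTransfer`, `CauchyHypersurfaceCausalProofs`).  Route-posited statement of the line; nothing is asserted. [conjecture] [folklore] -/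
def SubdevelopmentFuturePlacement : Prop :=
  ∀ (N : Type) [TopologicalSpace N] [ChartedSpace E3 N] [IsManifold (𝓡 3) ∞ N] [ConnectedSpace N]
    (D₁ : InitialDataSet (𝓡 3) N) (𝒦 : CauchyDevelopment D₁) (𝒮 : Spacetime.{0} 4)
    (χ : 𝒦.carrier → 𝒮.carrier), ContMDiff (𝓡 4) (𝓡 4) ∞ χ → IsOpenEmbedding χ →
    𝒦.metric.IsIsometricImmersion 𝒮.metric.toPseudoRiemannianMetric χ →
    𝒦.timeOrientation.PreservesTimeOrientation χ 𝒮.timeOrientation →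
    χ '' (𝒦.metric.chronologicalFuture 𝒦.timeOrientation (range 𝒦.embed)) ⊆
      futureDomain 𝒮 (χ '' range 𝒦.embed)


end Statements

/-! ### The corrected F1 -/

variable {X : Type} [TopologicalSpace X] [ChartedSpace E3 X] [IsManifold (𝓡 3) ∞ X]
  [ConnectedSpace X] {D : InitialDataSet (𝓡 3) X}

/-- **F1' `SlabCauchyRigidity'`** — the CORRECTED slab-jet Cauchy rigidity: the registered
`K2Route.SlabCauchyRigidity` with (i) the additional hypothesis (H8) that the collar charts are
future-oriented on their slabs (`dΦᵢ(Λᵢ V)` future-directed, `V = −g♯dt*` the Kerr-star time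
orientation), and (ii) the diamond `slabDiamond` replaced by `slabDiamond' = {0 < t*, 3t* + 2r < 6M}`
(inside the Kerr future domain of dependence of the open slab for every `|a| < M`).  Route-posited statement of the line; nothing is asserted. [conjecture] [folklore] -/
def SlabCauchyRigidity' : Prop :=
  ∀ (k' : ℕ), 1 ≤ k' →
    ∀ (X : Type) [TopologicalSpace X] [ChartedSpace E3 X] [IsManifold (𝓡 3) ∞ X]
      [T2Space X] [SecondCountableTopology X] [ConnectedSpace X]
      (D : InitialDataSet (𝓡 3) X) (𝒱 : VacuumCauchyDevelopment D)
      (M a : Fin 1 → ℝ) (p : 𝒱.carrier) (mo : Fin 1 → lorentzGroup × E4)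
      (B : Fin 1 → ModelBackground) (Φ : ∀ i, (B i).domain → 𝒱.carrier),
    𝒱.IsMaximal → (∀ i, 0 < M i ∧ |a i| < M i) →
    (∃ i, p ∈ Φ i '' (B i).truncTimeSlab (3 * M i) 0) →
    (∀ i, B i = starBackground (mo i).1 (mo i).2 (M i) (a i)
      (fun x => Kerr.radius (a i) (poincareInv (mo i).1 (mo i).2 x))) →
    (∀ i, ContMDiffOn 𝓘(ℝ, E4) (𝓡 4) ∞ (Φ i)
        {x | -1 < (B i).time x.1 ∧ (B i).time x.1 < 1 ∧ (B i).radius x.1 < 3 * M i + 1} ∧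
      IsOpenEmbedding ({x | -1 < (B i).time x.1 ∧ (B i).time x.1 < 1 ∧
        (B i).radius x.1 < 3 * M i + 1}.restrict (Φ i))) →
    (∀ i, 𝒱.toSpacetime.truncDeviationCk (B i) (Φ i) k' (3 * M i) 0 ≤ 0) →
    collarCore M p B Φ ⊆ range 𝒱.embed →
    (∀ i, ∀ x ∈ (B i).truncTimeSlab (3 * M i) 0, 𝒱.timeOrientation.IsFutureDirected
      (mfderiv 𝓘(ℝ, E4) (𝓡 4) (Φ i) x
        (((mo i).1 : E4 ≃L[ℝ] E4) (Kerr.timeVector (M i) (a i) (poincareInv (mo i).1 (mo i).2 x.1))))) →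
    ∃ Ψ : (B 0).domain → 𝒱.carrier,
      (∀ x ∈ (B 0).truncTimeSlab (3 * M 0) 0, Ψ x = Φ 0 x) ∧
      ContinuousOn Ψ (slabDiamondWithSlab' (B 0) (M 0)) ∧
      ContMDiffOn 𝓘(ℝ, E4) (𝓡 4) ∞ Ψ (slabDiamond' (B 0) (M 0)) ∧
      IsOpenEmbedding ((slabDiamond' (B 0) (M 0)).restrict Ψ) ∧
      Ψ '' slabDiamond' (B 0) (M 0) ⊆ interior (killingDomain 𝒱 M p B Φ) ∧
      supCkENorm (Subtype.val '' slabDiamond' (B 0) (M 0)) 0 (𝒱.toSpacetime.deviationExtend (B 0) Ψ) ≤ 0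



/-! ### The checked reduction `F1' ⟸ (A) ∧ (C) ∧ (D) ∧ (E)` -/

section Reduction

variable {M a : ℝ}

/-- The image of the open slab under `ψ_N` is the Kerr-side open slab `slab°`. -/
theorem range_ψN_eq (M a : ℝ) : range (ψN M a) = slabKo M a := by
  ext z
  constructor
  · rintro ⟨y, rfl⟩
    exact ψN_mem_slabKo M a y
  · rintro ⟨h0, hr⟩
    have hz : (z : E4) = E4.ofTimeSpace 0 (E4.spatial (z : E4)) := by
      conv_lhs => rw [← E4.ofTimeSpace_time_spatial (z : E4)]
      rw [E4.time_apply, h0]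
    have hmem : E4.spatial (z : E4) ∈ Kerr.slice a M := by
      show max M 0 < Kerr.radius a (E4.ofTimeSpace 0 (E4.spatial (z : E4)))
      rw [← hz]; exact z.2
    refine ⟨⟨⟨E4.spatial (z : E4), hmem⟩, ?_⟩, ?_⟩
    · show Kerr.radius a (E4.ofTimeSpace 0 (E4.spatial (z : E4))) < 3 * M
      rw [← hz]; exact hr
    · exact Subtype.ext hz.symm


theorem isOpen_diamondK (M a : ℝ) : IsOpen (diamondK M a) := by
  have hr : Continuous fun y : Kerr.region a M => Kerr.radius a y.1 :=
    (Kerr.continuous_radius a).comp continuous_subtype_val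
  have h0 : Continuous fun x : E4 => x 0 := PiLp.continuous_apply 2 _ 0
  have ht : Continuous fun y : Kerr.region a M => y.1 0 := h0.comp continuous_subtype_val
  simp only [diamondK, Set.setOf_and]
  refine (isOpen_lt continuous_const ?_).inter (isOpen_lt continuous_const ?_) <;> fun_prop


/-- `Λ (Λ⁻¹(x − c)) + c = x`. -/
theorem lab_poincareInv (mo : lorentzGroup × E4) (x : E4) :
    (mo.1 : E4 ≃L[ℝ] E4) (poincareInv mo.1 mo.2 x) + mo.2 = x := by
  simp [poincareInv]


/-- `Λ⁻¹((Λ z + c) − c) = z`. -/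
theorem poincareInv_lab (mo : lorentzGroup × E4) (z : E4) :
    poincareInv mo.1 mo.2 ((mo.1 : E4 ≃L[ℝ] E4) z + mo.2) = z := by
  simp [poincareInv]


theorem poincareInv_injective (mo : lorentzGroup × E4) : Injective (poincareInv mo.1 mo.2) :=
  fun x y h => by rw [← lab_poincareInv mo x, ← lab_poincareInv mo y, h]


/-- The `C⁰` sup norm of a function vanishing on `S` is `≤ 0`. -/
theorem supCkENorm_zero_le_of_forall_eq_zero {F G : Type*} [NormedAddCommGroup F] [NormedSpace ℝ F]
    [NormedAddCommGroup G] [NormedSpace ℝ G] {S : Set F} {f : F → G} (h : ∀ x ∈ S, f x = 0) :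
    supCkENorm S 0 f ≤ 0 := by
  refine iSup₂_le fun m hm ↦ iSup₂_le fun x hx ↦ ?_
  obtain rfl : m = 0 := Nat.le_zero.mp hm
  have h0 : iteratedFDeriv ℝ 0 f x = 0 := by
    ext v
    rw [iteratedFDeriv_zero_apply, h x hx]
    rfl
  rw [h0, enorm_zero]


set_option maxHeartbeats 1600000 in
/-- **F1' from the route**: the corrected slab-jet Cauchy rigidity follows from the Kerr
sub-datum identification (A), the Kerr slab-lens Cauchy property (C), the localisation principle
(D) and the placement lemma (E).  Pure plumbing (the Kerr chart facts are discharged). -/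
theorem slabCauchyRigidity'_of_route (hA : SlabSubdatum) (hC : KerrSlabLensCauchy)
    (hD : SubdataDevelopmentsEmbedLit) (hE : SubdevelopmentFuturePlacement) : SlabCauchyRigidity' := by
  haveI : Kerr.Facts := kerrFacts
  haveI : Kerr.SliceFacts := Kerr.sliceFacts_holds
  intro k' hk' X _ _ _ _ _ _ D 𝒱 M a p mo B Φ hmax hpar hp hB hΦ hdev hCX hor
  have hM : 0 < M 0 := (hpar 0).1
  have ha : |a 0| < M 0 := (hpar 0).2
  have hslab : Φ 0 '' (B 0).truncTimeSlab (3 * M 0) 0 ⊆ range 𝒱.embed :=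
    (image_truncTimeSlab_subset_collarCore M p B Φ 0).trans hCX
  -- (A): the Kerr sub-datum
  obtain ⟨ΦN, hΦN, hΦN', hΦNo, hιΦ, hh, hk⟩ :=
    hA k' hk' X D 𝒱 (M 0) (a 0) (mo 0) (B 0) (Φ 0) hM ha (hB 0) (hΦ 0) (hdev 0) hslab (hor 0)
  -- (C): the Kerr slab lens
  obtain ⟨hNconn, hLconn, hCauchy, hI⟩ := hC (M 0) (a 0) hM ha
  haveI : ConnectedSpace (slabW (M 0) (a 0)) := isConnected_iff_connectedSpace.mp hNconn
  -- the Kerr-side data embedding of the sub-datum `Φ_N^* D`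
  set Dₑ : InitialDataSet (𝓡 3) (slabW (M 0) (a 0)) := D.comap ΦN hΦN hΦN' with hDₑ
  have hψemb : Manifold.IsSmoothEmbedding 𝓘(ℝ, E3) 𝓘(ℝ, E4) ∞ (ψN (M 0) (a 0)) :=
    isSmoothEmbedding_comp_subtypeVal (Kerr.isSmoothEmbedding_sliceEmbed_holds (a 0) (M 0))
  have hνN : (Kerr.smoothMetric (M 0) (a 0) (M 0)).IsFutureUnitNormal 𝓘(ℝ, E3)
      ((Kerr.timeOrientation (M 0) (a 0) (M 0) hM.le).ofLE le_top) (ψN (M 0) (a 0)) (νN (M 0) (a 0)) := by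
    obtain ⟨hu, hf⟩ := Kerr.isFutureUnitNormal_sliceNormal_holds (M 0) (a 0) (M 0) hM.le
    refine ⟨hu.comp_subtypeVal fun y => ?_, fun y => hf y.1⟩
    exact ((Kerr.isSmoothEmbedding_sliceEmbed_holds (a 0) (M 0)).contMDiff y).mdifferentiableAt
      (by simp)
  let 𝒮K : DataEmbedding Dₑ :=
    { toSpacetime := Kerr.spacetime (M 0) (a 0) (M 0) hM.le
      embed := ψN (M 0) (a 0)
      isSmoothEmbedding := hψemb
      normal := νN (M 0) (a 0)
      isFutureUnitNormal := hνN
      induced_h := fun y ↦ by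
        ext v w
        exact (hh y v w).symm
      induced_k := by
        intro instLC y
        haveI : (Kerr.smoothMetric (M 0) (a 0) (M 0)).HasLeviCivita := instLC
        ext v w
        exact (hk y v w).symm }
  have hvac : 𝒮K.IsVacuum := by
    intro instLC x
    haveI : (Kerr.metric (M 0) (a 0) (M 0)).HasLeviCivita := instLC
    exact Kerr.ricci_smoothMetric (M 0) (a 0) (M 0) x
  -- restriction to the lens: a vacuum Cauchy development of the sub-datum
  set L : Opens (Kerr.region (a 0) (M 0)) := ⟨lensK (M 0) (a 0), isOpen_lensK (M 0) (a 0)⟩ with hL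
  have hιL : ∀ y, 𝒮K.embed y ∈ L := fun y => slabKo_subset_lensK (ψN_mem_slabKo (M 0) (a 0) y)
  have hrange : range (𝒮K.embedOpens L hιL) = Subtype.val ⁻¹' slabKo (M 0) (a 0) := by
    ext z
    rw [← range_ψN_eq]
    constructor
    · rintro ⟨y, rfl⟩; exact ⟨y, rfl⟩
    · rintro ⟨y, hy⟩; exact ⟨y, Subtype.ext hy⟩
  let 𝒦 : VacuumCauchyDevelopment Dₑ :=
    { toDataEmbedding := 𝒮K.restrict L hLconn hιL 𝒮K.mdifferentiableAt_embed_normal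
      isCauchyHypersurface := by
        show ((𝒮K.metric.restrict PseudoRiemannianMetric.contMDiff_restrict_holds L).IsCauchyHypersurface
          (𝒮K.timeOrientation.restrict PseudoRiemannianMetric.contMDiff_restrict_holds
            𝒮K.timeOrientation.contMDiff_restrict_holds L) (range (𝒮K.embedOpens L hιL)))
        rw [hrange]
        exact hCauchy
      isRicciFlat := by
        intro instLC
        haveI : (𝒮K.metric.restrict PseudoRiemannianMetric.contMDiff_restrict_holds
            L).toPseudoRiemannianMetric.HasLeviCivita := instLC
        exact 𝒮K.isRicciFlat_restrict L hvac }
  -- (D): the lens development embeds into the maximal development over `Φ_N`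
  obtain ⟨χ, hχs, hχo, hχi, hχt, hχe⟩ := hD X D 𝒱 hmax (slabW (M 0) (a 0)) ΦN hΦN hΦN' hΦNo 𝒦
  -- (E): placement of the chronological future of the slab
  have hplace := hE (slabW (M 0) (a 0)) Dₑ 𝒦.toCauchyDevelopment 𝒱.toSpacetime χ hχs hχo hχi hχt
  /- ### the rest-frame map `P = Λ⁻¹(· − c)` from the background domain onto the Kerr chart -/
  set P : E4 → E4 := poincareInv (mo 0).1 (mo 0).2 with hP
  have hdom : ((B 0).domain : Set E4) = P ⁻¹' (Kerr.region (a 0) (M 0) : Set E4) := by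
    rw [hB 0]; rfl
  have htime : (B 0).time = fun x => P x 0 := by rw [hB 0]; rfl
  have hrad : (B 0).radius = fun x => Kerr.radius (a 0) (P x) := by rw [hB 0]; rfl
  have hbil : (B 0).bilin = boostedKerrBilin (mo 0).1 (mo 0).2 (M 0) (a 0) := by rw [hB 0]; rfl
  have hPreg : ∀ x : (B 0).domain, P x.1 ∈ Kerr.region (a 0) (M 0) := fun x => by
    have hx : (x.1 : E4) ∈ ((B 0).domain : Set E4) := x.2
    rw [hdom] at hx
    exact hx
  set Pr : (B 0).domain → Kerr.region (a 0) (M 0) := fun x => ⟨P x.1, hPreg x⟩ with hPr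
  have hPrs : ContMDiff 𝓘(ℝ, E4) 𝓘(ℝ, E4) ∞ Pr := by
    rw [← ContMDiff.subtypeVal_comp_iff]
    intro x
    exact contMDiffAt_subtype_iff.2 (KerrSchildChart.contDiff_poincareInv (mo 0).1 (mo 0).2).contMDiff.contMDiffAt
  have hdPr : ∀ x : (B 0).domain, mfderiv 𝓘(ℝ, E4) 𝓘(ℝ, E4) Pr x =
      (((mo 0).1 : E4 ≃L[ℝ] E4).symm : E4 →L[ℝ] E4) := fun x => by
    have h1 : MDifferentiableAt 𝓘(ℝ, E4) 𝓘(ℝ, E4) (fun x : (B 0).domain => P x.1) x := by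
      have := (KerrSchildChart.contDiff_poincareInv (mo 0).1 (mo 0).2 (n := ∞)).contMDiff.contMDiffAt (x := x.1)
      exact (contMDiffAt_subtype_iff.2 this).mdifferentiableAt (by simp)
    rw [OpensChart.mfderiv_codRestrict (f := fun x : (B 0).domain => P x.1) (fun _ => rfl) h1]
    rw [show (fun x : (B 0).domain => P x.1) = P ∘ Subtype.val from rfl,
      mfderiv_comp_subtypeVal (((KerrSchildChart.contDiff_poincareInv (mo 0).1 (mo 0).2 (n := ∞)).contMDiff.contMDiffAt
        (x := x.1)).mdifferentiableAt (by simp)), mfderiv_eq_fderiv, KerrSchildChart.fderiv_poincareInv]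
  have hPrinj : Injective Pr := fun x y h =>
    Subtype.ext (poincareInv_injective (mo 0) (congrArg Subtype.val h))
  -- `Pr` as a homeomorphism
  have hlab : ∀ z : Kerr.region (a 0) (M 0), ((mo 0).1 : E4 ≃L[ℝ] E4) z.1 + (mo 0).2 ∈ (B 0).domain := by
    intro z
    show ((mo 0).1 : E4 ≃L[ℝ] E4) z.1 + (mo 0).2 ∈ ((B 0).domain : Set E4)
    rw [hdom, mem_preimage, show P (((mo 0).1 : E4 ≃L[ℝ] E4) z.1 + (mo 0).2) = z.1 from
      poincareInv_lab (mo 0) z.1]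
    exact z.2
  let PrH : (B 0).domain ≃ₜ Kerr.region (a 0) (M 0) :=
    { toFun := Pr
      invFun := fun z => ⟨((mo 0).1 : E4 ≃L[ℝ] E4) z.1 + (mo 0).2, hlab z⟩
      left_inv := fun x => Subtype.ext (lab_poincareInv (mo 0) x.1)
      right_inv := fun z => Subtype.ext (poincareInv_lab (mo 0) z.1)
      continuous_toFun := hPrs.continuous
      continuous_invFun := by
        refine Continuous.subtype_mk ?_ _
        exact ((((mo 0).1 : E4 ≃L[ℝ] E4).continuous.comp continuous_subtype_val).add continuous_const) }
  /- ### the chart `Ψ` -/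
  classical
  set pull : Set (B 0).domain := Pr ⁻¹' lensK (M 0) (a 0) with hpull
  have hpullo : IsOpen pull := (isOpen_lensK (M 0) (a 0)).preimage hPrs.continuous
  let Ψ : (B 0).domain → 𝒱.carrier := fun x => if h : Pr x ∈ lensK (M 0) (a 0) then χ ⟨Pr x, h⟩ else Φ 0 x
  have hΨ_of : ∀ x (h : Pr x ∈ lensK (M 0) (a 0)), Ψ x = χ ⟨Pr x, h⟩ := fun x h => dif_pos h
  -- the extension of `χ` off the lens, for the calculus
  let χ' : Kerr.region (a 0) (M 0) → 𝒱.carrier := fun z => if h : z ∈ lensK (M 0) (a 0) then χ ⟨z, h⟩ else p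
  have hχ'L : (fun z : L => χ' z.1) = χ := funext fun z => dif_pos z.2
  have hχ'at : ∀ z : Kerr.region (a 0) (M 0), z ∈ lensK (M 0) (a 0) →
      ContMDiffAt 𝓘(ℝ, E4) (𝓡 4) ∞ χ' z := fun z hz => by
    have h : ContMDiffAt 𝓘(ℝ, E4) (𝓡 4) ∞ (fun z : L => χ' z.1) ⟨z, hz⟩ := by rw [hχ'L]; exact hχs ⟨z, hz⟩
    exact contMDiffAt_subtype_iff.1 h
  have hdχ' : ∀ z : L, mfderiv (𝓡 4) (𝓡 4) χ z = mfderiv 𝓘(ℝ, E4) (𝓡 4) χ' z.1 := fun z => by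
    rw [← hχ'L]
    exact mfderiv_comp_subtypeVal ((hχ'at z.1 z.2).mdifferentiableAt (by simp))
  have hΨeq : ∀ x ∈ pull, Ψ =ᶠ[𝓝 x] (χ' ∘ Pr) := fun x hx => by
    filter_upwards [hpullo.mem_nhds hx] with y hy
    rw [hΨ_of y hy]
    have hy' : Pr y ∈ lensK (M 0) (a 0) := hy
    show χ ⟨Pr y, hy⟩ = χ' (Pr y)
    simp only [χ']
    rw [dif_pos hy']
  have hΨat : ∀ x ∈ pull, ContMDiffAt 𝓘(ℝ, E4) (𝓡 4) ∞ Ψ x := fun x hx =>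
    ((hχ'at (Pr x) hx).comp x (hPrs x)).congr_of_eventuallyEq (hΨeq x hx)
  have hΨon : ContMDiffOn 𝓘(ℝ, E4) (𝓡 4) ∞ Ψ pull := fun x hx => (hΨat x hx).contMDiffWithinAt
  have hdΨ : ∀ (x : (B 0).domain) (hx : x ∈ pull) (v : E4), mfderiv 𝓘(ℝ, E4) (𝓡 4) Ψ x v =
      mfderiv 𝓘(ℝ, E4) (𝓡 4) χ' (Pr x) ((((mo 0).1 : E4 ≃L[ℝ] E4).symm : E4 →L[ℝ] E4) v) := by
    intro x hx v
    rw [(hΨeq x hx).mfderiv_eq, mfderiv_comp x ((hχ'at (Pr x) hx).mdifferentiableAt (by simp))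
      (hPrs.mdifferentiableAt (by simp)), hdPr x]
    rfl
  -- `χ'` is isometric on the lens (chart form)
  have hisoχ' : ∀ (z : Kerr.region (a 0) (M 0)) (hz : z ∈ lensK (M 0) (a 0)) (u u' : E4),
      𝒱.metric.val (χ' z) (mfderiv 𝓘(ℝ, E4) (𝓡 4) χ' z u) (mfderiv 𝓘(ℝ, E4) (𝓡 4) χ' z u') =
        Kerr.bilin (M 0) (a 0) z.1 u u' := by
    intro z hz u u'
    have e1 : χ' z = χ ⟨z, hz⟩ := dif_pos hz
    have e2 : mfderiv 𝓘(ℝ, E4) (𝓡 4) χ' z = mfderiv (𝓡 4) (𝓡 4) χ ⟨z, hz⟩ := (hdχ' ⟨z, hz⟩).symm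
    have h := congrArg (fun b => b u u') (hχi.2 ⟨z, hz⟩)
    simp only [pullbackBilin_apply] at h
    rw [e1, e2]
    exact h
  -- exactness of `Ψ` on `pull`
  have hexact : ∀ x ∈ pull, 𝒱.toSpacetime.deviation (B 0) Ψ x = 0 := by
    intro x hx
    ext v w
    have hx' : Pr x ∈ lensK (M 0) (a 0) := hx
    have e1 : χ' (Pr x) = χ ⟨Pr x, hx⟩ := dif_pos hx'
    rw [Spacetime.deviation_apply, hdΨ x hx v, hdΨ x hx w, hΨ_of x hx, ← e1, hisoχ' (Pr x) hx, hbil,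
      boostedKerrBilin_apply]
    exact sub_self _
  -- arithmetic: the corrected diamond pulls back into the lens
  have hmem_pull : ∀ x : (B 0).domain, 0 ≤ (B 0).time x.1 →
      3 * (B 0).time x.1 + 2 * (B 0).radius x.1 < 6 * M 0 → x ∈ pull := by
    intro x h0 h1
    rw [htime] at h0 h1; rw [hrad] at h1
    have hMr : M 0 < Kerr.radius (a 0) (P x.1) := (le_max_left (M 0) 0).trans_lt (hPreg x)
    change 0 ≤ P x.1 0 at h0
    change 3 * P x.1 0 + 2 * Kerr.radius (a 0) (P x.1) < 6 * M 0 at h1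
    show (0 < 6 * M 0 - 2 * Kerr.radius (a 0) (P x.1) - 3 * P x.1 0 ∧
      0 < 6 * M 0 - 2 * Kerr.radius (a 0) (P x.1) + 3 * P x.1 0 ∧
      0 < 2 * P x.1 0 + (Kerr.radius (a 0) (P x.1) - M 0))
    exact ⟨by linarith, by linarith, by linarith⟩
  have hDsub : slabDiamond' (B 0) (M 0) ⊆ pull := fun x hx => hmem_pull x hx.1.le hx.2
  have hDSsub : slabDiamondWithSlab' (B 0) (M 0) ⊆ pull := fun x hx => hmem_pull x hx.1 hx.2
  have hDdia : ∀ x ∈ slabDiamond' (B 0) (M 0), Pr x ∈ diamondK (M 0) (a 0) := by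
    intro x hx
    obtain ⟨h0, h1⟩ := hx
    rw [htime] at h0 h1; rw [hrad] at h1
    change 0 < P x.1 0 at h0
    change 3 * P x.1 0 + 2 * Kerr.radius (a 0) (P x.1) < 6 * M 0 at h1
    exact ⟨h0, by show 0 < 6 * M 0 - 2 * Kerr.radius (a 0) (P x.1) - 3 * P x.1 0; linarith⟩
  -- the slab points of the lens are the images of `Φ₀`
  have hχembed : ∀ y : slabW (M 0) (a 0), χ (𝒦.embed y) = 𝒱.embed (ΦN y) := fun y => congrFun hχe y
  have hslab_eq : ∀ (x : (B 0).domain) (hx : Pr x ∈ lensK (M 0) (a 0)), (B 0).time x.1 = 0 →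
      Ψ x = Φ 0 x ∧ Ψ x ∈ Φ 0 '' (B 0).truncTimeSlab (3 * M 0) 0 := by
    intro x hx ht0
    rw [htime] at ht0
    change P x.1 0 = 0 at ht0
    have hr3 : Kerr.radius (a 0) (P x.1) < 3 * M 0 := by
      have := hx.1; rw [ht0] at this; linarith
    have hmem : (⟨Pr x, hx⟩ : L) ∈ range (𝒮K.embedOpens L hιL) := by
      rw [hrange]; exact ⟨ht0, hr3⟩
    obtain ⟨y, hy⟩ := hmem
    have hval : E4.ofTimeSpace 0 (y : E3) = P x.1 := congrArg (fun z : L => (z.1.1 : E4)) hy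
    have hΨy : Ψ x = χ (𝒦.embed y) := by rw [hΨ_of x hx]; exact congrArg χ hy.symm
    obtain ⟨hxmem, hΦeq⟩ := hιΦ y
    have hpt : (⟨((mo 0).1 : E4 ≃L[ℝ] E4) (E4.ofTimeSpace 0 (y : E3)) + (mo 0).2, hxmem⟩ : (B 0).domain) = x := by
      apply Subtype.ext
      show ((mo 0).1 : E4 ≃L[ℝ] E4) (E4.ofTimeSpace 0 (y : E3)) + (mo 0).2 = x.1
      rw [hval]; exact lab_poincareInv (mo 0) x.1
    have key : Ψ x = Φ 0 x := by rw [hΨy, hχembed y, hΦeq, hpt]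
    refine ⟨key, ?_⟩
    rw [key]
    refine ⟨x, ⟨?_, ?_⟩, rfl⟩
    · rw [htime]; exact ht0
    · rw [hrad]; exact hr3.le
  refine ⟨Ψ, ?_, ?_, hΨon.mono hDsub, ?_, ?_, ?_⟩
  · -- (1) `Ψ = Φ₀` on the closed slab
    intro x hx
    by_cases h : Pr x ∈ lensK (M 0) (a 0)
    · exact (hslab_eq x h hx.1).1
    · exact dif_neg h
  · -- (2) continuity on `Δ' ∪ slab°`
    exact hΨon.continuousOn.mono hDSsub
  · -- (4) open embedding of `Δ'`
    have hsubL : diamondK (M 0) (a 0) ⊆ (L : Set (Kerr.region (a 0) (M 0))) := diamondK_subset_lensK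
    have hincl : IsOpenEmbedding (Set.inclusion hsubL) :=
      IsOpenEmbedding.inclusion hsubL (continuous_subtype_val.isOpen_preimage _ (isOpen_diamondK _ _))
    have hiff : ∀ x : (B 0).domain, x ∈ slabDiamond' (B 0) (M 0) ↔ PrH x ∈ diamondK (M 0) (a 0) := by
      intro x
      refine ⟨fun hx => hDdia x hx, fun hx => ?_⟩
      obtain ⟨h0, h1⟩ := hx
      change 0 < P x.1 0 at h0
      change 0 < 6 * M 0 - 2 * Kerr.radius (a 0) (P x.1) - 3 * P x.1 0 at h1
      refine ⟨?_, ?_⟩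
      · rw [htime]; exact h0
      · rw [htime, hrad]; show 3 * P x.1 0 + 2 * Kerr.radius (a 0) (P x.1) < 6 * M 0; linarith
    let Qd : slabDiamond' (B 0) (M 0) ≃ₜ diamondK (M 0) (a 0) := PrH.subtype hiff
    have hcomp : (slabDiamond' (B 0) (M 0)).restrict Ψ = χ ∘ Set.inclusion hsubL ∘ Qd := by
      funext x
      exact hΨ_of x.1 (hDsub x.2)
    rw [hcomp]
    exact hχo.comp (hincl.comp Qd.isOpenEmbedding)
  · -- (5) placement inside the interior of the Killing domain
    set T : Set L := Subtype.val ⁻¹' diamondK (M 0) (a 0) with hT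
    have hTo : IsOpen T := (isOpen_diamondK _ _).preimage continuous_subtype_val
    have himg : Ψ '' slabDiamond' (B 0) (M 0) ⊆ χ '' T := by
      rintro _ ⟨x, hx, rfl⟩
      exact ⟨⟨Pr x, hDsub hx⟩, hDdia x hx, (hΨ_of x (hDsub hx)).symm⟩
    have hTI : T ⊆ 𝒦.metric.chronologicalFuture 𝒦.timeOrientation (range 𝒦.embed) := by
      show T ⊆ (𝒮K.metric.restrict PseudoRiemannianMetric.contMDiff_restrict_holds L).chronologicalFuture
        (𝒮K.timeOrientation.restrict PseudoRiemannianMetric.contMDiff_restrict_holds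
          𝒮K.timeOrientation.contMDiff_restrict_holds L) (range (𝒮K.embedOpens L hιL))
      rw [hrange]
      exact hI
    have hcore : χ '' range 𝒦.embed ⊆ collarCore M p B Φ := by
      rintro _ ⟨_, ⟨y, rfl⟩, rfl⟩
      rw [hχembed y]
      obtain ⟨hxmem, hΦeq⟩ := hιΦ y
      rw [hΦeq]
      refine image_truncTimeSlab_subset_collarCore M p B Φ 0 ⟨_, ⟨?_, ?_⟩, rfl⟩
      · rw [htime]
        show poincareInv (mo 0).1 (mo 0).2 (((mo 0).1 : E4 ≃L[ℝ] E4) (E4.ofTimeSpace 0 (y : E3)) + (mo 0).2) 0 = 0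
        rw [poincareInv_lab]; rfl
      · rw [hrad]
        show Kerr.radius (a 0) (poincareInv (mo 0).1 (mo 0).2
          (((mo 0).1 : E4 ≃L[ℝ] E4) (E4.ofTimeSpace 0 (y : E3)) + (mo 0).2)) ≤ 3 * M 0
        rw [poincareInv_lab]; exact y.2.le
    have hsub : χ '' T ⊆ killingDomain 𝒱 M p B Φ :=
      ((image_mono hTI).trans hplace).trans
        ((futureDomain_mono _ hcore).trans (futureDomain_mono _ subset_union_left))
    exact himg.trans (interior_maximal hsub (hχo.isOpenMap _ hTo))
  · -- (6) exactness on `Δ'`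
    refine supCkENorm_zero_le_of_forall_eq_zero ?_
    rintro _ ⟨x, hx, rfl⟩
    rw [Spacetime.deviationExtend_coe]
    exact hexact x (hDsub hx)


end Reduction


/-! ### Splitting (A): (A1) the factorisation through `ι(X)` and (A2) the jet identities -/

section SplitA

/-- **(A1) `SlabFactorisation`** — step (a): the collar chart restricted to the open slab factors
smoothly through the embedded Cauchy hypersurface `ι(X)`: `Φ₀ ∘ (y ↦ Λ(0,y) + c) = ι ∘ Φ_N` with
`Φ_N : slabW → X` smooth, with injective differentials and an open embedding.  (Exactness at
order `0` makes `dΦ₀` injective at slab points.)  PROVED below (`slabFactorisation_holds`).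
Route statement of the line. [conjecture] [folklore] -/
def SlabFactorisation : Prop :=
  ∀ (k' : ℕ) (X : Type) [TopologicalSpace X] [ChartedSpace E3 X] [IsManifold (𝓡 3) ∞ X]
      [T2Space X] [SecondCountableTopology X] [ConnectedSpace X]
      (D : InitialDataSet (𝓡 3) X) (𝒱 : VacuumCauchyDevelopment D)
      (M a : ℝ) (mo : lorentzGroup × E4) (B : ModelBackground) (Φ₀ : B.domain → 𝒱.carrier),
    0 < M → |a| < M →
    B = starBackground mo.1 mo.2 M a (fun x => Kerr.radius a (poincareInv mo.1 mo.2 x)) →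
    (ContMDiffOn 𝓘(ℝ, E4) (𝓡 4) ∞ Φ₀
        {x | -1 < B.time x.1 ∧ B.time x.1 < 1 ∧ B.radius x.1 < 3 * M + 1} ∧
      IsOpenEmbedding ({x | -1 < B.time x.1 ∧ B.time x.1 < 1 ∧
        B.radius x.1 < 3 * M + 1}.restrict Φ₀)) →
    𝒱.toSpacetime.truncDeviationCk B Φ₀ k' (3 * M) 0 ≤ 0 →
    Φ₀ '' B.truncTimeSlab (3 * M) 0 ⊆ range 𝒱.embed →
    ∃ ΦN : slabW M a → X, ContMDiff (𝓡 3) (𝓡 3) ((((⊤ : ℕ∞) : WithTop ℕ∞)) + 1) ΦN ∧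
      (∀ u, Injective (mfderiv (𝓡 3) (𝓡 3) ΦN u)) ∧ IsOpenEmbedding ΦN ∧
      (∀ y : slabW M a, ∃ hx : ((mo.1 : E4 ≃L[ℝ] E4) (E4.ofTimeSpace 0 (y : E3)) + mo.2) ∈ B.domain,
          𝒱.embed (ΦN y) = Φ₀ ⟨_, hx⟩)


/-- **(A2) `SlabJetIdentities`** — step (b): for ANY smooth `Φ_N` through which the collar chart
factors on the open slab, the exact `1`-jet (`k' ≥ 1`) of the future-oriented collar chart gives
`Φ_N^* h = ψ_N^* g_{M,a}` (order `0`) and `Φ_N^* k = K_{ν_N}(ψ_N)` (order `1`: Christoffel symbols at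
slab points, `OpensChart.secondFundamentalForm_eq_of_repr`; the normal pinned pointwise on the slab by
(H8), `TimeOrientation.eq_of_isFutureUnitNormal`; naturality `secondFundamentalForm_comp_right`,
`secondFundamentalForm_comap`).  MISSING (true on paper; the `h`-identity is elementary).
Route statement of the line. [conjecture] [folklore] -/
def SlabJetIdentities : Prop :=
  ∀ [Kerr.Facts] [Kerr.SliceFacts] (k' : ℕ), 1 ≤ k' →
    ∀ (X : Type) [TopologicalSpace X] [ChartedSpace E3 X] [IsManifold (𝓡 3) ∞ X]
      [T2Space X] [SecondCountableTopology X] [ConnectedSpace X]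
      (D : InitialDataSet (𝓡 3) X) (𝒱 : VacuumCauchyDevelopment D)
      (M a : ℝ) (mo : lorentzGroup × E4) (B : ModelBackground) (Φ₀ : B.domain → 𝒱.carrier),
    0 < M → |a| < M →
    B = starBackground mo.1 mo.2 M a (fun x => Kerr.radius a (poincareInv mo.1 mo.2 x)) →
    (ContMDiffOn 𝓘(ℝ, E4) (𝓡 4) ∞ Φ₀
        {x | -1 < B.time x.1 ∧ B.time x.1 < 1 ∧ B.radius x.1 < 3 * M + 1} ∧
      IsOpenEmbedding ({x | -1 < B.time x.1 ∧ B.time x.1 < 1 ∧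
        B.radius x.1 < 3 * M + 1}.restrict Φ₀)) →
    𝒱.toSpacetime.truncDeviationCk B Φ₀ k' (3 * M) 0 ≤ 0 →
    Φ₀ '' B.truncTimeSlab (3 * M) 0 ⊆ range 𝒱.embed →
    (∀ x ∈ B.truncTimeSlab (3 * M) 0, 𝒱.timeOrientation.IsFutureDirected
      (mfderiv 𝓘(ℝ, E4) (𝓡 4) Φ₀ x
        ((mo.1 : E4 ≃L[ℝ] E4) (Kerr.timeVector M a (poincareInv mo.1 mo.2 x.1))))) →
    ∀ (ΦN : slabW M a → X), ContMDiff (𝓡 3) (𝓡 3) ((((⊤ : ℕ∞) : WithTop ℕ∞)) + 1) ΦN →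
      (∀ y : slabW M a, ∃ hx : ((mo.1 : E4 ≃L[ℝ] E4) (E4.ofTimeSpace 0 (y : E3)) + mo.2) ∈ B.domain,
          𝒱.embed (ΦN y) = Φ₀ ⟨_, hx⟩) →
      (∀ (y : slabW M a) (v w : E3),
          D.h.inner (ΦN y) (mfderiv (𝓡 3) (𝓡 3) ΦN y v) (mfderiv (𝓡 3) (𝓡 3) ΦN y w) =
            Kerr.bilin M a (ψN M a y : E4) (mfderiv 𝓘(ℝ, E3) 𝓘(ℝ, E4) (ψN M a) y v)
              (mfderiv 𝓘(ℝ, E3) 𝓘(ℝ, E4) (ψN M a) y w)) ∧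
      (∀ [(Kerr.smoothMetric M a M).HasLeviCivita] (y : slabW M a) (v w : E3),
          D.k (ΦN y) (mfderiv (𝓡 3) (𝓡 3) ΦN y v) (mfderiv (𝓡 3) (𝓡 3) ΦN y w) =
            (Kerr.smoothMetric M a M).secondFundamentalForm 𝓘(ℝ, E3) (ψN M a) (νN M a) y v w)


/-- (A) from (A1) and (A2) (pure logic). -/
theorem slabSubdatum_of (h1 : SlabFactorisation) (h2 : SlabJetIdentities) : SlabSubdatum := by
  intro _ _ k' hk' X _ _ _ _ _ _ D 𝒱 M a mo B Φ₀ hM ha hB hΦ hdev hslab hor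
  obtain ⟨ΦN, hΦN, hΦN', hΦNo, hιΦ⟩ := h1 k' X D 𝒱 M a mo B Φ₀ hM ha hB hΦ hdev hslab
  obtain ⟨hh, hk⟩ := h2 k' hk' X D 𝒱 M a mo B Φ₀ hM ha hB hΦ hdev hslab hor ΦN hΦN hιΦ
  exact ⟨ΦN, hΦN, hΦN', hΦNo, hιΦ, hh, fun y v w => hk y v w⟩


end SplitA

/-! ### (A1) proved: the factorisation through the Cauchy hypersurface -/

set_option synthInstance.maxHeartbeats 200000 in
/-- Exactness at order `0` on the slab: the deviation vanishes at slab points. -/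
theorem deviation_eq_zero_of_truncDeviationCk_le_zero {𝒮 : Spacetime.{0} 4} {B : ModelBackground}
    {Φ₀ : B.domain → 𝒮.carrier} {k : ℕ} {R τ : ℝ} (h : 𝒮.truncDeviationCk B Φ₀ k R τ ≤ 0)
    {x : B.domain} (hx : x ∈ B.truncTimeSlab R τ) : 𝒮.deviation B Φ₀ x = 0 := by
  have hle := (enorm_iteratedFDeriv_le_supCkENorm (k := k) (m := 0) (Nat.zero_le _)
    (mem_image_of_mem Subtype.val hx) (𝒮.deviationExtend B Φ₀)).trans h
  have h0 : iteratedFDeriv ℝ 0 (𝒮.deviationExtend B Φ₀) x.1 = 0 := by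
    have := le_antisymm hle zero_le
    rwa [enorm_eq_zero] at this
  have h1 := congrArg (fun F => F Fin.elim0) h0
  simp only [iteratedFDeriv_zero_apply, Spacetime.deviationExtend_coe] at h1
  exact h1


set_option maxHeartbeats 1600000 in
/-- **(A1) holds** — `slabFactorisation_holds : SlabFactorisation`: `Φ₀ ∘ (y ↦ Λ(0,y) + c)` is a
smooth map of the open slab into `𝒱` with image in `ι(X)`, hence factors smoothly through the
embedding `ι` (`Literature.Geometry.Manifold.exists_contMDiff_comp_eq_of_range_subset`); the
factor has injective differentials (`dΦ₀` is injective at slab points by order-`0` exactness and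
the nondegeneracy of `g_{M,a}`), is injective, and is a local diffeomorphism
(`isLocalDiffeomorphAt_of_mfderiv`), hence an open embedding. [cite: LeeSmoothManifolds2013, Cor. 5.30] -/
theorem slabFactorisation_holds : SlabFactorisation := by
  intro k' X _ _ _ _ _ _ D 𝒱 M a mo B Φ₀ hM ha hB hΦ hdev hslab
  set P : E4 → E4 := poincareInv mo.1 mo.2 with hP
  have hdom : (B.domain : Set E4) = P ⁻¹' (Kerr.region a M : Set E4) := by rw [hB]; rfl
  have htime : B.time = fun x => P x 0 := by rw [hB]; rfl
  have hrad : B.radius = fun x => Kerr.radius a (P x) := by rw [hB]; rfl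
  have hbil : B.bilin = boostedKerrBilin mo.1 mo.2 M a := by rw [hB]; rfl
  have hPreg : ∀ x : B.domain, P x.1 ∈ Kerr.region a M := fun x => by
    have hx : (x.1 : E4) ∈ (B.domain : Set E4) := x.2
    rw [hdom] at hx
    exact hx
  -- the affine representative `A z = Λ (0, z) + c` and the lab-frame slab embedding `eN`
  set A : E3 → E4 := fun z => (mo.1 : E4 ≃L[ℝ] E4) (E4.ofTimeSpace 0 z) + mo.2 with hA
  have hPA : ∀ z, P (A z) = E4.ofTimeSpace 0 z := fun z => poincareInv_lab mo _
  have hAd : ∀ z, HasFDerivAt A (((mo.1 : E4 ≃L[ℝ] E4) : E4 →L[ℝ] E4).comp E4.spaceEmbed) z :=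
    fun z => (((mo.1 : E4 ≃L[ℝ] E4) : E4 →L[ℝ] E4).hasFDerivAt.comp z
      (E4.hasFDerivAt_ofTimeSpace 0 z)).add_const mo.2
  have hAs : ContDiff ℝ ∞ A :=
    (((mo.1 : E4 ≃L[ℝ] E4) : E4 →L[ℝ] E4).contDiff.comp (E4.contDiff_ofTimeSpace 0)).add
      contDiff_const
  have hAinj : Injective A := fun z₁ z₂ h => by
    have := congrArg P h
    rw [hPA, hPA] at this
    exact E4.ofTimeSpace_injective 0 this
  have hmem : ∀ y : slabW M a, A (y : E3) ∈ B.domain := fun y => by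
    show A (y : E3) ∈ (B.domain : Set E4)
    rw [hdom, mem_preimage, hPA]
    exact Kerr.mem_slice_iff_ofTimeSpace_mem_region.1 y.1.2
  set eN : slabW M a → B.domain := fun y => ⟨A (y : E3), hmem y⟩ with heN
  have heNs : ContMDiff 𝓘(ℝ, E3) 𝓘(ℝ, E4) ∞ eN := by
    rw [← ContMDiff.subtypeVal_comp_iff]
    exact (hAs.contMDiff.comp contMDiff_subtype_val).comp contMDiff_subtype_val
  have hdeN : ∀ y : slabW M a, mfderiv 𝓘(ℝ, E3) 𝓘(ℝ, E4) eN y =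
      (((mo.1 : E4 ≃L[ℝ] E4) : E4 →L[ℝ] E4).comp E4.spaceEmbed) := by
    intro y
    have hdAz : MDifferentiableAt 𝓘(ℝ, E3) 𝓘(ℝ, E4) (fun z : Kerr.slice a M => A z.1) y.1 :=
      ((hAs.contMDiff.comp contMDiff_subtype_val) y.1).mdifferentiableAt (by simp)
    have hd1 : MDifferentiableAt 𝓘(ℝ, E3) 𝓘(ℝ, E4) (fun y : slabW M a => A (y : E3)) y :=
      (((hAs.contMDiff.comp contMDiff_subtype_val).comp contMDiff_subtype_val) y).mdifferentiableAt
        (by simp)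
    rw [OpensChart.mfderiv_codRestrict (f := fun y : slabW M a => A (y : E3)) (fun _ => rfl) hd1,
      show (fun y : slabW M a => A (y : E3)) = (fun z : Kerr.slice a M => A z.1) ∘ Subtype.val from rfl,
      mfderiv_comp_subtypeVal hdAz,
      show (fun z : Kerr.slice a M => A z.1) = A ∘ Subtype.val from rfl,
      mfderiv_comp_subtypeVal (hAs.contMDiff.contMDiffAt.mdifferentiableAt (by simp)),
      mfderiv_eq_fderiv, (hAd _).fderiv]
  -- `eN` lands in the layer and in the closed slab
  have hslabmem : ∀ y : slabW M a, eN y ∈ B.truncTimeSlab (3 * M) 0 := fun y => by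
    refine ⟨?_, ?_⟩
    · rw [htime]; show P (A _) 0 = 0; rw [hPA]; rfl
    · rw [hrad]; show Kerr.radius a (P (A _)) ≤ 3 * M; rw [hPA]; exact y.2.le
  have hlayer : ∀ y : slabW M a, eN y ∈
      {x : B.domain | -1 < B.time x.1 ∧ B.time x.1 < 1 ∧ B.radius x.1 < 3 * M + 1} := fun y => by
    obtain ⟨h0, hr⟩ := hslabmem y
    exact ⟨by rw [h0]; norm_num, by rw [h0]; norm_num, by linarith⟩
  -- the smooth map `Φ₀ ∘ eN` into `𝒱`, with image in `ι(X)`, and its factorisation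
  have hg : ContMDiff 𝓘(ℝ, E3) (𝓡 4) ∞ (Φ₀ ∘ eN) := hΦ.1.comp_contMDiff heNs hlayer
  have hrange : range (Φ₀ ∘ eN) ⊆ range 𝒱.embed := by
    rintro _ ⟨y, rfl⟩
    exact hslab ⟨eN y, hslabmem y, rfl⟩
  obtain ⟨ΦN, hΦNs, hcomp⟩ :=
    Literature.Geometry.Manifold.exists_contMDiff_comp_eq_of_range_subset 𝒱.isSmoothEmbedding hg hrange
  have hΦNd : ∀ u, MDifferentiableAt (𝓡 3) (𝓡 3) ΦN u := fun u => (hΦNs u).mdifferentiableAt (by simp)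
  have hLo : IsOpen {x : B.domain | -1 < B.time x.1 ∧ B.time x.1 < 1 ∧ B.radius x.1 < 3 * M + 1} := by
    have ht : Continuous fun x : B.domain => B.time x.1 := by
      rw [htime]
      exact ((PiLp.continuous_apply 2 _ 0).comp (continuous_poincareInv _ _)).comp continuous_subtype_val
    have hr : Continuous fun x : B.domain => B.radius x.1 := by
      rw [hrad]
      exact ((Kerr.continuous_radius a).comp (continuous_poincareInv _ _)).comp continuous_subtype_val
    simp only [Set.setOf_and]
    exact (isOpen_lt continuous_const ht).inter ((isOpen_lt ht continuous_const).inter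
      (isOpen_lt hr continuous_const))
  have hΦ₀d : ∀ y : slabW M a, MDifferentiableAt 𝓘(ℝ, E4) (𝓡 4) Φ₀ (eN y) := fun y =>
    ((hΦ.1 _ (hlayer y)).contMDiffAt (hLo.mem_nhds (hlayer y))).mdifferentiableAt (by simp)
  -- `dΦ₀` is injective at slab points (order-`0` exactness + nondegeneracy of `g_{M,a}`)
  have hinjΦ₀ : ∀ x ∈ B.truncTimeSlab (3 * M) 0, Injective (mfderiv 𝓘(ℝ, E4) (𝓡 4) Φ₀ x) := by
    intro x hx v₁ v₂ hv
    have hdev0 := deviation_eq_zero_of_truncDeviationCk_le_zero hdev hx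
    have hiso : ∀ v w : E4, 𝒱.metric.val (Φ₀ x) (mfderiv 𝓘(ℝ, E4) (𝓡 4) Φ₀ x v)
        (mfderiv 𝓘(ℝ, E4) (𝓡 4) Φ₀ x w) = B.bilin x.1 v w := fun v w => by
      have h := congrArg (fun b => b v w) hdev0
      simp only [Spacetime.deviation_apply, zero_apply, sub_eq_zero] at h
      exact h
    set u := v₁ - v₂ with hu
    have hu0 : mfderiv 𝓘(ℝ, E4) (𝓡 4) Φ₀ x u = 0 := by rw [hu, map_sub, hv, sub_self]
    have key : ∀ w' : E4,
        Kerr.bilin M a (poincareInv mo.1 mo.2 x.1) (((mo.1 : E4 ≃L[ℝ] E4).symm) u) w' = 0 := by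
      intro w'
      have h := hiso u ((mo.1 : E4 ≃L[ℝ] E4) w')
      rw [hu0, map_zero, zero_apply, hbil, boostedKerrBilin_apply,
        ContinuousLinearEquiv.symm_apply_apply] at h
      exact h.symm
    have hsu : ((mo.1 : E4 ≃L[ℝ] E4).symm) u = 0 :=
      Kerr.bilin_nondegenerate M a (Kerr.radius_pos_of_mem_region (hPreg x)) _ key
    have hu' := congrArg (mo.1 : E4 ≃L[ℝ] E4) hsu
    simp only [ContinuousLinearEquiv.apply_symm_apply, map_zero] at hu'
    rw [hu] at hu'
    exact sub_eq_zero.mp hu'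
  -- the differentials of `Φ_N` are injective
  have hΦN' : ∀ u, Injective (mfderiv (𝓡 3) (𝓡 3) ΦN u) := by
    intro y v₁ v₂ hv
    have h1 : mfderiv 𝓘(ℝ, E3) (𝓡 4) (𝒱.embed ∘ ΦN) y =
        (mfderiv (𝓡 3) (𝓡 4) 𝒱.embed (ΦN y)).comp (mfderiv (𝓡 3) (𝓡 3) ΦN y) :=
      mfderiv_comp y (𝒱.mdifferentiable_embed _) (hΦNd y)
    have h2 : mfderiv 𝓘(ℝ, E3) (𝓡 4) (Φ₀ ∘ eN) y =
        (mfderiv 𝓘(ℝ, E4) (𝓡 4) Φ₀ (eN y)).comp (mfderiv 𝓘(ℝ, E3) 𝓘(ℝ, E4) eN y) :=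
      mfderiv_comp y (hΦ₀d y) (heNs.mdifferentiableAt (by simp))
    rw [hcomp, h2, hdeN y] at h1
    have h3 : mfderiv 𝓘(ℝ, E4) (𝓡 4) Φ₀ (eN y) ((((mo.1 : E4 ≃L[ℝ] E4) : E4 →L[ℝ] E4).comp E4.spaceEmbed) v₁) =
        mfderiv 𝓘(ℝ, E4) (𝓡 4) Φ₀ (eN y) ((((mo.1 : E4 ≃L[ℝ] E4) : E4 →L[ℝ] E4).comp E4.spaceEmbed) v₂) := by
      have e1 : mfderiv 𝓘(ℝ, E4) (𝓡 4) Φ₀ (eN y)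
          ((((mo.1 : E4 ≃L[ℝ] E4) : E4 →L[ℝ] E4).comp E4.spaceEmbed) v₁) =
          mfderiv (𝓡 3) (𝓡 4) 𝒱.embed (ΦN y) (mfderiv (𝓡 3) (𝓡 3) ΦN y v₁) :=
        DFunLike.congr_fun h1 v₁
      have e2 : mfderiv 𝓘(ℝ, E4) (𝓡 4) Φ₀ (eN y)
          ((((mo.1 : E4 ≃L[ℝ] E4) : E4 →L[ℝ] E4).comp E4.spaceEmbed) v₂) =
          mfderiv (𝓡 3) (𝓡 4) 𝒱.embed (ΦN y) (mfderiv (𝓡 3) (𝓡 3) ΦN y v₂) :=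
        DFunLike.congr_fun h1 v₂
      rw [e1, e2, hv]
    have h4 : (((mo.1 : E4 ≃L[ℝ] E4) : E4 →L[ℝ] E4).comp E4.spaceEmbed) v₁ =
        (((mo.1 : E4 ≃L[ℝ] E4) : E4 →L[ℝ] E4).comp E4.spaceEmbed) v₂ :=
      hinjΦ₀ (eN y) (hslabmem y) h3
    have h5 : E4.spaceEmbed v₁ = E4.spaceEmbed v₂ := by
      simpa using h4
    have h6 := congrArg E4.spatial h5
    simp only [E4.spatial_spaceEmbed] at h6
    exact h6
  -- `Φ_N` is injective
  have hΦNinj : Injective ΦN := by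
    intro y₁ y₂ h
    have h1 : Φ₀ (eN y₁) = Φ₀ (eN y₂) := by
      have e₁ := congrFun hcomp y₁; have e₂ := congrFun hcomp y₂
      simp only [Function.comp_apply] at e₁ e₂
      rw [← e₁, ← e₂, h]
    have h2 : eN y₁ = eN y₂ := by
      have := hΦ.2.injective (a₁ := ⟨eN y₁, hlayer y₁⟩) (a₂ := ⟨eN y₂, hlayer y₂⟩) h1
      exact congrArg Subtype.val this
    have h3 : A (y₁ : E3) = A (y₂ : E3) := congrArg Subtype.val h2
    exact Subtype.ext (Subtype.ext (hAinj h3))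
  -- `Φ_N` is a local diffeomorphism, hence an open embedding
  have hloc : IsLocalDiffeomorph (𝓡 3) (𝓡 3) ∞ ΦN := fun y => by
    set L : E3 →L[ℝ] E3 := mfderiv (𝓡 3) (𝓡 3) ΦN y with hL
    have hLinj : Injective L := hΦN' y
    refine Literature.Geometry.Manifold.isLocalDiffeomorphAt_of_mfderiv (n := ∞) (by simp) isOpen_univ
      (mem_univ y) hΦNs.contMDiffOn (L.toLinearMap.linearEquivOfInjective hLinj rfl).toContinuousLinearEquiv ?_
    ext v
    show L v = (L.toLinearMap.linearEquivOfInjective hLinj rfl).toContinuousLinearEquiv v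
    rw [LinearEquiv.coe_toContinuousLinearEquiv', LinearMap.linearEquivOfInjective_apply]
    rfl
  have hΦNo : IsOpenEmbedding ΦN :=
    IsOpenEmbedding.of_continuous_injective_isOpenMap hΦNs.continuous hΦNinj hloc.isOpenMap
  refine ⟨ΦN, hΦNs, hΦN', hΦNo, fun y => ⟨hmem y, ?_⟩⟩
  exact congrFun hcomp y





/-! ### Splitting (A2): the metric identity (order `0`, PROVED) and the second-form identity (order `1`) -/

section SplitA2

/-- The common hypothesis block of (A2h)/(A2k): a future-oriented exact collar chart and a smooth
`Φ_N` through which it factors on the open slab. -/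
def JetHypotheses (k' : ℕ) (X : Type) [TopologicalSpace X] [ChartedSpace E3 X] [IsManifold (𝓡 3) ∞ X]
    [ConnectedSpace X] (D : InitialDataSet (𝓡 3) X) (𝒱 : VacuumCauchyDevelopment D)
    (M a : ℝ) (mo : lorentzGroup × E4) (B : ModelBackground) (Φ₀ : B.domain → 𝒱.carrier)
    (ΦN : slabW M a → X) : Prop :=
  0 < M ∧ |a| < M ∧
    B = starBackground mo.1 mo.2 M a (fun x => Kerr.radius a (poincareInv mo.1 mo.2 x)) ∧
    (ContMDiffOn 𝓘(ℝ, E4) (𝓡 4) ∞ Φ₀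
        {x | -1 < B.time x.1 ∧ B.time x.1 < 1 ∧ B.radius x.1 < 3 * M + 1} ∧
      IsOpenEmbedding ({x | -1 < B.time x.1 ∧ B.time x.1 < 1 ∧
        B.radius x.1 < 3 * M + 1}.restrict Φ₀)) ∧
    𝒱.toSpacetime.truncDeviationCk B Φ₀ k' (3 * M) 0 ≤ 0 ∧
    Φ₀ '' B.truncTimeSlab (3 * M) 0 ⊆ range 𝒱.embed ∧
    (∀ x ∈ B.truncTimeSlab (3 * M) 0, 𝒱.timeOrientation.IsFutureDirected
      (mfderiv 𝓘(ℝ, E4) (𝓡 4) Φ₀ x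
        ((mo.1 : E4 ≃L[ℝ] E4) (Kerr.timeVector M a (poincareInv mo.1 mo.2 x.1))))) ∧
    ContMDiff (𝓡 3) (𝓡 3) ((((⊤ : ℕ∞) : WithTop ℕ∞)) + 1) ΦN ∧
    (∀ y : slabW M a, ∃ hx : ((mo.1 : E4 ≃L[ℝ] E4) (E4.ofTimeSpace 0 (y : E3)) + mo.2) ∈ B.domain,
        𝒱.embed (ΦN y) = Φ₀ ⟨_, hx⟩)


/-- **(A2h) `SlabMetricIdentity`** — order `0`: `Φ_N^* h = ψ_N^* g_{M,a}`.  PROVED below. Route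
statement of the line. [conjecture] [folklore] -/
def SlabMetricIdentity : Prop :=
  ∀ (k' : ℕ) (X : Type) [TopologicalSpace X] [ChartedSpace E3 X] [IsManifold (𝓡 3) ∞ X]
      [T2Space X] [SecondCountableTopology X] [ConnectedSpace X]
      (D : InitialDataSet (𝓡 3) X) (𝒱 : VacuumCauchyDevelopment D)
      (M a : ℝ) (mo : lorentzGroup × E4) (B : ModelBackground) (Φ₀ : B.domain → 𝒱.carrier)
      (ΦN : slabW M a → X), JetHypotheses k' X D 𝒱 M a mo B Φ₀ ΦN →
    ∀ (y : slabW M a) (v w : E3),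
      D.h.inner (ΦN y) (mfderiv (𝓡 3) (𝓡 3) ΦN y v) (mfderiv (𝓡 3) (𝓡 3) ΦN y w) =
        Kerr.bilin M a (ψN M a y : E4) (mfderiv 𝓘(ℝ, E3) 𝓘(ℝ, E4) (ψN M a) y v)
          (mfderiv 𝓘(ℝ, E3) 𝓘(ℝ, E4) (ψN M a) y w)


/-- **(A2k) `SlabSecondFormIdentity`** — order `1` (`k' ≥ 1`): `Φ_N^* k = K_{ν_N}(ψ_N)`, the
Kerr slab second fundamental form.  MISSING (true on paper: `induced_k`,
`secondFundamentalForm_comp_right`, `secondFundamentalForm_comap` through the chart `Φ₀|layer` and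
through the Poincaré isometry, `OpensChart.secondFundamentalForm_eq_of_repr` on both chart domains,
equality of `G`, `∂G` at slab points from the order-`≤ 1` jet, `sharp_congr_of_val_eq`, and the
normal pinned by (H8) via `TimeOrientation.eq_of_isFutureUnitNormal`).  Route statement of the
line. [conjecture] [folklore] -/
def SlabSecondFormIdentity : Prop :=
  ∀ [Kerr.Facts] [Kerr.SliceFacts] (k' : ℕ), 1 ≤ k' →
    ∀ (X : Type) [TopologicalSpace X] [ChartedSpace E3 X] [IsManifold (𝓡 3) ∞ X]
      [T2Space X] [SecondCountableTopology X] [ConnectedSpace X]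
      (D : InitialDataSet (𝓡 3) X) (𝒱 : VacuumCauchyDevelopment D)
      (M a : ℝ) (mo : lorentzGroup × E4) (B : ModelBackground) (Φ₀ : B.domain → 𝒱.carrier)
      (ΦN : slabW M a → X), JetHypotheses k' X D 𝒱 M a mo B Φ₀ ΦN →
    ∀ [(Kerr.smoothMetric M a M).HasLeviCivita] (y : slabW M a) (v w : E3),
      D.k (ΦN y) (mfderiv (𝓡 3) (𝓡 3) ΦN y v) (mfderiv (𝓡 3) (𝓡 3) ΦN y w) =
        (Kerr.smoothMetric M a M).secondFundamentalForm 𝓘(ℝ, E3) (ψN M a) (νN M a) y v w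


/-- (A2) from (A2h) and (A2k) (pure logic). -/
theorem slabJetIdentities_of (hh : SlabMetricIdentity) (hk : SlabSecondFormIdentity) :
    SlabJetIdentities := by
  intro _ _ k' hk' X _ _ _ _ _ _ D 𝒱 M a mo B Φ₀ hM ha hB hΦ hdev hslab hor ΦN hΦN hιΦ
  have hJ : JetHypotheses k' X D 𝒱 M a mo B Φ₀ ΦN := ⟨hM, ha, hB, hΦ, hdev, hslab, hor, hΦN, hιΦ⟩
  exact ⟨hh k' X D 𝒱 M a mo B Φ₀ ΦN hJ, fun y v w => hk k' hk' X D 𝒱 M a mo B Φ₀ ΦN hJ y v w⟩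


set_option maxHeartbeats 1600000 in
/-- **(A2h) holds** — `slabMetricIdentity_holds : SlabMetricIdentity`:
`h(dΦ_N v, dΦ_N w) = g(dι dΦ_N v, dι dΦ_N w)` (`induced_h`) `= g(d(Φ₀ ∘ e_N) v, d(Φ₀ ∘ e_N) w)`
(chain rule and `ι ∘ Φ_N = Φ₀ ∘ e_N`) `= g_B(de_N v, de_N w)` (order-`0` exactness)
`= g_{M,a}((0,v),(0,w))` (`boostedKerrBilin_apply`, `de_N = Λ ∘ (v ↦ (0,v))`)
`= g_{M,a}(dψ_N v, dψ_N w)` (`Kerr.mfderiv_sliceEmbed`). [cite: ONeill1983, Ch. 3, p. 58] -/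
theorem slabMetricIdentity_holds : SlabMetricIdentity := by
  intro k' X _ _ _ _ _ _ D 𝒱 M a mo B Φ₀ ΦN hJ y v w
  obtain ⟨hM, ha, hB, hΦ, hdev, hslab, -, hΦNs, hιΦ⟩ := hJ
  set P : E4 → E4 := poincareInv mo.1 mo.2 with hP
  have hdom : (B.domain : Set E4) = P ⁻¹' (Kerr.region a M : Set E4) := by rw [hB]; rfl
  have htime : B.time = fun x => P x 0 := by rw [hB]; rfl
  have hrad : B.radius = fun x => Kerr.radius a (P x) := by rw [hB]; rfl
  have hbil : B.bilin = boostedKerrBilin mo.1 mo.2 M a := by rw [hB]; rfl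
  -- the affine representative and the lab-frame slab embedding
  set A : E3 → E4 := fun z => (mo.1 : E4 ≃L[ℝ] E4) (E4.ofTimeSpace 0 z) + mo.2 with hA
  have hPA : ∀ z, P (A z) = E4.ofTimeSpace 0 z := fun z => poincareInv_lab mo _
  have hAd : ∀ z, HasFDerivAt A (((mo.1 : E4 ≃L[ℝ] E4) : E4 →L[ℝ] E4).comp E4.spaceEmbed) z :=
    fun z => (((mo.1 : E4 ≃L[ℝ] E4) : E4 →L[ℝ] E4).hasFDerivAt.comp z
      (E4.hasFDerivAt_ofTimeSpace 0 z)).add_const mo.2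
  have hAs : ContDiff ℝ ∞ A :=
    (((mo.1 : E4 ≃L[ℝ] E4) : E4 →L[ℝ] E4).contDiff.comp (E4.contDiff_ofTimeSpace 0)).add
      contDiff_const
  have hmem : ∀ y : slabW M a, A (y : E3) ∈ B.domain := fun y => (hιΦ y).1
  set eN : slabW M a → B.domain := fun y => ⟨A (y : E3), hmem y⟩ with heN
  have hcomp : ∀ y, 𝒱.embed (ΦN y) = Φ₀ (eN y) := fun y => (hιΦ y).2
  have heNs : ContMDiff 𝓘(ℝ, E3) 𝓘(ℝ, E4) ∞ eN := by
    rw [← ContMDiff.subtypeVal_comp_iff]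
    exact (hAs.contMDiff.comp contMDiff_subtype_val).comp contMDiff_subtype_val
  have hdeN : ∀ y : slabW M a, mfderiv 𝓘(ℝ, E3) 𝓘(ℝ, E4) eN y =
      (((mo.1 : E4 ≃L[ℝ] E4) : E4 →L[ℝ] E4).comp E4.spaceEmbed) := by
    intro y
    have hdAz : MDifferentiableAt 𝓘(ℝ, E3) 𝓘(ℝ, E4) (fun z : Kerr.slice a M => A z.1) y.1 :=
      ((hAs.contMDiff.comp contMDiff_subtype_val) y.1).mdifferentiableAt (by simp)
    have hd1 : MDifferentiableAt 𝓘(ℝ, E3) 𝓘(ℝ, E4) (fun y : slabW M a => A (y : E3)) y :=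
      (((hAs.contMDiff.comp contMDiff_subtype_val).comp contMDiff_subtype_val) y).mdifferentiableAt
        (by simp)
    rw [OpensChart.mfderiv_codRestrict (f := fun y : slabW M a => A (y : E3)) (fun _ => rfl) hd1,
      show (fun y : slabW M a => A (y : E3)) = (fun z : Kerr.slice a M => A z.1) ∘ Subtype.val from rfl,
      mfderiv_comp_subtypeVal hdAz,
      show (fun z : Kerr.slice a M => A z.1) = A ∘ Subtype.val from rfl,
      mfderiv_comp_subtypeVal (hAs.contMDiff.contMDiffAt.mdifferentiableAt (by simp)),
      mfderiv_eq_fderiv, (hAd _).fderiv]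
  have hslabmem : ∀ y : slabW M a, eN y ∈ B.truncTimeSlab (3 * M) 0 := fun y => by
    refine ⟨?_, ?_⟩
    · rw [htime]; show P (A _) 0 = 0; rw [hPA]; rfl
    · rw [hrad]; show Kerr.radius a (P (A _)) ≤ 3 * M; rw [hPA]; exact y.2.le
  have hlayer : ∀ y : slabW M a, eN y ∈
      {x : B.domain | -1 < B.time x.1 ∧ B.time x.1 < 1 ∧ B.radius x.1 < 3 * M + 1} := fun y => by
    obtain ⟨h0, hr⟩ := hslabmem y
    exact ⟨by rw [h0]; norm_num, by rw [h0]; norm_num, by linarith⟩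
  have hLo : IsOpen {x : B.domain | -1 < B.time x.1 ∧ B.time x.1 < 1 ∧ B.radius x.1 < 3 * M + 1} := by
    have ht : Continuous fun x : B.domain => B.time x.1 := by
      rw [htime]
      exact ((PiLp.continuous_apply 2 _ 0).comp (continuous_poincareInv _ _)).comp continuous_subtype_val
    have hr : Continuous fun x : B.domain => B.radius x.1 := by
      rw [hrad]
      exact ((Kerr.continuous_radius a).comp (continuous_poincareInv _ _)).comp continuous_subtype_val
    simp only [Set.setOf_and]
    exact (isOpen_lt continuous_const ht).inter ((isOpen_lt ht continuous_const).inter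
      (isOpen_lt hr continuous_const))
  have hΦ₀d : MDifferentiableAt 𝓘(ℝ, E4) (𝓡 4) Φ₀ (eN y) :=
    ((hΦ.1 _ (hlayer y)).contMDiffAt (hLo.mem_nhds (hlayer y))).mdifferentiableAt (by simp)
  -- chain rules
  have hfun : 𝒱.embed ∘ ΦN = Φ₀ ∘ eN := funext hcomp
  have h1 : mfderiv 𝓘(ℝ, E3) (𝓡 4) (𝒱.embed ∘ ΦN) y =
      (mfderiv (𝓡 3) (𝓡 4) 𝒱.embed (ΦN y)).comp (mfderiv (𝓡 3) (𝓡 3) ΦN y) :=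
    mfderiv_comp y (𝒱.mdifferentiable_embed _) ((hΦNs y).mdifferentiableAt (by simp))
  have h2 : mfderiv 𝓘(ℝ, E3) (𝓡 4) (Φ₀ ∘ eN) y =
      (mfderiv 𝓘(ℝ, E4) (𝓡 4) Φ₀ (eN y)).comp (mfderiv 𝓘(ℝ, E3) 𝓘(ℝ, E4) eN y) :=
    mfderiv_comp y hΦ₀d (heNs.mdifferentiableAt (by simp))
  rw [hfun, h2, hdeN y] at h1
  have hd : ∀ u : E3, mfderiv (𝓡 3) (𝓡 4) 𝒱.embed (ΦN y) (mfderiv (𝓡 3) (𝓡 3) ΦN y u) =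
      mfderiv 𝓘(ℝ, E4) (𝓡 4) Φ₀ (eN y) ((mo.1 : E4 ≃L[ℝ] E4) (E4.spaceEmbed u)) :=
    fun u => (DFunLike.congr_fun h1 u).symm
  -- `h = ι^* g`, then order-`0` exactness, then the Poincaré identification
  have hind := congrArg (fun b => b (mfderiv (𝓡 3) (𝓡 3) ΦN y v) (mfderiv (𝓡 3) (𝓡 3) ΦN y w))
    (𝒱.induced_h (ΦN y))
  simp only [pullbackBilin_apply] at hind
  rw [← hind, hd v, hd w, hcomp y]
  have hiso : ∀ v' w' : E4, 𝒱.metric.val (Φ₀ (eN y)) (mfderiv 𝓘(ℝ, E4) (𝓡 4) Φ₀ (eN y) v')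
      (mfderiv 𝓘(ℝ, E4) (𝓡 4) Φ₀ (eN y) w') = B.bilin (eN y).1 v' w' := fun v' w' => by
    have h := congrArg (fun b => b v' w') (deviation_eq_zero_of_truncDeviationCk_le_zero hdev (hslabmem y))
    simp only [Spacetime.deviation_apply, zero_apply, sub_eq_zero] at h
    exact h
  rw [hiso, hbil, boostedKerrBilin_apply, ContinuousLinearEquiv.symm_apply_apply,
    ContinuousLinearEquiv.symm_apply_apply,
    show poincareInv mo.1 mo.2 (eN y).1 = (ψN M a y : E4) from hPA _,
    show ψN M a = Kerr.sliceEmbed a M ∘ Subtype.val from rfl,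
    mfderiv_comp_subtypeVal ((Kerr.contMDiff_sliceEmbed a M ∞ y.1).mdifferentiableAt (by simp)),
    Kerr.mfderiv_sliceEmbed]
  rfl


end SplitA2


/-! ### Final assembly in this file -/

/-- **F1' from the two remaining analytic/geometric inputs and the two inputs proved in the
companion files**: with (A1) and (A2h) proved here, the corrected slab-jet Cauchy rigidity follows
from (D) (`subdataDevelopmentsEmbedLit_of_choquetBruhatGeroch`, localisation file: conditional on
`choquetBruhat_geroch_exists_mghd_cauchy`), (E) (`subdevelopmentFuturePlacement_holds`, placement
file), the Kerr slab second-form identity (A2k) and the Kerr slab-lens Cauchy property (C). -/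
theorem slabCauchyRigidity'_of (hD : SubdataDevelopmentsEmbedLit) (hE : SubdevelopmentFuturePlacement)
    (hk : SlabSecondFormIdentity) (hC : KerrSlabLensCauchy) : SlabCauchyRigidity' :=
  slabCauchyRigidity'_of_route
    (slabSubdatum_of slabFactorisation_holds (slabJetIdentities_of slabMetricIdentity_holds hk)) hC hD hE


end F1Route

end Summit.FinalStateConjecture.FinalStateConjecture.Theorems.BondiBartnikRigidity.DirectMethod

end


/-! ## merged part 1: `stub_slabCauchyRigidity_lens.lean` -/


/-!
# F1 `stub_slabCauchyRigidity`, step (c): the open Kerr slab is a Cauchy hypersurface of the slab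
# lens of the Kerr star chart (`KerrSlabLensCauchy`) — line `direct-method-on-the-cone`, crux
# `BondiBartnikRigidity` (stmt-FinalStateConjecture-10807), worker F1

Route statement (C) of `stub_slabCauchyRigidity.lean`: in the ingoing Kerr–Schild star chart
`Kerr.region a M = {r > M}` (`0 < M`, `|a| < M`), the open slab `slab° = {t* = 0, r < 3M}` is a
Cauchy hypersurface of the lens `V_K = {6M − 2r − 3t* > 0} ∩ {6M − 2r + 3t* > 0} ∩ {2t* + r − M > 0}`,
`slabW`, `V_K` are connected, and `V_K ∩ {t* > 0} ⊆ I⁺_{V_K}(slab°)`.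

ORDER THEORY OF THREE CLOCKS (template: `SwallowTheDatum….stub_collarCauchy`): along a future
timelike curve of the chart the Kerr–Schild speed limit `|ẋ⃗|_δ < ẋ⁰` (`η(v,v) ≤ g(v,v)`,
`CollarCauchy.minkowski_curve`) and `|∇r|²_δ = (r² + a²)/Σ ≤ 1 + a²/r² < 2` (`r > M > |a|`) give
`|ṙ| < √2 ẋ⁰`, so `t* + c r` is strictly increasing for `|c| ≤ 2/3` (`strictMonoOn_clock`); hence
`6M − 2r − 3t*` decreases and `6M − 2r + 3t*`, `2t* + r − M` increase to the future.  Existence of the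
crossing by the escape trichotomy and the Minkowski endpoint lemmas, the chart edge `r = M` being
unreachable pastward by the hole clock (`CollarCauchy.strictAntiOn_radius`), futureward by `2t* + r − M`.
-/

noncomputable section

-- D-0017: single-problem summit, `Summit.<S>.<S>.…` by design (cf. lakefile `weak.linter.dupNamespace`).
set_option linter.dupNamespace false

open Set Filter Function Topology TopologicalSpace
open Literature.Geometry.Lorentzian
open scoped Manifold ContDiff Topology RealInnerProductSpace
open Summit.FinalStateConjecture.FinalStateConjecture.Theorems.SwallowTheDatum.KerrShieldedSettles.CollarCauchy
  (curve_velocity minkowski_curve hasDerivAt_radius_comp strictAntiOn_radius)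
open Summit.FinalStateConjecture.FinalStateConjecture.Theorems.KerrShieldedSettles.Negative (minkowski_le_bilin)

namespace Summit.FinalStateConjecture.FinalStateConjecture.Theorems.BondiBartnikRigidity.DirectMethod

namespace F1Route

/-! ### Kerr-side sets (restated verbatim from `stub_slabCauchyRigidity.lean`) -/






/-! ### The speed limit and the clocks `t* + c r` -/

section Clocks

/-- **`|∇r|_δ ≤ √2` where `r ≥ |a|`**: `|∇r|² = (r² + a²)/Σ ≤ (r² + a²)/r² ≤ 2`
(`Kerr.inner_radiusGradVec_self`, `Kerr.sq_le_blSigma`). [cite: arXiv07060622, (35)] -/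
theorem norm_radiusGradVec_le {a : ℝ} {y : E3} (hr : 0 < Kerr.radius a (E4.ofTimeSpace 0 y))
    (har : |a| ≤ Kerr.radius a (E4.ofTimeSpace 0 y)) : ‖Kerr.radiusGradVec a y‖ ≤ Real.sqrt 2 := by
  have h2 : ‖Kerr.radiusGradVec a y‖ ^ 2 ≤ 2 := by
    rw [← real_inner_self_eq_norm_sq, Kerr.inner_radiusGradVec_self hr,
      div_le_iff₀ (Kerr.blSigma_pos hr)]
    have hS := Kerr.sq_le_blSigma hr
    have ha2 : a ^ 2 ≤ Kerr.radius a (E4.ofTimeSpace 0 y) ^ 2 := by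
      rw [← sq_abs a]; exact pow_le_pow_left₀ (abs_nonneg a) har 2
    nlinarith
  calc ‖Kerr.radiusGradVec a y‖ = Real.sqrt (‖Kerr.radiusGradVec a y‖ ^ 2) :=
        (Real.sqrt_sq (norm_nonneg _)).symm
    _ ≤ Real.sqrt 2 := Real.sqrt_le_sqrt h2


/-- **The speed limit for `r`**: `|dr(v⃗)| ≤ √2 ‖v⃗‖` at points with `r ≥ |a|`. -/
theorem abs_radiusGrad_le {a : ℝ} {y : E3} (hr : 0 < Kerr.radius a (E4.ofTimeSpace 0 y))
    (har : |a| ≤ Kerr.radius a (E4.ofTimeSpace 0 y)) (v : E3) :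
    |Kerr.radiusGrad a y v| ≤ Real.sqrt 2 * ‖v‖ := by
  rw [Kerr.radiusGrad_apply]
  exact (abs_real_inner_le_norm _ _).trans
    (mul_le_mul_of_nonneg_right (norm_radiusGradVec_le hr har) (norm_nonneg _))


variable [Kerr.Facts] {M a : ℝ} {hM : 0 ≤ M} {γ : ℝ → Kerr.region a M} {s : Set ℝ}

/-- Along a future timelike curve of the chart `{r > M}`, `|a| < M`: `|ṙ| < (3/2) v⁰` (indeed
`< √2 v⁰`), from the Kerr–Schild cone comparison `‖v⃗‖ < v⁰` and `|∇r| ≤ √2`. -/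
theorem abs_deriv_radius_lt (ha : |a| < M) (hγ : (Kerr.smoothMetric M a M).IsFutureTimelikeCurveOn
      ((Kerr.timeOrientation M a M hM).ofLE le_top) γ s) {t : ℝ} (ht : t ∈ s) :
    |Kerr.radiusGrad a (E4.spatial (γ t : E4)) (E4.spatial (deriv (fun σ => (γ σ : E4)) t))| <
      3 / 2 * deriv (fun σ => (γ σ : E4)) t 0 := by
  obtain ⟨-, hv0, hsp⟩ := Minkowski.hasDerivAt_of_isFutureTimelikeCurveOn (minkowski_curve hγ) ht
  have hx : 0 < Kerr.radius a (γ t) := Kerr.radius_pos_of_mem_region (γ t).2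
  have hr' : 0 < Kerr.radius a (E4.ofTimeSpace 0 (E4.spatial (γ t : E4))) := by
    rwa [Kerr.radius_ofTimeSpace_spatial]
  have har : |a| ≤ Kerr.radius a (E4.ofTimeSpace 0 (E4.spatial (γ t : E4))) := by
    rw [Kerr.radius_ofTimeSpace_spatial]
    exact (ha.trans (Kerr.lt_radius_of_mem_region (γ t).2)).le
  have h1 := abs_radiusGrad_le hr' har (E4.spatial (deriv (fun σ => (γ σ : E4)) t))
  have hsqrt : Real.sqrt 2 < 3 / 2 := by
    rw [show (3 / 2 : ℝ) = Real.sqrt ((3 / 2) ^ 2) by rw [Real.sqrt_sq]; norm_num]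
    exact Real.sqrt_lt_sqrt (by norm_num) (by norm_num)
  have h2 : Real.sqrt 2 * ‖E4.spatial (deriv (fun σ => (γ σ : E4)) t)‖ ≤
      Real.sqrt 2 * deriv (fun σ => (γ σ : E4)) t 0 :=
    mul_le_mul_of_nonneg_left hsp.le (Real.sqrt_nonneg _)
  nlinarith [Real.sqrt_nonneg 2]


/-- The derivative of the clock `σ ↦ t*(γ σ) + c r(γ σ)`. -/
theorem hasDerivAt_clock (c : ℝ) (hγ : (Kerr.smoothMetric M a M).IsFutureTimelikeCurveOn
      ((Kerr.timeOrientation M a M hM).ofLE le_top) γ s) {t : ℝ} (ht : t ∈ s) :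
    HasDerivAt (fun σ => (γ σ : E4) 0 + c * Kerr.radius a (γ σ))
      (deriv (fun σ => (γ σ : E4)) t 0 + c *
        Kerr.radiusGrad a (E4.spatial (γ t : E4)) (E4.spatial (deriv (fun σ => (γ σ : E4)) t))) t :=
  (Minkowski.hasDerivAt_time (minkowski_curve hγ) ht).add ((hasDerivAt_radius_comp hγ ht).const_mul c)


/-- **The clocks**: for `|c| ≤ 2/3` the function `t* + c r` is strictly increasing along future
timelike curves of the chart `{r > M}`, `|a| < M` (derivative `v⁰ + c ṙ ≥ v⁰ − |c| |ṙ| > 0`). -/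
theorem strictMonoOn_clock {c : ℝ} (hc : |c| ≤ 2 / 3) (ha : |a| < M) (hs : s.OrdConnected)
    (hγ : (Kerr.smoothMetric M a M).IsFutureTimelikeCurveOn
      ((Kerr.timeOrientation M a M hM).ofLE le_top) γ s) :
    StrictMonoOn (fun σ => (γ σ : E4) 0 + c * Kerr.radius a (γ σ)) s := by
  refine strictMonoOn_of_deriv_pos hs.convex
    (fun t ht => (hasDerivAt_clock c hγ ht).continuousAt.continuousWithinAt) fun t ht => ?_
  have ht' := interior_subset ht
  rw [(hasDerivAt_clock c hγ ht').deriv]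
  have h1 := abs_deriv_radius_lt ha hγ ht'
  obtain ⟨-, hv0, -⟩ := Minkowski.hasDerivAt_of_isFutureTimelikeCurveOn (minkowski_curve hγ) ht'
  set ρ := Kerr.radiusGrad a (E4.spatial (γ t : E4)) (E4.spatial (deriv (fun σ => (γ σ : E4)) t))
  have h2 : |c * ρ| ≤ 2 / 3 * |ρ| := by rw [abs_mul]; exact mul_le_mul_of_nonneg_right hc (abs_nonneg _)
  have h3 : -(c * ρ) ≤ |c * ρ| := neg_le_abs _
  nlinarith [abs_nonneg ρ]


/-- `t*` is strictly increasing along future timelike curves of the chart (the clock `c = 0`,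
equivalently `Minkowski.strictMonoOn_time`). -/
theorem strictMonoOn_time' (hs : s.OrdConnected) (hγ : (Kerr.smoothMetric M a M).IsFutureTimelikeCurveOn
      ((Kerr.timeOrientation M a M hM).ofLE le_top) γ s) :
    StrictMonoOn (fun σ => (γ σ : E4) 0) s :=
  Minkowski.strictMonoOn_time hs (minkowski_curve hγ)


end Clocks


/-! ### The Cauchy property of the open slab in the lens, chart form -/

section Cauchy

theorem rMinus_lt_self {M a : ℝ} (ha : |a| < M) : Kerr.rMinus M a < M := by
  have h : 0 < M ^ 2 - a ^ 2 := by
    have := sq_lt_sq' (by linarith [abs_nonneg a, neg_abs_le a]) (lt_of_le_of_lt (le_abs_self a) ha)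
    nlinarith [abs_nonneg a, sq_abs a]
  have := Real.sqrt_pos.2 h
  unfold Kerr.rMinus; linarith


theorem self_lt_rPlus {M a : ℝ} (ha : |a| < M) : M < Kerr.rPlus M a := by
  have h : 0 < M ^ 2 - a ^ 2 := by
    have := sq_lt_sq' (by linarith [abs_nonneg a, neg_abs_le a]) (lt_of_le_of_lt (le_abs_self a) ha)
    nlinarith [abs_nonneg a, sq_abs a]
  have := Real.sqrt_pos.2 h
  unfold Kerr.rPlus; linarith


variable [Kerr.Facts]

/-- **The open slab `{t* = 0}` is met exactly once by every future timelike curve of the chart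
lying in the lens and without future/past endpoint in the lens** (chart form of (C)). -/
theorem slab_cauchy_chart {M a : ℝ} (hM0 : 0 < M) (ha : |a| < M)
    (γ : ℝ → Kerr.region a M) (s : Set ℝ) (hs : s.OrdConnected) (hne : s.Nonempty)
    (hγ : (Kerr.smoothMetric M a M).IsFutureTimelikeCurveOn
      ((Kerr.timeOrientation M a M hM0.le).ofLE le_top) γ s)
    (hL : ∀ t ∈ s, γ t ∈ lensK M a)
    (hend : ∀ q : Kerr.region a M, q ∈ lensK M a →
      ¬ HasFutureEndpoint γ s q ∧ ¬ HasPastEndpoint γ s q) :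
    ∃! t, t ∈ s ∧ (γ t : E4) 0 = 0 := by
  haveI : Nonempty s := hne.to_subtype
  have hβ := minkowski_curve hγ
  have hmono := strictMonoOn_time' hs hγ
  have hrM : ∀ σ, M < Kerr.radius a (γ σ) := fun σ => Kerr.lt_radius_of_mem_region (γ σ).2
  have hmem : ∀ q : E4, M < Kerr.radius a q → q ∈ Kerr.region a M := fun q hq => by
    rw [Kerr.mem_region, max_eq_left hM0.le]; exact hq
  -- uniqueness by monotonicity of `t*`; existence is what remains
  suffices hex : ∃ t ∈ s, (γ t : E4) 0 = 0 by
    obtain ⟨t, ht, ht0⟩ := hex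
    refine ⟨t, ⟨ht, ht0⟩, ?_⟩
    rintro t' ⟨ht', ht'0⟩
    exact hmono.injOn ht' ht (ht'0.trans ht0.symm)
  by_contra hno
  push Not at hno
  obtain ⟨t₀, ht₀⟩ := hne
  have hcont : ContinuousOn (fun σ => (γ σ : E4) 0) s := Minkowski.continuousOn_time hβ
  have hcr : Continuous fun q : E4 => Kerr.radius a q := Kerr.continuous_radius a
  have hc0 : Continuous fun q : E4 => q 0 := PiLp.continuous_apply 2 _ 0
  -- the clocks along the curve
  have hw₁ := strictMonoOn_clock (c := 2 / 3) (by rw [abs_of_pos (by norm_num)]) ha hs hγ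
  have hw₂ := strictMonoOn_clock (c := -(2 / 3)) (by rw [abs_neg, abs_of_pos (by norm_num)]) ha hs hγ
  have hf₃ := strictMonoOn_clock (c := 1 / 2) (by rw [abs_of_pos (by norm_num)]; norm_num) ha hs hγ
  obtain ⟨hL1, hL2, hL3⟩ := hL t₀ ht₀
  rcases lt_or_gt_of_ne (hno t₀ ht₀) with hneg | hpos
  · /- below the slab: futureward escape.  `t* < 0` on `s`, bounded above, so the coordinate curve has
      a future endpoint `q` in `E4`; the clocks `t* − (2/3) r`, `t* + r/2` (increasing) and `t* ≤ 0`
      put `q` in the lens: contradiction. -/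
    have hall : ∀ t ∈ s, (γ t : E4) 0 < 0 := by
      intro t ht
      by_contra hge
      push Not at hge
      obtain ⟨c, hc, hc0'⟩ := hs.isPreconnected.intermediate_value ht₀ ht hcont ⟨hneg.le, hge⟩
      exact hno c hc hc0'
    have hbdd : BddAbove ((fun σ => (γ σ : E4) 0) '' s) :=
      ⟨0, by rintro _ ⟨σ, hσ, rfl⟩; exact (hall σ hσ).le⟩
    obtain ⟨q, hq⟩ : ∃ q : E4, HasFutureEndpoint (fun σ => (γ σ : E4)) s q := by
      by_contra hcon
      push Not at hcon
      exact Minkowski.not_bddAbove_time hs hβ ⟨⟨t₀, ht₀⟩, hcon⟩ hbdd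
    have hqr : Tendsto (fun σ : s => Kerr.radius a (γ σ)) atTop (𝓝 (Kerr.radius a q)) :=
      (hcr.tendsto q).comp hq
    have hq0 : Tendsto (fun σ : s => (γ σ : E4) 0) atTop (𝓝 (q 0)) := (hc0.tendsto q).comp hq
    have hq0le : q 0 ≤ 0 := le_of_tendsto' hq0 fun σ => (hall σ σ.2).le
    have h2 : (γ t₀ : E4) 0 + -(2 / 3) * Kerr.radius a (γ t₀) ≤ q 0 + -(2 / 3) * Kerr.radius a q := by
      refine ge_of_tendsto (hq0.add (hqr.const_mul (-(2 / 3)))) ?_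
      filter_upwards [eventually_ge_atTop (⟨t₀, ht₀⟩ : s)] with σ hσ
      exact hw₂.monotoneOn ht₀ σ.2 hσ
    have h3 : (γ t₀ : E4) 0 + 1 / 2 * Kerr.radius a (γ t₀) ≤ q 0 + 1 / 2 * Kerr.radius a q := by
      refine ge_of_tendsto (hq0.add (hqr.const_mul (1 / 2))) ?_
      filter_upwards [eventually_ge_atTop (⟨t₀, ht₀⟩ : s)] with σ hσ
      exact hf₃.monotoneOn ht₀ σ.2 hσ
    have hrq : M < Kerr.radius a q := by linarith
    have hqL : (⟨q, hmem q hrq⟩ : Kerr.region a M) ∈ lensK M a := by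
      refine ⟨?_, ?_, ?_⟩ <;> simp only <;> linarith
    exact (hend ⟨q, hmem q hrq⟩ hqL).1 ((hasFutureEndpoint_subtypeVal_comp_iff (p := ⟨q, hmem q hrq⟩)).1 hq)
  · /- above the slab: pastward escape.  `t* > 0` on `s`, bounded below, so the coordinate curve has a
      past endpoint `q`; the clock `t* + (2/3) r` bounds the first two lens functions at `q` from below,
      and `r(q) > M` (the hole clock excludes `r(q) = M`), so `q` is in the lens: contradiction. -/
    have hall : ∀ t ∈ s, 0 < (γ t : E4) 0 := by
      intro t ht
      by_contra hle
      push Not at hle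
      obtain ⟨c, hc, hc0'⟩ := hs.isPreconnected.intermediate_value ht ht₀ hcont ⟨hle, hpos.le⟩
      exact hno c hc hc0'
    have hbdd : BddBelow ((fun σ => (γ σ : E4) 0) '' s) :=
      ⟨0, by rintro _ ⟨σ, hσ, rfl⟩; exact (hall σ hσ).le⟩
    obtain ⟨q, hq⟩ : ∃ q : E4, HasPastEndpoint (fun σ => (γ σ : E4)) s q := by
      by_contra hcon
      push Not at hcon
      exact Minkowski.not_bddBelow_time hs hβ ⟨⟨t₀, ht₀⟩, hcon⟩ hbdd
    have hqr : Tendsto (fun σ : s => Kerr.radius a (γ σ)) atBot (𝓝 (Kerr.radius a q)) :=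
      (hcr.tendsto q).comp hq
    have hq0 : Tendsto (fun σ : s => (γ σ : E4) 0) atBot (𝓝 (q 0)) := (hc0.tendsto q).comp hq
    have hq0ge : 0 ≤ q 0 := ge_of_tendsto' hq0 fun σ => (hall σ σ.2).le
    have h1 : q 0 + 2 / 3 * Kerr.radius a q ≤ (γ t₀ : E4) 0 + 2 / 3 * Kerr.radius a (γ t₀) := by
      refine le_of_tendsto (hq0.add (hqr.const_mul (2 / 3))) ?_
      filter_upwards [eventually_le_atBot (⟨t₀, ht₀⟩ : s)] with σ hσ
      exact hw₁.monotoneOn σ.2 ht₀ hσ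
    have hrqM : M ≤ Kerr.radius a q := ge_of_tendsto' hqr fun σ => (hrM σ).le
    rcases hrqM.lt_or_eq with hrq | hrq
    · have hqL : (⟨q, hmem q hrq⟩ : Kerr.region a M) ∈ lensK M a := by
        refine ⟨?_, ?_, ?_⟩ <;> simp only <;> linarith
      exact (hend ⟨q, hmem q hrq⟩ hqL).2 ((hasPastEndpoint_subtypeVal_comp_iff (p := ⟨q, hmem q hrq⟩)).1 hq)
    · have hev : ∀ᶠ σ : s in atBot, Kerr.radius a (γ σ) < Kerr.rPlus M a :=
        hqr.eventually (Iio_mem_nhds (by rw [← hrq]; exact self_lt_rPlus ha))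
      obtain ⟨σ₁, hσ₁⟩ := hev.exists_forall_of_atBot
      have hanti := strictAntiOn_radius ha (rMinus_lt_self ha) (hs.inter ordConnected_Iic)
        inter_subset_left hγ (s' := s ∩ Iic (σ₁ : ℝ)) (fun σ hσ => hσ₁ ⟨σ, hσ.1⟩ hσ.2)
      have hge : ∀ᶠ σ : s in atBot, Kerr.radius a (γ σ₁) ≤ Kerr.radius a (γ σ) := by
        filter_upwards [eventually_le_atBot σ₁] with σ hσ
        exact hanti.antitoneOn ⟨σ.2, hσ⟩ ⟨σ₁.2, self_mem_Iic⟩ hσ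
      have hle := ge_of_tendsto hqr hge
      linarith [hrM σ₁]


/-- **(C3) The open slab is a Cauchy hypersurface of the lens** (packaged form: every endless
timelike curve of the open sub-spacetime `V_K` meets `val⁻¹' slab°` exactly once). -/
theorem isCauchyHypersurface_slabKo {M a : ℝ} (hM0 : 0 < M) (ha : |a| < M) :
    ((Kerr.spacetime M a M hM0.le).metric.restrict PseudoRiemannianMetric.contMDiff_restrict_holds
        ⟨lensK M a, isOpen_lensK M a⟩).IsCauchyHypersurface
      ((Kerr.spacetime M a M hM0.le).timeOrientation.restrict
        PseudoRiemannianMetric.contMDiff_restrict_holds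
        (Kerr.spacetime M a M hM0.le).timeOrientation.contMDiff_restrict_holds
        ⟨lensK M a, isOpen_lensK M a⟩)
      (Subtype.val ⁻¹' slabKo M a) := by
  intro γ s hγ
  obtain ⟨hs, htl, hfe, hpe⟩ := hγ
  have htl' := (LorentzianMetric.isFutureTimelikeCurveOn_restrict_iff _ _ _ _ _).1 htl
  have hL : ∀ t ∈ s, (Subtype.val ∘ γ) t ∈ lensK M a := fun t _ => (γ t).2
  have hend : ∀ q : Kerr.region a M, q ∈ lensK M a →
      ¬ HasFutureEndpoint (Subtype.val ∘ γ) s q ∧ ¬ HasPastEndpoint (Subtype.val ∘ γ) s q :=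
    fun q hq => ⟨fun h => hfe.2 ⟨q, hq⟩ (hasFutureEndpoint_subtypeVal_comp_iff.1 h),
      fun h => hpe.2 ⟨q, hq⟩ (hasPastEndpoint_subtypeVal_comp_iff.1 h)⟩
  obtain ⟨t, ⟨hts, ht⟩, huniq⟩ := slab_cauchy_chart hM0 ha (Subtype.val ∘ γ) s hs hfe.1 htl' hL hend
  refine ⟨t, ⟨hts, ?_⟩, fun t' ht' => huniq t' ⟨ht'.1, ht'.2.1⟩⟩
  refine ⟨ht, ?_⟩
  have ht' : ((γ t).1.1 : E4) 0 = 0 := ht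
  have h1' : 0 < 6 * M - 2 * Kerr.radius a (γ t).1.1 - 3 * ((γ t).1.1 : E4) 0 := (γ t).2.1
  show Kerr.radius a (γ t).1.1 < 3 * M
  linarith


end Cauchy


/-! ### The future part of the lens lies in the chronological future of the slab -/

section Future

variable [Kerr.Facts]

/-- **(C4)**: `V_K ∩ {t* > 0} ⊆ I⁺_{V_K}(slab°)` — the endless timelike curve through a point of
the lens (`exists_isEndlessTimelikeCurve_through`) meets `slab°` exactly once, and by the clock
`t*` this happens strictly before the point when `t* > 0` there. -/
theorem diamondK_subset_chronologicalFuture {M a : ℝ} (hM0 : 0 < M) (ha : |a| < M) :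
    (Subtype.val ⁻¹' diamondK M a : Set (⟨lensK M a, isOpen_lensK M a⟩ : Opens (Kerr.region a M))) ⊆
      ((Kerr.spacetime M a M hM0.le).metric.restrict PseudoRiemannianMetric.contMDiff_restrict_holds
        ⟨lensK M a, isOpen_lensK M a⟩).chronologicalFuture
      ((Kerr.spacetime M a M hM0.le).timeOrientation.restrict
        PseudoRiemannianMetric.contMDiff_restrict_holds
        (Kerr.spacetime M a M hM0.le).timeOrientation.contMDiff_restrict_holds
        ⟨lensK M a, isOpen_lensK M a⟩)
      (Subtype.val ⁻¹' slabKo M a) := by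
  intro z hz
  have hn2 : (2 : ℕ∞ω) ≤ ((⊤ : ℕ∞) : ℕ∞ω) := WithTop.coe_le_coe.mpr le_top
  obtain ⟨Δ, D, hΔ, h0D, hΔ0⟩ := LorentzianMetric.exists_isEndlessTimelikeCurve_through
    (g := (Kerr.spacetime M a M hM0.le).metric.restrict PseudoRiemannianMetric.contMDiff_restrict_holds
        ⟨lensK M a, isOpen_lensK M a⟩)
    (τ := (Kerr.spacetime M a M hM0.le).timeOrientation.restrict
        PseudoRiemannianMetric.contMDiff_restrict_holds
        (Kerr.spacetime M a M hM0.le).timeOrientation.contMDiff_restrict_holds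
        ⟨lensK M a, isOpen_lensK M a⟩) hn2 z
  obtain ⟨t₁, ⟨ht₁D, ht₁S⟩, -⟩ := isCauchyHypersurface_slabKo hM0 ha Δ D hΔ
  set γ' : ℝ → Kerr.region a M := Subtype.val ∘ Δ with hγ'
  have htl' : (Kerr.smoothMetric M a M).IsFutureTimelikeCurveOn
      ((Kerr.timeOrientation M a M hM0.le).ofLE le_top) γ' D :=
    (LorentzianMetric.isFutureTimelikeCurveOn_restrict_iff _ _ _ _ _).1 hΔ.2.1
  have hmono := strictMonoOn_time' hΔ.1 htl'
  have hz0 : 0 < ((z : Kerr.region a M) : E4) 0 := hz.1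
  rcases lt_trichotomy t₁ 0 with ht | rfl | ht
  · exact ⟨Δ t₁, ht₁S, Δ, t₁, 0, ht, hΔ.2.1.mono (hΔ.1.out ht₁D h0D), rfl, hΔ0⟩
  · exfalso
    rw [hΔ0] at ht₁S
    have : ((z : Kerr.region a M) : E4) 0 = 0 := ht₁S.1
    linarith
  · exfalso
    have h := hmono h0D ht₁D ht
    have h1 : (γ' t₁ : E4) 0 = 0 := ht₁S.1
    have h0 : (γ' 0 : E4) 0 = ((z : Kerr.region a M) : E4) 0 := by
      have : γ' 0 = (z : Kerr.region a M) := by rw [hγ', Function.comp_apply, hΔ0]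
      rw [this]
    simp only at h
    linarith


end Future

/-! ### Connectedness of the open slab and of the lens -/

section Connected

/-- The open shell `{M < r(0,·) < 3M}` of `E3` is the image of `(M, 3M) × S²` under the oblate
spheroidal parametrisation, hence connected (`0 < M`). [cite: ONeill1995, Ch. 2 §2.1] -/
theorem isConnected_shell {M : ℝ} (a : ℝ) (hM : 0 < M) :
    IsConnected {y : E3 | M < Kerr.radius a (E4.ofTimeSpace 0 y) ∧ Kerr.radius a (E4.ofTimeSpace 0 y) < 3 * M} := by
  have heq : {y : E3 | M < Kerr.radius a (E4.ofTimeSpace 0 y) ∧ Kerr.radius a (E4.ofTimeSpace 0 y) < 3 * M} =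
      (fun p : ℝ × E3 ↦ (WithLp.toLp 2
        ![√(p.1 ^ 2 + a ^ 2) * p.2 0, √(p.1 ^ 2 + a ^ 2) * p.2 1, p.1 * p.2 2] : E3)) ''
        (Ioo M (3 * M) ×ˢ Metric.sphere (0 : E3) 1) := by
    ext y
    constructor
    · rintro ⟨h1, h2⟩
      have hy : y ∈ {y : E3 | M < Kerr.radius a (E4.ofTimeSpace 0 y)} := h1
      rw [Kerr.slice_eq_image_spheroidal a hM.le] at hy
      obtain ⟨⟨r, w⟩, ⟨hr, hw⟩, rfl⟩ := hy
      rw [mem_sphere_zero_iff_norm] at hw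
      rw [Kerr.radius_spheroidal (hM.trans hr) hw] at h2
      exact ⟨(r, w), ⟨⟨hr, h2⟩, mem_sphere_zero_iff_norm.2 hw⟩, rfl⟩
    · rintro ⟨⟨r, w⟩, ⟨⟨hr1, hr2⟩, hw⟩, rfl⟩
      rw [mem_sphere_zero_iff_norm] at hw
      simp only [mem_setOf_eq]
      rw [Kerr.radius_spheroidal (hM.trans hr1) hw]
      exact ⟨hr1, hr2⟩
  rw [heq]
  exact ((isConnected_Ioo (by linarith)).prod Kerr.isConnected_sphere_E3).image _
    (Kerr.continuous_spheroidal a).continuousOn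


/-- **(C1)** The open slab `slabW` is connected. -/
theorem isConnected_slabW {M : ℝ} (a : ℝ) (hM : 0 < M) : IsConnected (slabW M a : Set (Kerr.slice a M)) := by
  have himg : Subtype.val '' (slabW M a : Set (Kerr.slice a M)) =
      {y : E3 | M < Kerr.radius a (E4.ofTimeSpace 0 y) ∧ Kerr.radius a (E4.ofTimeSpace 0 y) < 3 * M} := by
    ext y
    constructor
    · rintro ⟨z, hz, rfl⟩
      have h1 : max M 0 < Kerr.radius a (E4.ofTimeSpace 0 (z : E3)) := z.2
      rw [max_eq_left hM.le] at h1
      exact ⟨h1, hz⟩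
    · rintro ⟨h1, h2⟩
      have hmem : y ∈ Kerr.slice a M := by
        show max M 0 < Kerr.radius a (E4.ofTimeSpace 0 y)
        rw [max_eq_left hM.le]; exact h1
      exact ⟨⟨y, hmem⟩, h2, rfl⟩
  refine ⟨?_, IsInducing.subtypeVal.isPreconnected_image.mp ?_⟩
  · obtain ⟨y, hy⟩ := (isConnected_shell a hM).nonempty
    rw [← himg] at hy
    obtain ⟨z, hz, -⟩ := hy
    exact ⟨z, hz⟩
  · have h := (isConnected_shell a hM).isPreconnected
    rw [← himg] at h
    exact h


/-- **(C2)** The lens is connected: every point `x` of it is joined inside it to the slab point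
`(0, x⃗)` by the vertical coordinate segment (the three lens functions are affine in `t*` along it),
and the slab `{0} × shell` is connected. -/
theorem isConnected_lensK {M : ℝ} (a : ℝ) (hM : 0 < M) : IsConnected (lensK M a) := by
  -- work with the image `S ⊆ E4`
  set S : Set E4 := Subtype.val '' lensK M a with hS
  have hSmem : ∀ x : E4, x ∈ S ↔ M < Kerr.radius a x ∧ 0 < 6 * M - 2 * Kerr.radius a x - 3 * x 0 ∧
      0 < 6 * M - 2 * Kerr.radius a x + 3 * x 0 ∧ 0 < 2 * x 0 + (Kerr.radius a x - M) := by
    intro x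
    constructor
    · rintro ⟨z, hz, rfl⟩
      exact ⟨Kerr.lt_radius_of_mem_region z.2, hz⟩
    · rintro ⟨h0, h1⟩
      have hmem : x ∈ Kerr.region a M := by rw [Kerr.mem_region, max_eq_left hM.le]; exact h0
      exact ⟨⟨x, hmem⟩, h1, rfl⟩
  -- the slab set and its base point
  set T : Set E4 := E4.ofTimeSpace 0 '' {y : E3 | M < Kerr.radius a (E4.ofTimeSpace 0 y) ∧
    Kerr.radius a (E4.ofTimeSpace 0 y) < 3 * M} with hT
  have hTc : IsConnected T := (isConnected_shell a hM).image _ (E4.continuous_ofTimeSpace 0).continuousOn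
  have hTS : T ⊆ S := by
    rintro _ ⟨y, ⟨h1, h2⟩, rfl⟩
    rw [hSmem]
    simp only [E4.ofTimeSpace_apply_zero, mul_zero, sub_zero, add_zero, zero_add]
    exact ⟨h1, by linarith, by linarith, by linarith⟩
  obtain ⟨x₀, hx₀⟩ := hTc.nonempty
  have hpre : IsPreconnected S := by
    refine isPreconnected_of_forall x₀ fun x hx ↦ ?_
    rw [hSmem] at hx
    obtain ⟨h0, h1, h2, h3⟩ := hx
    -- the foot point `(0, x⃗)` and the vertical segment
    set f : E4 := E4.ofTimeSpace 0 (E4.spatial x) with hf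
    have hrf : ∀ θ : ℝ, Kerr.radius a (f + θ • (x - f)) = Kerr.radius a x := fun θ ↦ by
      have hsp : E4.spatial (f + θ • (x - f)) = E4.spatial x := by
        rw [map_add, map_smul, map_sub, hf, E4.spatial_ofTimeSpace, sub_self, smul_zero, add_zero]
      rw [← Kerr.radius_ofTimeSpace_spatial a (f + θ • (x - f)), hsp, Kerr.radius_ofTimeSpace_spatial]
    have h0f : ∀ θ : ℝ, (f + θ • (x - f)) 0 = θ * x 0 := fun θ ↦ by
      simp [hf]
    have hfT : f ∈ T := by
      refine ⟨E4.spatial x, ⟨?_, ?_⟩, rfl⟩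
      · rw [Kerr.radius_ofTimeSpace_spatial]; exact h0
      · rw [Kerr.radius_ofTimeSpace_spatial]; linarith
    have hseg : segment ℝ f x ⊆ S := by
      rw [segment_eq_image']
      rintro _ ⟨θ, ⟨hθ0, hθ1⟩, rfl⟩
      rw [hSmem, hrf θ, h0f θ]
      refine ⟨h0, ?_, ?_, ?_⟩
      · nlinarith
      · nlinarith
      · rcases le_or_gt 0 (x 0) with hx | hx
        · nlinarith [mul_nonneg hθ0 hx]
        · nlinarith [mul_nonneg (sub_nonneg.2 hθ1) (neg_nonneg.2 hx.le)]
    refine ⟨T ∪ segment ℝ f x, union_subset hTS hseg, Or.inl hx₀, Or.inr (right_mem_segment _ _ _), ?_⟩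
    exact hTc.isPreconnected.union f hfT (left_mem_segment _ _ _) (convex_segment _ _).isPreconnected
  refine ⟨?_, IsInducing.subtypeVal.isPreconnected_image.mp hpre⟩
  obtain ⟨z, hz, -⟩ := hTS hx₀
  exact ⟨z, hz⟩


end Connected

/-! ### (C) assembled -/


/-- **(C) holds** — `kerrSlabLensCauchy_holds : KerrSlabLensCauchy`. -/
theorem kerrSlabLensCauchy_holds : KerrSlabLensCauchy := fun M a hM ha =>
  ⟨isConnected_slabW (M := M) a hM, isConnected_lensK a hM, isCauchyHypersurface_slabKo hM ha,
    diamondK_subset_chronologicalFuture hM ha⟩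


end F1Route

end Summit.FinalStateConjecture.FinalStateConjecture.Theorems.BondiBartnikRigidity.DirectMethod

end


/-! ## merged part 2: `stub_slabCauchyRigidity_placement.lean` -/


/-!
# F1 `stub_slabCauchyRigidity`, step (e): placement of an embedded sub-development inside the
# faithful future domain of dependence (`SubdevelopmentFuturePlacement`) — line
# `direct-method-on-the-cone`, crux `BondiBartnikRigidity` (stmt-FinalStateConjecture-10807), worker F1

Route statement (E) of `stub_slabCauchyRigidity.lean`, PROVED:

* `LorentzianMetric.IsCauchyHypersurface.exists_mem_of_isPastEndless_of_mem_chronologicalFuture` —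
  **one-sided form of O'Neill's Lemma 14.29**: a PAST-endless future causal curve through a point of
  `I⁺(S)`, `S` a Cauchy hypersurface, meets `S` at or before that point (the tree's
  `false_of_isEndlessCausalCurve_of_mem_chronologicalFuture`, whose proof only uses the past half of
  the curve; adapted verbatim);
* `subdevelopmentFuturePlacement_holds : SubdevelopmentFuturePlacement` — if a Cauchy development
  `𝒦` embeds isometrically, openly and future-preservingly into a spacetime `𝒮` by `χ`, then
  `χ(I⁺(ι N)) ⊆ D⁺_𝒮(χ(ι N))` for the FAITHFUL future domain of dependence `futureDomain` of the
  line's vocabulary: the maximal piece inside the open set `χ(𝒦)` of a past-endless causal curve of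
  `𝒮` lifts to a past-endless causal curve of `𝒦` (`IsFutureCausalCurveOn.invFun_comp`,
  `not_hasPastEndpoint_connectedComponentIn`) and the one-sided lemma applies in `𝒦`.

References: O'Neill 1983, Ch. 14, Lemma 14.29 [ONeillSemiRiemannian1983]; Hawking–Ellis 1973, §6.5
[HawkingEllis1973CUP]; Sbierski 2016, §3.3 [Sbierski2016AHP].
-/

noncomputable section

-- D-0017: single-problem summit, `Summit.<S>.<S>.…` by design (cf. lakefile `weak.linter.dupNamespace`).
set_option linter.dupNamespace false

open Set Filter Function Topology TopologicalSpace Bundle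
open scoped Manifold ContDiff Topology

namespace Literature.Geometry.Lorentzian

namespace LorentzianMetric

variable {E : Type*} [NormedAddCommGroup E] [NormedSpace ℝ E] {H : Type*} [TopologicalSpace H]
  {I : ModelWithCorners ℝ E H} {n : ℕ∞ω} {M : Type*} [TopologicalSpace M] [ChartedSpace H M]
  [IsManifold I ∞ M] {g : LorentzianMetric I n M} {τ : TimeOrientation g}

-- adapted from `Literature/Geometry/Lorentzian/CauchyHypersurfaceCausalProofs.lean`
-- (`IsCauchyHypersurface.false_of_isEndlessCausalCurve_of_mem_chronologicalFuture`: the endless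
-- curve is replaced by a past-endless one and the conclusion made positive)
/-- **One-sided form of O'Neill's Lemma 14.29**: on a Hausdorff, second countable,
finite-dimensional manifold without boundary with a `Cⁿ` (`n ≥ 2`) time-oriented Lorentzian metric,
a future causal curve `γ` on an interval `s` WITHOUT PAST ENDPOINT, through a point `γ t₀ ∈ I⁺(S)`
of the chronological future of a Cauchy hypersurface `S`, meets `S` at some parameter `t ≤ t₀`.
Proof (O'Neill's): otherwise the past half of `γ` lies in `I⁺(S)`; the avoidance lemma
(`exists_isPastEndless_timelike_shadow`) gives a past-endless timelike curve in `I⁺(S)` ending above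
`γ t₀`, whose endless future extension stays in `I⁺(S)` and must meet `S` — against achronality.
[cite: ONeillSemiRiemannian1983, Ch. 14, Lemma 29 (p. 415)] -/
theorem IsCauchyHypersurface.exists_mem_of_isPastEndless_of_mem_chronologicalFuture [T2Space M]
    [SecondCountableTopology M] [BoundarylessManifold I M] [FiniteDimensional ℝ E] (hn : 2 ≤ n)
    {S : Set M} (hS : g.IsCauchyHypersurface τ S) {γ : ℝ → M} {s : Set ℝ} (hs : s.OrdConnected)
    (hγc : g.IsFutureCausalCurveOn τ γ s) (hend : IsPastEndless γ s) {t₀ : ℝ} (ht₀ : t₀ ∈ s)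
    (hI : γ t₀ ∈ g.chronologicalFuture τ S) : ∃ t ∈ s, t ≤ t₀ ∧ γ t ∈ S := by
  by_contra hmiss
  push Not at hmiss
  have hn1 : (1 : ℕ∞ω) ≤ n := le_trans one_le_two hn
  have hA : g.IsAchronal τ S := IsCauchyHypersurface.isAchronal_holds hn hS
  have hdisj : Disjoint (g.chronologicalFuture τ S) S := (isAchronal_iff_disjoint S).mp hA
  have hdisj' : Disjoint (g.chronologicalFuture τ S) (g.chronologicalPast τ S) := by
    rw [Set.disjoint_left]
    rintro p hpF ⟨x, hx, μ, a, b, hab, hμ, hμa, hμb⟩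
    have hx' : x ∈ g.chronologicalFuture τ {p} :=
      ⟨p, rfl, fun t ↦ μ (a + b - t), a, b, hab,
        isFutureTimelikeCurveOn_reverse_reverse_iff.mp hμ.reverseParam, by simp [hμb],
        by simp [hμa]⟩
    exact Set.disjoint_left.mp hdisj (mem_chronologicalFuture_trans hpF hx') hx
  -- Step 1: the past half `J` of the curve lies in `I⁺(S)`
  set J : Set ℝ := s ∩ Iic t₀ with hJ_def
  have hJ : J.OrdConnected := hs.inter ordConnected_Iic
  have ht₀J : t₀ ∈ J := ⟨ht₀, mem_Iic.mpr le_rfl⟩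
  have hαJ : g.IsFutureCausalCurveOn τ γ J := hγc.mono inter_subset_left
  have hmissJ : ∀ t ∈ J, γ t ∉ S := fun t ht ↦ hmiss t ht.1 ht.2
  have hIJ : ∀ t ∈ J, γ t ∈ g.chronologicalFuture τ S := by
    have himg : γ '' J ⊆ g.chronologicalFuture τ S ∪ g.chronologicalPast τ S := by
      rintro _ ⟨t, ht, rfl⟩
      exact hS.mem_chronologicalFuture_union_chronologicalPast hn (hmissJ t ht)
    have hconn : IsPreconnected (γ '' J) :=
      hJ.isPreconnected.image γ fun t ht ↦ (hαJ.continuousAt ht).continuousWithinAt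
    rcases hconn.subset_or_subset (isOpen_chronologicalFuture_of_boundaryless g τ S)
      (isOpen_chronologicalPast_of_boundaryless g τ S) hdisj' himg with h | h
    · exact fun t ht ↦ h (mem_image_of_mem γ ht)
    · exact absurd (h (mem_image_of_mem γ ht₀J)) (Set.disjoint_left.mp hdisj' hI)
  -- Step 2: `γ|_J` is past endless; a non-convergent decreasing sequence of parameters
  have hendJ : IsPastEndless γ J := by
    refine ⟨⟨t₀, ht₀J⟩, fun P hP ↦ hend.2 P ?_⟩
    rwa [hasPastEndpoint_congr_set ht₀J ht₀ (fun t ht ↦ ⟨fun h ↦ h.1, fun h ↦ ⟨h, ht⟩⟩)] at hP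
  obtain ⟨t, htJ, hanti, ht0, -, hnc⟩ := exists_antitone_seq_not_tendsto hJ hendJ ht₀J
  -- Step 3: a point `p₀ ≫ γ t₀`, hence `p₀ ≫ γ (t 0)` by push-up
  obtain ⟨μ, ε, hε, hμ0, hμ⟩ := g.exists_isFutureTimelikeCurveOn_Ioo_of_isInteriorPoint τ
    (BoundarylessManifold.isInteriorPoint (I := I) (x := γ t₀))
  have hp₀ : μ (ε / 2) ∈ g.chronologicalFuture τ {γ t₀} :=
    ⟨γ t₀, rfl, μ, 0, ε / 2, by positivity,
      hμ.mono (Icc_subset_Ioo (by linarith) (by linarith)), hμ0, rfl⟩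
  have hp₀' : μ (ε / 2) ∈ g.chronologicalFuture τ {γ (t 0)} := by
    refine mem_chronologicalFuture_of_mem_causalFuture hn1 ?_ hp₀
    rcases ht0.eq_or_lt with h | h
    · rw [h]; exact subset_causalFuture g τ _ (mem_singleton _)
    · exact Or.inr ⟨γ (t 0), rfl, γ, t 0, t₀, h, hαJ.mono (hJ.out (htJ 0) ht₀J), rfl, rfl⟩
  -- Step 4: the shadowing past-endless timelike curve, inside `I⁺(S)`
  obtain ⟨β, D, hD, h0D, hD0, hβ, hβend, hβ0, hβI⟩ :=
    exists_isPastEndless_timelike_shadow hn1 hJ hαJ htJ hanti hnc hp₀'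
  have hβS : ∀ u ∈ D, β u ∈ g.chronologicalFuture τ S := by
    intro u hu
    obtain ⟨j, hj⟩ := hβI u hu
    exact mem_chronologicalFuture_trans (hIJ _ (htJ j)) hj
  -- Step 5: extend to the future; the endless timelike curve stays in `I⁺(S)` yet meets `S`
  obtain ⟨Δ, D', hΔ, -, hΔD, hΔI⟩ :=
    exists_isEndlessTimelikeCurve_extends_future hn hD h0D hD0 hβ hβend
  have hp₀S : μ (ε / 2) ∈ g.chronologicalFuture τ S := mem_chronologicalFuture_trans (hIJ t₀ ht₀J) hp₀
  have hΔS : ∀ t ∈ D', Δ t ∈ g.chronologicalFuture τ S := by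
    intro t ht
    by_cases htD : t ∈ D
    · rw [hΔD t htD]; exact hβS t htD
    · have := hΔI t ht htD
      rw [hβ0] at this
      exact mem_chronologicalFuture_trans hp₀S this
  obtain ⟨t₁, ⟨ht₁, ht₁S⟩, -⟩ := hS Δ D' hΔ
  exact Set.disjoint_left.mp hdisj (hΔS t₁ ht₁) ht₁S


end LorentzianMetric

end Literature.Geometry.Lorentzian

namespace Summit.FinalStateConjecture.FinalStateConjecture.Theorems.BondiBartnikRigidity.DirectMethod

namespace F1Route

open Literature.Geometry.Lorentzian


/-- **(E) holds**: `χ(I⁺(ι N)) ⊆ D⁺_𝒮(χ(ι N))` (faithful future domain of dependence). Given a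
past-endless causal curve `γ` of `𝒮` through `χ y`, `y ∈ I⁺_𝒦(ι N)`, its maximal piece `γ|_J`
inside the open set `χ(𝒦)` lifts along the injective local isometry `χ` to a future causal curve
`δ = χ⁻¹ ∘ γ` of `𝒦` (`IsFutureCausalCurveOn.invFun_comp`), past-endless in `𝒦` (an endpoint
`e` would make `χ e ∈ χ(𝒦)` a past endpoint of `γ|_J`, `not_hasPastEndpoint_connectedComponentIn`);
by the one-sided Lemma 14.29 in `𝒦`, `δ` meets `ι N` at some `t ≤ t₀`, so `γ t ∈ χ(ι N)`.
[cite: ONeillSemiRiemannian1983, Ch. 14, Lemma 29 (p. 415)] [cite: Sbierski2016AHP, §3.3] -/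
theorem subdevelopmentFuturePlacement_holds : SubdevelopmentFuturePlacement := by
  intro N _ _ _ _ D₁ 𝒦 𝒮 χ hχs hχo hχi hχt
  rintro _ ⟨y, hy, rfl⟩ γ s hs hγ hend t₀ ht₀ hγt₀
  classical
  have hn2 : (2 : ℕ∞ω) ≤ ((⊤ : ℕ∞) : ℕ∞ω) := WithTop.coe_le_coe.mpr le_top
  set O : Set 𝒮.carrier := range χ with hO_def
  have hO : IsOpen O := hχo.isOpen_range
  have hγO : γ t₀ ∈ O := ⟨y, hγt₀.symm⟩
  -- the maximal piece of `γ` inside `O` through `t₀`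
  set J : Set ℝ := connectedComponentIn (s ∩ γ ⁻¹' O) t₀ with hJ_def
  have ht₀J : t₀ ∈ J := mem_connectedComponentIn ⟨ht₀, hγO⟩
  have hJsub : J ⊆ s ∩ γ ⁻¹' O := connectedComponentIn_subset _ _
  have hJord : J.OrdConnected :=
    isPreconnected_iff_ordConnected.1 isPreconnected_connectedComponentIn
  -- the lift `δ = χ⁻¹ ∘ γ` on `J`
  set δ : ℝ → 𝒦.carrier := Function.invFun χ ∘ γ with hδ_def
  have hχδ : ∀ t ∈ J, χ (δ t) = γ t := fun t ht ↦ Function.invFun_eq (hJsub ht).2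
  have hloc : IsLocalDiffeomorph (𝓡 4) (𝓡 4) ∞ χ :=
    LorentzianMetric.isLocalDiffeomorph_of_isIsometricImmersion hχi
  have hδc : 𝒦.metric.IsFutureCausalCurveOn 𝒦.timeOrientation δ J :=
    LorentzianMetric.IsFutureCausalCurveOn.invFun_comp hχi hχt hχo.injective hloc
      (hγ.mono fun t ht ↦ (hJsub ht).1) fun t ht ↦ (hJsub ht).2
  -- `δ|_J` is past endless in `𝒦`
  have hδend : IsPastEndless δ J := by
    refine ⟨⟨t₀, ht₀J⟩, fun e he ↦ ?_⟩
    have hγe : HasPastEndpoint γ J (χ e) := by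
      have h1 : HasPastEndpoint (χ ∘ δ) J (χ e) := (hχs.continuous.tendsto e).comp he
      exact h1.congr fun t ↦ hχδ t t.2
    exact not_hasPastEndpoint_connectedComponentIn hs (fun t ht ↦ hγ.continuousAt ht) hend hO ht₀
      hγO ⟨e, rfl⟩ hγe
  -- `δ t₀ = y ∈ I⁺(ι N)`
  have hδt₀ : δ t₀ = y := hχo.injective ((hχδ t₀ ht₀J).trans hγt₀)
  have hI : δ t₀ ∈ 𝒦.metric.chronologicalFuture 𝒦.timeOrientation (range 𝒦.embed) := by
    rw [hδt₀]; exact hy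
  obtain ⟨t, htJ, htt₀, htS⟩ :=
    𝒦.isCauchyHypersurface.exists_mem_of_isPastEndless_of_mem_chronologicalFuture hn2 hJord hδc
      hδend ht₀J hI
  exact ⟨t, (hJsub htJ).1, htt₀, δ t, htS, hχδ t htJ⟩


end F1Route

end Summit.FinalStateConjecture.FinalStateConjecture.Theorems.BondiBartnikRigidity.DirectMethod

end


/-! ## merged part 3: `stub_slabCauchyRigidity_localisation.lean` -/


/-!
# F1 `stub_slabCauchyRigidity`, step (d): the localisation principle in Literature vocabulary
# (`SubdataDevelopmentsEmbedLit`) from MGHD existence — line `direct-method-on-the-cone`,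
# crux `BondiBartnikRigidity` (stmt-FinalStateConjecture-10807), worker F1

The route statement (D) `SubdataDevelopmentsEmbedLit` of `stub_slabCauchyRigidity.lean` is,
verbatim, the body of route item `SubdataDevelopmentsEmbed` (stmt-FinalStateConjecture-10053) of
route `SwallowTheDatum`, which the tree closes CONDITIONALLY on the single named fact
`choquetBruhat_geroch_exists_mghd_cauchy` in
`Theorems/SwallowTheDatumSubdataDevelopmentsEmbedLocalisationHolds.lean` — but over the THESES name,
which a Theorems file of another route cannot import.  This file re-derives the same closing line
over the Literature-vocabulary statement, by ADAPTING (verbatim, `-- adapted from …` below) the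
three declarations of `…SubdataDevelopmentsEmbedLocalisation.lean` whose import closure contains
the Theses module (`not_clusterPt_map_of_mem`, `exists_realised_rel`,
`subdataDevelopmentsEmbed_of_choquetBruhatGeroch_of_causalCompact`) and the ten-line
`exists_isMaximal_of_nonempty_of_choquetBruhatGeroch` of `…SubdataDevelopmentsEmbed.lean`; every
other ingredient (`…NcbDomain`, `…HmaxGlue`, `…Realise`, the Literature gluing files) is imported.

* `subdataDevelopmentsEmbedLit_of_choquetBruhatGeroch :
    choquetBruhat_geroch_exists_mghd_cauchy → SubdataDevelopmentsEmbedLit`.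

References: Hawking–Ellis 1973, §7.6, pp. 249–251 [HawkingEllis1973CUP]; Choquet-Bruhat–Geroch
1969, Thm. 3 and p. 334 [ChoquetBruhatGeroch1969CMP]; Sbierski 2016, §2, Def. 2.4 [Sbierski2016AHP].
-/

noncomputable section

-- D-0017: single-problem summit, `Summit.<S>.<S>.…` by design (cf. lakefile `weak.linter.dupNamespace`).
set_option linter.dupNamespace false

open Function Set Filter Topology TopologicalSpace Bundle
open scoped Manifold ContDiff Topology

namespace Summit.FinalStateConjecture.FinalStateConjecture.Theorems.BondiBartnikRigidity.DirectMethod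

namespace F1Route

open Literature.Geometry.Lorentzian
open Summit.FinalStateConjecture.FinalStateConjecture.Theorems.SubdataDevelopmentsEmbed

universe u


-- adapted from `Theorems/SwallowTheDatumSubdataDevelopmentsEmbed.lean`
-- (`exists_isMaximal_of_nonempty_of_choquetBruhatGeroch`, verbatim)
/-- **MGHD existence for developable data, from the named fact** `choquetBruhat_geroch_exists_mghd_cauchy`
(Choquet-Bruhat–Geroch 1969, Thm. 3): the data of a vacuum Cauchy development solve the constraints
(`InitialDataSet.isVacuumConstraintSolution_of_dataEmbedding`). [cite: ChoquetBruhatGeroch1969CMP, Thm. 3] -/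
theorem exists_isMaximal_of_nonempty_of_choquetBruhatGeroch'
    (h : choquetBruhat_geroch_exists_mghd_cauchy) (X : Type) [TopologicalSpace X]
    [ChartedSpace E3 X] [IsManifold (𝓡 3) ∞ X] [T2Space X] [SecondCountableTopology X]
    [ConnectedSpace X] (D : InitialDataSet (𝓡 3) X) (hD : Nonempty (VacuumCauchyDevelopment D)) :
    ∃ 𝒟 : VacuumCauchyDevelopment D, 𝒟.IsMaximal := by
  obtain ⟨𝒟₀⟩ := hD
  haveI := D.metric.hasLeviCivita
  exact h X D (InitialDataSet.isVacuumConstraintSolution_of_dataEmbedding 𝒟₀.toDataEmbedding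
    𝒟₀.isVacuum fun x ↦ 𝒟₀.contMDiffAt_embed_normal x)


-- adapted from `Theorems/SwallowTheDatumSubdataDevelopmentsEmbedLocalisation.lean`
-- (`not_clusterPt_map_of_mem`, `exists_realised_rel`: verbatim)
/-- **An injective map which is open on the open set `U` has no cluster value `ψ y₀`, `y₀ ∈ U`,
along `U` at a point of the frontier of `U`**: a closed neighbourhood `B ⊆ U` of `y₀` has
`ψ(int B ∩ U)` as a neighbourhood of `ψ y₀`, points of `U` near `p` mapped into it lie in `B`
(injectivity), so `p ∈ B ⊆ U`, while `p ∈ ∂U` and `U` is open. [folklore] -/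
theorem not_clusterPt_map_of_mem {α β : Type*} [TopologicalSpace α] [TopologicalSpace β]
    [RegularSpace α] {U : Set α} (hU : IsOpen U) {ψ : α → β} (hinj : InjOn ψ U)
    (hopen : ∀ B : Set α, IsOpen B → IsOpen (ψ '' (B ∩ U))) {p : α} (hp : p ∈ frontier U)
    {y₀ : α} (hy₀ : y₀ ∈ U) : ¬ ClusterPt (ψ y₀) (map ψ (𝓝[U] p)) := by
  intro hq
  obtain ⟨B, hBn, hBc, hBU⟩ := exists_mem_nhds_isClosed_subset (hU.mem_nhds hy₀)
  have hO : ψ '' (interior B ∩ U) ∈ 𝓝 (ψ y₀) :=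
    (hopen _ isOpen_interior).mem_nhds ⟨y₀, ⟨mem_interior_iff_mem_nhds.2 hBn, hy₀⟩, rfl⟩
  have hpB : p ∈ closure B := by
    rw [mem_closure_iff_nhds]
    intro W hW
    have hmem : ψ '' (W ∩ U) ∈ map ψ (𝓝[U] p) :=
      image_mem_map (Filter.inter_mem (mem_nhdsWithin_of_mem_nhds hW) self_mem_nhdsWithin)
    obtain ⟨z, hzO, hzW⟩ := (clusterPt_iff_nonempty.1 hq) hO hmem
    obtain ⟨b, ⟨hbB, hbU⟩, rfl⟩ := hzO
    obtain ⟨y, ⟨hyW, hyU⟩, hyb⟩ := hzW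
    have hyb' : y = b := hinj hyU hbU hyb
    exact ⟨y, hyW, hyb' ▸ interior_subset hbB⟩
  rw [hBc.closure_eq] at hpB
  have hpU : p ∈ interior U := by rw [hU.interior_eq]; exact hBU hpB
  exact hp.2 hpU


variable {n : ℕ}
  {N : Type u} [TopologicalSpace N] [ChartedSpace (EuclideanSpace ℝ (Fin n)) N]
  [IsManifold (𝓡 n) ∞ N] [ConnectedSpace N] {D₁ : InitialDataSet (𝓡 n) N}
  {X : Type u} [TopologicalSpace X] [ChartedSpace (EuclideanSpace ℝ (Fin n)) X]
  [IsManifold (𝓡 n) ∞ X] [ConnectedSpace X] {D₂ : InitialDataSet (𝓡 n) X}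

/-! ### Realising a development of the sub-datum inside another one, relative version -/

/-- **Realising a development `𝒰` of the sub-datum inside a development `𝒟₁` of the sub-datum,
as a relative common sub-development of `𝒟₁` and a development `𝒟₂` of the datum** (relative
form of Sbierski 2016, §2, Remark (2) after Def. 2.4, with EXPLICIT witnesses): if
`j : 𝒰 → 𝒟₁` is a smooth, time-orientation preserving, isometric open embedding with
`j ∘ ι_𝒰 = ι₁` and `k : 𝒰 → 𝒟₂` a smooth, time-orientation preserving isometric immersion with
`k ∘ ι_𝒰 = ι₂ ∘ Φ`, then `(U, ψ) = (j(𝒰), k ∘ j⁻¹)` satisfies the seven displayed conjuncts of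
a relative common sub-development over `Φ`, and moreover `U = j(𝒰)` and `ψ ∘ j = k`. The proof
is that of `exists_realised_of_embedsInto` (the case `Φ = id`), verbatim.
[cite: Sbierski2016AHP, §2, Def. 2.4 and Remark (2)] -/
theorem exists_realised_rel (𝒰 𝒟₁ : CauchyDevelopment D₁) (𝒟₂ : CauchyDevelopment D₂)
    {Φ : N → X} {j : 𝒰.carrier → 𝒟₁.carrier}
    (hjs : ContMDiff (𝓡 (n + 1)) (𝓡 (n + 1)) ∞ j) (hjo : IsOpenEmbedding j)
    (hji : 𝒰.metric.IsIsometricImmersion 𝒟₁.metric.toPseudoRiemannianMetric j)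
    (hjt : 𝒰.timeOrientation.PreservesTimeOrientation j 𝒟₁.timeOrientation)
    (hjc : j ∘ 𝒰.embed = 𝒟₁.embed)
    {k : 𝒰.carrier → 𝒟₂.carrier} (hks : ContMDiff (𝓡 (n + 1)) (𝓡 (n + 1)) ∞ k)
    (hki : 𝒰.metric.IsIsometricImmersion 𝒟₂.metric.toPseudoRiemannianMetric k)
    (hkt : 𝒰.timeOrientation.PreservesTimeOrientation k 𝒟₂.timeOrientation)
    (hkc : k ∘ 𝒰.embed = 𝒟₂.embed ∘ Φ) :
    ∃ (U : Opens 𝒟₁.carrier) (ψ : 𝒟₁.carrier → 𝒟₂.carrier),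
      ((∀ u, 𝒟₁.embed u ∈ U) ∧ IsConnected (U : Set 𝒟₁.carrier) ∧
      (𝒟₁.metric.restrict PseudoRiemannianMetric.contMDiff_restrict_holds U).IsCauchyHypersurface
        (𝒟₁.timeOrientation.restrict PseudoRiemannianMetric.contMDiff_restrict_holds
          𝒟₁.timeOrientation.contMDiff_restrict_holds U) (Subtype.val ⁻¹' range 𝒟₁.embed) ∧
      ContMDiffOn (𝓡 (n + 1)) (𝓡 (n + 1)) ∞ ψ U ∧
      (∀ p ∈ U, pullbackBilin (I := 𝓡 (n + 1)) (I' := 𝓡 (n + 1)) ψ 𝒟₂.metric.val p =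
        𝒟₁.metric.val p) ∧
      (∀ p ∈ U, 𝒟₂.timeOrientation.IsFutureDirected
        (mfderiv (𝓡 (n + 1)) (𝓡 (n + 1)) ψ p (𝒟₁.timeOrientation.vectorField p))) ∧
      ψ ∘ 𝒟₁.embed = 𝒟₂.embed ∘ Φ) ∧
      (U : Set 𝒟₁.carrier) = range j ∧ ∀ x, ψ (j x) = k x := by
  classical
  haveI : Nonempty 𝒰.carrier := inferInstance
  have hkd : MDifferentiable (𝓡 (n + 1)) (𝓡 (n + 1)) k := hks.mdifferentiable (by simp)
  set ji : 𝒟₁.carrier → 𝒰.carrier := invFun j with hji_def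
  have hleft : ∀ x, ji (j x) = x := leftInverse_invFun hjo.injective
  have hright : ∀ p ∈ range j, j (ji p) = p := fun p hp ↦ invFun_eq hp
  have hjis : ContMDiffOn (𝓡 (n + 1)) (𝓡 (n + 1)) ∞ ji (range j) :=
    contMDiffOn_invFun_range (𝒮 := 𝒰.toSpacetime) (𝒮' := 𝒟₁.toSpacetime) hji hjo.injective
  have hjid : ∀ p ∈ range j, MDifferentiableAt (𝓡 (n + 1)) (𝓡 (n + 1)) ji p := fun p hp ↦
    ((hjis p hp).contMDiffAt (hjo.isOpen_range.mem_nhds hp)).mdifferentiableAt (by simp)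
  -- `dj (dj⁻¹ w) = w` on the range
  have hdd : ∀ (x : 𝒰.carrier) (w : TangentSpace (𝓡 (n + 1)) (j x)),
      mfderiv (𝓡 (n + 1)) (𝓡 (n + 1)) j (ji (j x)) (mfderiv (𝓡 (n + 1)) (𝓡 (n + 1)) ji (j x) w)
        = w :=
    mfderiv_comp_mfderiv_invFun (𝒮 := 𝒰.toSpacetime) (𝒮' := 𝒟₁.toSpacetime) hji hjo.injective hjo
  -- scalar products: `g_𝒰 (dj⁻¹ v, dj⁻¹ w) = g₁ (v, w)` at points `j x`
  have hval : ∀ (x : 𝒰.carrier) (v w : TangentSpace (𝓡 (n + 1)) (j x)),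
      𝒰.metric.val (ji (j x)) (mfderiv (𝓡 (n + 1)) (𝓡 (n + 1)) ji (j x) v)
        (mfderiv (𝓡 (n + 1)) (𝓡 (n + 1)) ji (j x) w) = 𝒟₁.metric.val (j x) v w := by
    intro x v w
    have h := congrArg (fun b ↦ b (mfderiv (𝓡 (n + 1)) (𝓡 (n + 1)) ji (j x) v)
      (mfderiv (𝓡 (n + 1)) (𝓡 (n + 1)) ji (j x) w)) (hji.2 (ji (j x)))
    simp only [pullbackBilin_apply] at h
    rw [hdd, hdd] at h
    rw [hleft] at h ⊢
    exact h.symm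
  -- future-directed vectors: `dj⁻¹ v` is future-directed if `v` is (converse timecone lemma)
  have hfut : ∀ (x : 𝒰.carrier) (v : TangentSpace (𝓡 (n + 1)) (j x)),
      𝒟₁.timeOrientation.IsFutureDirected v →
        𝒰.timeOrientation.IsFutureDirected (mfderiv (𝓡 (n + 1)) (𝓡 (n + 1)) ji (j x) v) := by
    intro x v hv
    refine hjt.isFutureDirected_of_mfderiv hji.2 ?_
    rw [hdd]
    rw [hleft]
    exact hv
  refine ⟨⟨range j, hjo.isOpen_range⟩, k ∘ ji, ⟨fun u ↦ ?_, ?_, ?_, ?_, ?_, ?_, ?_⟩, rfl,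
    fun x ↦ ?_⟩
  · -- `ι₁ u = j (ι_𝒰 u) ∈ range j`
    exact ⟨𝒰.embed u, congrFun hjc u⟩
  · -- connected
    exact isConnected_range hjs.continuous
  · -- `ι₁(N)` is a Cauchy hypersurface of the sub-spacetime `range j`
    intro γ s hγ
    obtain ⟨hs, hγt, hγf, hγp⟩ := hγ
    have hγM : 𝒟₁.metric.IsFutureTimelikeCurveOn 𝒟₁.timeOrientation (Subtype.val ∘ γ) s :=
      (LorentzianMetric.isFutureTimelikeCurveOn_restrict_iff 𝒟₁.metric 𝒟₁.timeOrientation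
        PseudoRiemannianMetric.contMDiff_restrict_holds
        𝒟₁.timeOrientation.contMDiff_restrict_holds _).1 hγt
    -- the pulled-back curve in `𝒰`
    set δ : ℝ → 𝒰.carrier := fun t ↦ ji (γ t : 𝒟₁.carrier) with hδ_def
    have hjδ : ∀ t, j (δ t) = (γ t : 𝒟₁.carrier) := fun t ↦ hright _ (γ t).2
    have hδt : 𝒰.metric.IsFutureTimelikeCurveOn 𝒰.timeOrientation δ s := by
      intro t ht
      obtain ⟨hd, h1, h2⟩ := hγM t ht
      obtain ⟨x, hx⟩ := (γ t).2
      have hdδ : HasMFDerivAt 𝓘(ℝ, ℝ) (𝓡 (n + 1)) δ t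
          ((mfderiv (𝓡 (n + 1)) (𝓡 (n + 1)) ji (γ t : 𝒟₁.carrier)).comp
            (mfderiv 𝓘(ℝ, ℝ) (𝓡 (n + 1)) (Subtype.val ∘ γ) t)) :=
        (hjid _ (γ t).2).hasMFDerivAt.comp t hd.hasMFDerivAt
      have hvel : velocity (𝓡 (n + 1)) δ t =
          mfderiv (𝓡 (n + 1)) (𝓡 (n + 1)) ji (γ t : 𝒟₁.carrier)
            (velocity (𝓡 (n + 1)) (Subtype.val ∘ γ) t) := by
        simp only [velocity]; rw [hdδ.mfderiv]; rfl
      refine ⟨hdδ.mdifferentiableAt, ?_, ?_⟩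
      · -- timelike
        change 𝒰.metric.val (δ t) (velocity (𝓡 (n + 1)) δ t) (velocity (𝓡 (n + 1)) δ t) < 0
        rw [hvel]
        have hv := hval x
        rw [hx] at hv
        rw [show δ t = ji (γ t : 𝒟₁.carrier) from rfl, hv]
        exact h1
      · -- future-directed
        rw [hvel]
        have hf := hfut x
        rw [hx] at hf
        exact hf _ h2
    -- endlessness transported along the homeomorphism `j : 𝒰 ≅ range j`
    have hδf : IsFutureEndless δ s := by
      refine ⟨hγf.1, fun q hq ↦ hγf.2 ⟨j q, q, rfl⟩ ?_⟩
      have h1 : HasFutureEndpoint (j ∘ δ) s (j q) := (hjs.continuous.tendsto q).comp hq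
      have h2 : HasFutureEndpoint (Subtype.val ∘ γ) s (j q) := h1.congr fun t ↦ hjδ t
      exact hasFutureEndpoint_subtypeVal_comp_iff.1 h2
    have hδp : IsPastEndless δ s := by
      refine ⟨hγp.1, fun q hq ↦ hγp.2 ⟨j q, q, rfl⟩ ?_⟩
      have h1 : HasPastEndpoint (j ∘ δ) s (j q) := (hjs.continuous.tendsto q).comp hq
      have h2 : HasPastEndpoint (Subtype.val ∘ γ) s (j q) := h1.congr fun t ↦ hjδ t
      exact hasPastEndpoint_subtypeVal_comp_iff.1 h2
    -- `δ` meets `ι_𝒰(N)` exactly once; crossings correspond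
    obtain ⟨t₀, ⟨ht₀s, u₀, hu₀⟩, huniq⟩ := 𝒰.isCauchyHypersurface δ s ⟨hs, hδt, hδf, hδp⟩
    refine ⟨t₀, ⟨ht₀s, u₀, ?_⟩, fun t ht ↦ huniq t ⟨ht.1, ?_⟩⟩
    · -- `γ t₀ = j (δ t₀) = j (ι_𝒰 u₀) = ι₁ u₀`
      show 𝒟₁.embed u₀ = (γ t₀ : 𝒟₁.carrier)
      rw [← hjδ t₀, ← hu₀]; exact (congrFun hjc u₀).symm
    · obtain ⟨u, hu⟩ := ht.2
      refine ⟨u, ?_⟩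
      show 𝒰.embed u = ji (γ t : 𝒟₁.carrier)
      rw [← hu, show 𝒟₁.embed u = j (𝒰.embed u) from (congrFun hjc u).symm, hleft]
  · -- smooth on `range j`
    exact hks.comp_contMDiffOn hjis
  · -- isometric on `range j`
    rintro _ ⟨x, rfl⟩
    ext v w
    have hc := mfderiv_comp (j x) (hkd (ji (j x))) (hjid (j x) ⟨x, rfl⟩)
    have hk := congrArg (fun b ↦ b (mfderiv (𝓡 (n + 1)) (𝓡 (n + 1)) ji (j x) v)
      (mfderiv (𝓡 (n + 1)) (𝓡 (n + 1)) ji (j x) w)) (hki.2 (ji (j x)))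
    simp only [pullbackBilin_apply] at hk ⊢
    rw [hc]
    exact hk.trans (hval x v w)
  · -- time-orientation preserving on `range j`
    rintro _ ⟨x, rfl⟩
    rw [mfderiv_comp (j x) (hkd (ji (j x))) (hjid (j x) ⟨x, rfl⟩)]
    exact hkt.isFutureDirected_mfderiv hki.2
      (hfut x _ (𝒟₁.timeOrientation.isFutureDirected_vectorField (j x)))
  · -- `(k ∘ j⁻¹) ∘ ι₁ = k ∘ ι_𝒰 = ι₂ ∘ Φ`
    funext u
    show k (ji (𝒟₁.embed u)) = 𝒟₂.embed (Φ u)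
    rw [show 𝒟₁.embed u = j (𝒰.embed u) from (congrFun hjc u).symm, hleft]
    exact congrFun hkc u
  · -- `ψ (j x) = k x`
    show k (ji (j x)) = k x
    rw [hleft]


/-! ### The item from MGHD existence -/

-- adapted from `Theorems/SwallowTheDatumSubdataDevelopmentsEmbedLocalisation.lean`
-- (`subdataDevelopmentsEmbed_of_choquetBruhatGeroch_of_causalCompact`: target restated over (D))
/-- **`SubdataDevelopmentsEmbed` from the existence of maximal globally hyperbolic vacuum
developments and the global hyperbolicity of Cauchy developments** (Hawking–Ellis 1973, §7.6,
p. 251; Choquet-Bruhat–Geroch 1969, p. 334): under the named facts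
`choquetBruhat_geroch_exists_mghd_cauchy` (Choquet-Bruhat–Geroch 1969, Thm. 3) and
`hawkingEllis_cauchyDevelopment_causalCompact_closed` (Hawking–Ellis 1973, Prop. 6.6.6; a theorem
of the tree, `…_holds`), every vacuum Cauchy development `𝒟'` of the sub-datum `Φ^* D` embeds
over `Φ` into every MAXIMAL vacuum Cauchy development `𝒟` of `D`. Proof: let `M̃` be a maximal
development of `Φ^* D` (the sub-datum is developable, by `𝒟'`; `N` inherits the Hausdorff and
second countability properties through the open embedding `Φ`), `R = (V, g|_V, ι ∘ Φ)` the domain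
of dependence of `ι(Φ N)` in `𝒟` (`exists_cauchyPieceDomain`), `θ : R → M̃` the embedding given
by maximality of `M̃`, `(U, ψ) = (θ(R), θ⁻¹)` the realised relative common sub-development of
`M̃` and `𝒟` (`exists_realised_rel`). A cluster point `q` of `ψ` at `∂U` lies off the closure of
the bad set of `K = ι(X) ∖ ι(Φ N)` (`not_mem_closure_badSet_of_clusterPt`), hence in `V = ψ(U)` —
impossible (`not_clusterPt_map_of_mem`). So `Z = 𝒟 ∪_ψ M̃` is a vacuum Cauchy development of
`D` receiving `M̃` over `Φ` (`hglue_of_relGluing`); `Z` embeds into the maximal `𝒟`, and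
`𝒟' → M̃ → Z → 𝒟` is the embedding. [cite: HawkingEllis1973CUP, §7.6, pp. 249–251]
[cite: ChoquetBruhatGeroch1969CMP, Thm. 3 and p. 334] -/
theorem subdataDevelopmentsEmbedLit_of_choquetBruhatGeroch_of_causalCompact
    (hcbg : choquetBruhat_geroch_exists_mghd_cauchy)
    (hgh : hawkingEllis_cauchyDevelopment_causalCompact_closed) :
    SubdataDevelopmentsEmbedLit := by
  intro X _ _ _ _ _ _ D 𝒟 hmax N _ _ _ _ Φ hΦ hΦ' hΦo 𝒟'
  classical
  -- `N` is Hausdorff and second countable (open embedding into `X`)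
  haveI : T2Space N := hΦo.isEmbedding.t2Space
  haveI : SecondCountableTopology N := hΦo.isEmbedding.secondCountableTopology
  -- a maximal development `M` of the sub-datum
  obtain ⟨M, hM⟩ := exists_isMaximal_of_nonempty_of_choquetBruhatGeroch' hcbg N
    (D.comap Φ hΦ hΦ') ⟨𝒟'⟩
  -- the domain of dependence `V` of `ι(Φ N)` in `𝒟` and the development `R` of the sub-datum
  obtain ⟨n₀⟩ : Nonempty N := inferInstance
  have hslab : ∀ a ∈ range 𝒟.embed, ∃ ν : TangentSpace (𝓡 4) a,
      𝒟.metric.IsTimelike ν ∧ 𝒟.timeOrientation.IsFutureDirected ν ∧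
      ∀ κ : ℝ, 0 < κ → ∀ᶠ σ in 𝓝 a, σ ∈ range 𝒟.embed →
        |𝒟.metric.val a ν (extChartAt (𝓡 4) a σ - extChartAt (𝓡 4) a a)| ≤
          κ * ‖extChartAt (𝓡 4) a σ - extChartAt (𝓡 4) a a‖ := by
    rintro _ ⟨y, rfl⟩
    refine ⟨𝒟.normal y, ?_, 𝒟.isFutureUnitNormal.2 y, fun κ hκ ↦
      𝒟.toDataEmbedding.eventually_abs_val_normal_le y hκ⟩
    show 𝒟.metric.val _ (𝒟.normal y) (𝒟.normal y) < 0
    rw [𝒟.isFutureUnitNormal.1.2 y]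
    norm_num
  obtain ⟨V, -, hVc, hιV, hVcl, hVC⟩ := exists_cauchyPieceDomain 𝒟 hΦo hslab n₀
  have hν : ∀ u, MDifferentiableAt (𝓡 3) (𝓡 4).tangent
      (fun x ↦ (TotalSpace.mk' (EuclideanSpace ℝ (Fin 4)) (𝒟.embed x) (𝒟.normal x) :
        TangentBundle (𝓡 4) 𝒟.carrier)) (Φ u) := fun u ↦
    𝒟.toDataEmbedding.mdifferentiableAt_embed_normal (Φ u)
  have hVC' : (𝒟.metric.restrict PseudoRiemannianMetric.contMDiff_restrict_holds V).IsCauchyHypersurface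
      (𝒟.timeOrientation.restrict PseudoRiemannianMetric.contMDiff_restrict_holds
        𝒟.timeOrientation.contMDiff_restrict_holds V)
      (range ((𝒟.toDataEmbedding.comapAlong Φ hΦ hΦ' hΦo hν).embedOpens V hιV)) := by
    intro γ s hγ
    obtain ⟨t, ⟨hts, u, hu⟩, huniq⟩ := hVC γ s hγ
    refine ⟨t, ⟨hts, u, Subtype.ext hu⟩, fun t' ht' ↦ huniq t' ⟨ht'.1, ?_⟩⟩
    obtain ⟨u', hu'⟩ := ht'.2
    exact ⟨u', congrArg Subtype.val hu'⟩
  set R : VacuumCauchyDevelopment (D.comap Φ hΦ hΦ') :=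
    𝒟.comapAlongRestrict Φ hΦ hΦ' hΦo hν V hVc hιV hVC' with hR_def
  -- `θ : R → M` by maximality of `M`
  obtain ⟨θ, hθs, hθo, hθi, hθt, hθc⟩ := hM R
  -- the inclusion `k = Subtype.val : R → 𝒟` over `Φ`
  set k : R.carrier → 𝒟.carrier := fun y ↦ y.1 with hk_def
  have hks : ContMDiff (𝓡 4) (𝓡 4) ∞ k := contMDiff_subtype_val
  have hki : R.metric.IsIsometricImmersion 𝒟.metric.toPseudoRiemannianMetric k := by
    refine ⟨hks, fun y ↦ ?_⟩
    ext v w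
    rw [pullbackBilin_apply]
    change 𝒟.metric.val y.1 (mfderiv (𝓡 4) (𝓡 4) (Subtype.val : V → 𝒟.carrier) y v)
      (mfderiv (𝓡 4) (𝓡 4) (Subtype.val : V → 𝒟.carrier) y w) = 𝒟.metric.val y.1 v w
    rw [mfderiv_subtypeVal]
    rfl
  have hkt : R.timeOrientation.PreservesTimeOrientation k 𝒟.timeOrientation := fun y ↦ by
    change 𝒟.timeOrientation.IsFutureDirected
      (mfderiv (𝓡 4) (𝓡 4) (Subtype.val : V → 𝒟.carrier) y (𝒟.timeOrientation.vectorField y.1))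
    rw [mfderiv_subtypeVal]
    exact 𝒟.timeOrientation.isFutureDirected_vectorField y.1
  have hkc : k ∘ R.embed = 𝒟.embed ∘ Φ := rfl
  -- realise `R` inside `M` through `θ`: `(U, ψ) = (θ(R), val ∘ θ⁻¹)`
  obtain ⟨U, ψ, hP, hUeq, hψθ⟩ := exists_realised_rel R.toCauchyDevelopment M.toCauchyDevelopment
    𝒟.toCauchyDevelopment hθs hθo hθi hθt hθc hks hki hkt hkc
  -- the image `ψ(U)` is `V`
  have himage : ψ '' (U : Set M.carrier) = (V : Set 𝒟.carrier) := by
    rw [hUeq]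
    ext z
    constructor
    · rintro ⟨_, ⟨r, rfl⟩, rfl⟩
      rw [hψθ]
      exact r.2
    · intro hz
      exact ⟨θ ⟨z, hz⟩, ⟨⟨z, hz⟩, rfl⟩, by rw [hψθ]⟩
  -- global hyperbolicity of `𝒟` and `M` (theorems of the tree)
  obtain ⟨hK, hK', hrel⟩ := hgh X D 𝒟.toCauchyDevelopment
  obtain ⟨hK₁, hK₁', -⟩ := hgh N (D.comap Φ hΦ hΦ') M.toCauchyDevelopment
  -- no cluster values of `ψ` at the frontier of `U`
  haveI : LocallyCompactSpace M.carrier :=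
    ChartedSpace.locallyCompactSpace (EuclideanSpace ℝ (Fin 4)) M.carrier
  have hncb : ∀ p ∈ frontier (U : Set M.carrier), ∀ q : 𝒟.carrier,
      ¬ ClusterPt q (map ψ (𝓝[(U : Set M.carrier)] p)) := by
    intro p hp q hq
    obtain ⟨hqF, -, hinj, hopen, -⟩ := not_mem_closure_badSet_of_clusterPt 𝒟 hΦ hΦ' hΦo M
      hK hK' hK₁ hK₁' (fun hx hy hxy ↦ hrel _ _ _ _ hx hy hxy)
      hslab U ψ hP hp hq
    -- `q ∈ closure ψ(U) = closure V`, hence `q ∈ V = ψ(U)`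
    have hle : map ψ (𝓝[(U : Set M.carrier)] p) ≤ 𝓟 (ψ '' (U : Set M.carrier)) := by
      rw [← map_principal]
      exact map_mono (le_principal_iff.2 self_mem_nhdsWithin)
    have hqcl : q ∈ closure (ψ '' (U : Set M.carrier)) :=
      mem_closure_iff_clusterPt.2 (hq.mono hle)
    rw [himage] at hqcl
    have hqV : q ∈ (V : Set 𝒟.carrier) := hVcl ⟨hqcl, hqF⟩
    rw [← himage] at hqV
    obtain ⟨y₀, hy₀U, rfl⟩ := hqV
    exact not_clusterPt_map_of_mem U.2 hinj hopen hp hy₀U hq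
  -- the gluing `Z = 𝒟 ∪_ψ M`, receiving `M` over `Φ`
  obtain ⟨Z, jZ, j', ⟨-, -, -, -, -⟩, ⟨hj's, hj'o, hj'i, hj't, hj'c⟩, -⟩ :=
    hglue_of_relGluing M 𝒟 hΦo.injective U ψ hP hncb
  -- maximality of `𝒟` absorbs `Z`; `𝒟'` embeds into `M`
  obtain ⟨ζ, hζs, hζo, hζi, hζt, hζc⟩ := hmax Z
  obtain ⟨χ', hχ's, hχ'o, hχ'i, hχ't, hχ'c⟩ := hM 𝒟'
  have hζj's : ContMDiff (𝓡 4) (𝓡 4) ∞ (ζ ∘ j') := hζs.comp hj's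
  have hζj'i : M.metric.IsIsometricImmersion 𝒟.metric.toPseudoRiemannianMetric (ζ ∘ j') :=
    hζi.comp hj'i
  refine ⟨(ζ ∘ j') ∘ χ', hζj's.comp hχ's, (hζo.comp hj'o).comp hχ'o, hζj'i.comp hχ'i,
    (hζt.comp hj't hζi.2 (hζs.mdifferentiable (by simp)) (hj's.mdifferentiable (by simp))).comp
      hχ't hζj'i.2 (hζj's.mdifferentiable (by simp)) (hχ's.mdifferentiable (by simp)), ?_⟩
  calc ((ζ ∘ j') ∘ χ') ∘ 𝒟'.embed = ζ ∘ j' ∘ (χ' ∘ 𝒟'.embed) := rfl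
    _ = ζ ∘ (j' ∘ M.embed) := by rw [hχ'c]
    _ = ζ ∘ (Z.embed ∘ Φ) := by rw [hj'c]
    _ = (ζ ∘ Z.embed) ∘ Φ := rfl
    _ = 𝒟.embed ∘ Φ := by rw [hζc]



/-- **(D) from MGHD existence alone**: `SubdataDevelopmentsEmbedLit` follows from the named fact
`choquetBruhat_geroch_exists_mghd_cauchy`, the global hyperbolicity input being the theorem
`hawkingEllis_cauchyDevelopment_causalCompact_closed_holds` of the tree. Hawking–Ellis 1973, §7.6,
p. 251. [cite: HawkingEllis1973CUP, §7.6, pp. 249–251] [cite: ChoquetBruhatGeroch1969CMP, Thm. 3 and p. 334] -/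
theorem subdataDevelopmentsEmbedLit_of_choquetBruhatGeroch
    (hcbg : choquetBruhat_geroch_exists_mghd_cauchy) : SubdataDevelopmentsEmbedLit :=
  subdataDevelopmentsEmbedLit_of_choquetBruhatGeroch_of_causalCompact hcbg
    hawkingEllis_cauchyDevelopment_causalCompact_closed_holds


end F1Route

end Summit.FinalStateConjecture.FinalStateConjecture.Theorems.BondiBartnikRigidity.DirectMethod

end


/-! ## merged part 4: `stub_slabCauchyRigidity_secondform.lean` -/


/-!
# F1 `stub_slabCauchyRigidity`, step (b), order `1`: the second fundamental form identity
# (`SlabSecondFormIdentity`) — line `direct-method-on-the-cone`, crux `BondiBartnikRigidity`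
# (stmt-FinalStateConjecture-10807), worker F1

Route statement (A2k) of `stub_slabCauchyRigidity.lean`: for a future-oriented exact collar chart (exact
`k'`-jet on the slab, `k' ≥ 1`) and a smooth `Φ_N` through which it factors on the open slab,
`Φ_N^* k = K_{ν_N}(ψ_N)` — the Kerr slab second fundamental form.

SEED FILE (the statement restated + the two generic congruence lemmas of the plan; the proof itself is
NOT here — see the report `stub_slabCauchyRigidity.report.md`, §4(b), for the typed plan:
`induced_k`, `secondFundamentalForm_comp_right`, `secondFundamentalForm_comap` on a sub-layer where
`dΦ₀` is injective, `OpensChart.secondFundamentalForm_eq_of_repr` on both chart domains,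
`christoffel_congr_point` with the order-`≤ 1` jet, and the normal pinned by (H8) through
`TimeOrientation.eq_of_isFutureUnitNormal`).
-/

noncomputable section

-- D-0017: single-problem summit, `Summit.<S>.<S>.…` by design (cf. lakefile `weak.linter.dupNamespace`).
set_option linter.dupNamespace false
set_option maxSynthPendingDepth 3

open Set Filter Function Topology TopologicalSpace Bundle
open Literature.Geometry.Lorentzian
open scoped Manifold ContDiff Topology ENNReal

/-! ### Two generic congruence lemmas -/

namespace Literature.Geometry.Lorentzian

namespace PseudoRiemannianMetric

section CongrK

variable {E : Type*} [NormedAddCommGroup E] [NormedSpace ℝ E] {H : Type*} [TopologicalSpace H]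
  {I : ModelWithCorners ℝ E H} {n : ℕ∞ω} {M : Type*} [TopologicalSpace M] [ChartedSpace H M]
  [IsManifold I ∞ M] [FiniteDimensional ℝ E]
  (g : PseudoRiemannianMetric I n E (TangentSpace I : M → Type _)) [g.HasLeviCivita]
  {E' : Type*} [NormedAddCommGroup E'] [NormedSpace ℝ E'] {H' : Type*} [TopologicalSpace H']
  {I' : ModelWithCorners ℝ E' H'} {N : Type*} [TopologicalSpace N] [ChartedSpace H' N]
  [FiniteDimensional ℝ E']

/-- The second fundamental form of `(f, ν)` only depends on the pair: congruence under `f₁ = f₂`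
and pointwise equality of the normal fields (all tangent spaces are the model space). [folklore] -/
theorem secondFundamentalForm_congr_pair {f₁ f₂ : N → M} (hf : f₁ = f₂) {ν₁ : NormalField I f₁}
    {ν₂ : NormalField I f₂} (hν : ∀ u, ν₁ u = ν₂ u) (y : N) :
    g.secondFundamentalForm I' f₁ ν₁ y = g.secondFundamentalForm I' f₂ ν₂ y := by
  subst hf
  have : ν₁ = ν₂ := funext hν
  subst this
  rfl


end CongrK

end PseudoRiemannianMetric

namespace OpensChart

variable {E : Type*} [NormedAddCommGroup E] [NormedSpace ℝ E] [FiniteDimensional ℝ E]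
  {V₁ V₂ : Opens E} {n : ℕ∞ω}
  {g₁ : PseudoRiemannianMetric 𝓘(ℝ, E) n E (TangentSpace 𝓘(ℝ, E) : V₁ → Type _)}
  {g₂ : PseudoRiemannianMetric 𝓘(ℝ, E) n E (TangentSpace 𝓘(ℝ, E) : V₂ → Type _)}
  {G₁ G₂ : E → E →L[ℝ] E →L[ℝ] ℝ}

/-- **The Christoffel map is local in the `1`-jet of the components**: two metrics on two chart
domains of `E` with the same value at a common point, and components with the same DERIVATIVE there,
have the same Christoffel map at that point (`Γ = ♯ ∘ ½ Koszul form`, the Koszul form being built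
from `DG` only, `sharp_congr_of_val_eq`; the base points need not even coincide). [cite: ONeill1983, Ch. 3, Prop. 3.13] -/
theorem christoffel_congr_point {x₁ : V₁} {x₂ : V₂}
    (hg : (g₁.val x₁ : E →L[ℝ] E →L[ℝ] ℝ) = g₂.val x₂)
    (hD : fderiv ℝ G₁ x₁ = fderiv ℝ G₂ x₂) (Y X : E) :
    christoffel g₁ G₁ x₁ Y X = christoffel g₂ G₂ x₂ Y X := by
  rw [christoffel_apply, christoffel_apply]
  have hK : koszulForm G₁ (x₁ : E) Y X = koszulForm G₂ (x₂ : E) Y X := by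
    refine LinearMap.ext fun Z ↦ ?_
    rw [koszulForm_apply, koszulForm_apply, hD]
  rw [hK]
  exact PseudoRiemannianMetric.sharp_congr_of_val_eq hg _


end OpensChart

end Literature.Geometry.Lorentzian

namespace Summit.FinalStateConjecture.FinalStateConjecture.Theorems.BondiBartnikRigidity.DirectMethod

namespace F1Route

/-! ### Restated vocabulary (verbatim from `stub_slabCauchyRigidity.lean`) -/







/-! ### (A2k): the proof -/

section Proof

variable {X : Type} [TopologicalSpace X] [ChartedSpace E3 X] [IsManifold (𝓡 3) ∞ X]

/-- `Λ⁻¹((Λ z + c) − c) = z`. -/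
theorem poincareInv_lab' (mo : lorentzGroup × E4) (z : E4) :
    poincareInv mo.1 mo.2 ((mo.1 : E4 ≃L[ℝ] E4) z + mo.2) = z := by
  simp [poincareInv]


set_option synthInstance.maxHeartbeats 200000 in
/-- Exactness at order `0` on the slab (restated from `stub_slabCauchyRigidity.lean`). -/
theorem deviation_eq_zero_of_truncDeviationCk_le_zero' {𝒮 : Spacetime.{0} 4} {B : ModelBackground}
    {Φ₀ : B.domain → 𝒮.carrier} {k : ℕ} {R τ : ℝ} (h : 𝒮.truncDeviationCk B Φ₀ k R τ ≤ 0)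
    {x : B.domain} (hx : x ∈ B.truncTimeSlab R τ) : 𝒮.deviation B Φ₀ x = 0 := by
  have hle := (enorm_iteratedFDeriv_le_supCkENorm (k := k) (m := 0) (Nat.zero_le _)
    (mem_image_of_mem Subtype.val hx) (𝒮.deviationExtend B Φ₀)).trans h
  have h0 : iteratedFDeriv ℝ 0 (𝒮.deviationExtend B Φ₀) x.1 = 0 := by
    have := le_antisymm hle zero_le
    rwa [enorm_eq_zero] at this
  have h1 := congrArg (fun F => F Fin.elim0) h0
  simp only [iteratedFDeriv_zero_apply, Spacetime.deviationExtend_coe] at h1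
  exact h1


/-- The open shell of `E3` underlying the open slab, as a chart domain of `E3`. -/
def slabN (M a : ℝ) : Opens E3 :=
  ⟨{z | max M 0 < Kerr.radius a (E4.ofTimeSpace 0 z) ∧ Kerr.radius a (E4.ofTimeSpace 0 z) < 3 * M},
    (isOpen_lt continuous_const ((Kerr.continuous_radius a).comp (E4.continuous_ofTimeSpace 0))).inter
      (isOpen_lt ((Kerr.continuous_radius a).comp (E4.continuous_ofTimeSpace 0)) continuous_const)⟩


/-- The identity reparametrisation `slabN ≅ slabW`. -/
def Θ (M a : ℝ) : slabN M a → slabW M a := fun z => ⟨⟨z.1, z.2.1⟩, z.2.2⟩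


theorem Θ_apply (M a : ℝ) (z : slabN M a) : ((Θ M a z : Kerr.slice a M) : E3) = z.1 := rfl


theorem contMDiff_Θ (M a : ℝ) : ContMDiff 𝓘(ℝ, E3) 𝓘(ℝ, E3) ∞ (Θ M a) := by
  have h1 : ContMDiff 𝓘(ℝ, E3) 𝓘(ℝ, E3) ∞ (fun z : slabN M a => (⟨z.1, z.2.1⟩ : Kerr.slice a M)) := by
    rw [← ContMDiff.subtypeVal_comp_iff]
    exact contMDiff_subtype_val
  rw [← ContMDiff.subtypeVal_comp_iff]
  exact h1


theorem mfderiv_Θ (M a : ℝ) (z : slabN M a) (v : E3) :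
    mfderiv 𝓘(ℝ, E3) 𝓘(ℝ, E3) (Θ M a) z v = v := by
  have hd0 : MDifferentiableAt 𝓘(ℝ, E3) 𝓘(ℝ, E3) (Subtype.val : slabN M a → E3) z :=
    (contMDiff_subtype_val (n := ∞)).mdifferentiableAt (by simp)
  have hd1 : MDifferentiableAt 𝓘(ℝ, E3) 𝓘(ℝ, E3)
      (fun z : slabN M a => (⟨z.1, z.2.1⟩ : Kerr.slice a M)) z :=
    OpensChart.mdifferentiableAt_codRestrict (U' := Kerr.slice a M)
      (φ := fun z : slabN M a => (⟨z.1, z.2.1⟩ : Kerr.slice a M))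
      (f := (Subtype.val : slabN M a → E3)) (fun _ => rfl) hd0
  rw [OpensChart.mfderiv_codRestrict (U' := slabW M a) (φ := Θ M a)
      (f := fun z : slabN M a => (⟨z.1, z.2.1⟩ : Kerr.slice a M)) (fun _ => rfl) hd1,
    OpensChart.mfderiv_codRestrict (U' := Kerr.slice a M)
      (φ := fun z : slabN M a => (⟨z.1, z.2.1⟩ : Kerr.slice a M))
      (f := (Subtype.val : slabN M a → E3)) (fun _ => rfl) hd0,
    mfderiv_subtypeVal]
  rfl


/-- A continuous linear injection out of `E4` is bounded below. -/
theorem exists_bound_of_injective {F : Type*} [NormedAddCommGroup F] [NormedSpace ℝ F]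
    (T : E4 →L[ℝ] F) (hT : Injective T) : ∃ c : ℝ, 0 < c ∧ ∀ v : E4, c * ‖v‖ ≤ ‖T v‖ := by
  obtain ⟨K, hK, hA⟩ := (LinearMap.injective_iff_antilipschitz (T : E4 →ₗ[ℝ] F)).1 hT
  refine ⟨(K : ℝ)⁻¹, by positivity, fun v => ?_⟩
  have h := hA.le_mul_dist v 0
  simp only [dist_zero_right, ContinuousLinearMap.coe_coe, map_zero] at h
  rw [inv_mul_le_iff₀ (by exact_mod_cast hK)]
  exact h


/-- A form close to a form bounded below by `c` is nondegenerate (`‖T − T₀‖ < c`). -/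
theorem nondegenerate_of_norm_sub_lt {T T₀ : E4 →L[ℝ] E4 →L[ℝ] ℝ} {c : ℝ}
    (hc : ∀ v : E4, c * ‖v‖ ≤ ‖T₀ v‖) (h : ‖T - T₀‖ < c) (v : E4) (hv : ∀ w, T v w = 0) : v = 0 := by
  by_contra hne
  have hvpos : 0 < ‖v‖ := norm_pos_iff.2 hne
  have hTv : T v = 0 := ContinuousLinearMap.ext fun w => by rw [hv w]; rfl
  have h1 : ‖T₀ v‖ ≤ ‖T - T₀‖ * ‖v‖ := by
    have : T₀ v = -((T - T₀) v) := by
      rw [sub_apply, hTv, zero_sub, neg_neg]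
    rw [this, norm_neg]
    exact (T - T₀).le_opNorm v
  have h2 : c * ‖v‖ ≤ ‖T - T₀‖ * ‖v‖ := (hc v).trans h1
  have := lt_of_le_of_lt (le_of_mul_le_mul_right h2 hvpos) h
  exact lt_irrefl _ this



set_option synthInstance.maxHeartbeats 400000 in
set_option maxHeartbeats 1600000 in
/-- **(A2k) holds** — the second fundamental form identity. -/
theorem slabSecondFormIdentity_holds : SlabSecondFormIdentity := by
  intro _ _ k' hk' X _ _ _ _ _ _ D 𝒱 M a mo B Φ₀ ΦN hJ _ y v w
  obtain ⟨hM, ha, hB, hΦ, hdev, hslab, hor, hΦNs, hιΦ⟩ := hJ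
  haveI hLC : 𝒱.metric.toPseudoRiemannianMetric.HasLeviCivita :=
    𝒱.metric.toPseudoRiemannianMetric.hasLeviCivita
  /- ## notation and elementary facts (as in the metric identity) -/
  set P : E4 → E4 := poincareInv mo.1 mo.2 with hP
  set Λ : E4 ≃L[ℝ] E4 := (mo.1 : E4 ≃L[ℝ] E4) with hΛ
  have hdom : (B.domain : Set E4) = P ⁻¹' (Kerr.region a M : Set E4) := by rw [hB]; rfl
  have htime : B.time = fun x => P x 0 := by rw [hB]; rfl
  have hrad : B.radius = fun x => Kerr.radius a (P x) := by rw [hB]; rfl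
  have hbil : B.bilin = boostedKerrBilin mo.1 mo.2 M a := by rw [hB]; rfl
  have hPreg : ∀ x : B.domain, P x.1 ∈ Kerr.region a M := fun x => by
    have hx : (x.1 : E4) ∈ (B.domain : Set E4) := x.2
    rw [hdom] at hx
    exact hx
  set A : E3 → E4 := fun z => Λ (E4.ofTimeSpace 0 z) + mo.2 with hA
  have hPA : ∀ z, P (A z) = E4.ofTimeSpace 0 z := fun z => poincareInv_lab' mo _
  have hAd : ∀ z, HasFDerivAt A ((Λ : E4 →L[ℝ] E4).comp E4.spaceEmbed) z :=
    fun z => ((Λ : E4 →L[ℝ] E4).hasFDerivAt.comp z (E4.hasFDerivAt_ofTimeSpace 0 z)).add_const mo.2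
  have hAs : ContDiff ℝ ∞ A :=
    ((Λ : E4 →L[ℝ] E4).contDiff.comp (E4.contDiff_ofTimeSpace 0)).add contDiff_const
  have hmem : ∀ y : slabW M a, A (y : E3) ∈ B.domain := fun y => (hιΦ y).1
  set eN : slabW M a → B.domain := fun y => ⟨A (y : E3), hmem y⟩ with heN
  have hcomp : ∀ y, 𝒱.embed (ΦN y) = Φ₀ (eN y) := fun y => (hιΦ y).2
  have heNs : ContMDiff 𝓘(ℝ, E3) 𝓘(ℝ, E4) ∞ eN := by
    rw [← ContMDiff.subtypeVal_comp_iff]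
    exact (hAs.contMDiff.comp contMDiff_subtype_val).comp contMDiff_subtype_val
  have hdeN : ∀ y : slabW M a, mfderiv 𝓘(ℝ, E3) 𝓘(ℝ, E4) eN y =
      ((Λ : E4 →L[ℝ] E4).comp E4.spaceEmbed) := by
    intro y
    have hdAz : MDifferentiableAt 𝓘(ℝ, E3) 𝓘(ℝ, E4) (fun z : Kerr.slice a M => A z.1) y.1 :=
      ((hAs.contMDiff.comp contMDiff_subtype_val) y.1).mdifferentiableAt (by simp)
    have hd1 : MDifferentiableAt 𝓘(ℝ, E3) 𝓘(ℝ, E4) (fun y : slabW M a => A (y : E3)) y :=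
      (((hAs.contMDiff.comp contMDiff_subtype_val).comp contMDiff_subtype_val) y).mdifferentiableAt
        (by simp)
    rw [OpensChart.mfderiv_codRestrict (U' := B.domain) (φ := eN) (f := fun y : slabW M a => A (y : E3))
        (fun _ => rfl) hd1,
      show (fun y : slabW M a => A (y : E3)) = (fun z : Kerr.slice a M => A z.1) ∘ Subtype.val from rfl,
      mfderiv_comp_subtypeVal hdAz,
      show (fun z : Kerr.slice a M => A z.1) = A ∘ Subtype.val from rfl,
      mfderiv_comp_subtypeVal (hAs.contMDiff.contMDiffAt.mdifferentiableAt (by simp)),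
      mfderiv_eq_fderiv, (hAd _).fderiv]
  have hslabmem : ∀ y : slabW M a, eN y ∈ B.truncTimeSlab (3 * M) 0 := fun y => by
    refine ⟨?_, ?_⟩
    · rw [htime]; show P (A _) 0 = 0; rw [hPA]; rfl
    · rw [hrad]; show Kerr.radius a (P (A _)) ≤ 3 * M; rw [hPA]; exact y.2.le
  have hlayer : ∀ y : slabW M a, eN y ∈
      {x : B.domain | -1 < B.time x.1 ∧ B.time x.1 < 1 ∧ B.radius x.1 < 3 * M + 1} := fun y => by
    obtain ⟨h0, hr⟩ := hslabmem y
    exact ⟨by rw [h0]; norm_num, by rw [h0]; norm_num, by linarith⟩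
  have hLo : IsOpen {x : B.domain | -1 < B.time x.1 ∧ B.time x.1 < 1 ∧ B.radius x.1 < 3 * M + 1} := by
    have ht : Continuous fun x : B.domain => B.time x.1 := by
      rw [htime]
      exact ((PiLp.continuous_apply 2 _ 0).comp (continuous_poincareInv _ _)).comp continuous_subtype_val
    have hr : Continuous fun x : B.domain => B.radius x.1 := by
      rw [hrad]
      exact ((Kerr.continuous_radius a).comp (continuous_poincareInv _ _)).comp continuous_subtype_val
    simp only [Set.setOf_and]
    exact (isOpen_lt continuous_const ht).inter ((isOpen_lt ht continuous_const).inter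
      (isOpen_lt hr continuous_const))
  have hΦ₀at : ∀ y : slabW M a, ContMDiffAt 𝓘(ℝ, E4) (𝓡 4) ∞ Φ₀ (eN y) := fun y =>
    (hΦ.1 _ (hlayer y)).contMDiffAt (hLo.mem_nhds (hlayer y))
  have hΦ₀d : ∀ y : slabW M a, MDifferentiableAt 𝓘(ℝ, E4) (𝓡 4) Φ₀ (eN y) := fun y =>
    (hΦ₀at y).mdifferentiableAt (by simp)
  have hΦNd : ∀ y, MDifferentiableAt (𝓡 3) (𝓡 3) ΦN y := fun y => (hΦNs y).mdifferentiableAt (by simp)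
  -- order-`0` exactness at slab points
  have hiso : ∀ (y : slabW M a) (v' w' : E4), 𝒱.metric.val (Φ₀ (eN y)) (mfderiv 𝓘(ℝ, E4) (𝓡 4) Φ₀ (eN y) v')
      (mfderiv 𝓘(ℝ, E4) (𝓡 4) Φ₀ (eN y) w') = B.bilin (eN y).1 v' w' := fun y v' w' => by
    have h := congrArg (fun b => b v' w') (deviation_eq_zero_of_truncDeviationCk_le_zero' hdev (hslabmem y))
    simp only [Spacetime.deviation_apply, zero_apply, sub_eq_zero] at h
    exact h
  have hbilK : ∀ (y : slabW M a) (v' w' : E4), B.bilin (eN y).1 (Λ v') (Λ w') =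
      Kerr.bilin M a (E4.ofTimeSpace 0 (y : E3)) v' w' := fun y v' w' => by
    rw [hbil, boostedKerrBilin_apply, ← hPA]
    show Kerr.bilin M a (P (A (y : E3))) (Λ.symm (Λ v')) (Λ.symm (Λ w')) = _
    rw [ContinuousLinearEquiv.symm_apply_apply, ContinuousLinearEquiv.symm_apply_apply]
  -- chain rule: `d(ι ∘ Φ_N) = dΦ₀ ∘ Λ ∘ (v ↦ (0, v))`
  have hd : ∀ (y : slabW M a) (u : E3),
      mfderiv (𝓡 3) (𝓡 4) 𝒱.embed (ΦN y) (mfderiv (𝓡 3) (𝓡 3) ΦN y u) =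
        mfderiv 𝓘(ℝ, E4) (𝓡 4) Φ₀ (eN y) (Λ (E4.spaceEmbed u)) := by
    intro y u
    have hfun : 𝒱.embed ∘ ΦN = Φ₀ ∘ eN := funext hcomp
    have h1 : mfderiv 𝓘(ℝ, E3) (𝓡 4) (𝒱.embed ∘ ΦN) y =
        (mfderiv (𝓡 3) (𝓡 4) 𝒱.embed (ΦN y)).comp (mfderiv (𝓡 3) (𝓡 3) ΦN y) :=
      mfderiv_comp y (𝒱.mdifferentiable_embed _) (hΦNd y)
    have h2 : mfderiv 𝓘(ℝ, E3) (𝓡 4) (Φ₀ ∘ eN) y =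
        (mfderiv 𝓘(ℝ, E4) (𝓡 4) Φ₀ (eN y)).comp (mfderiv 𝓘(ℝ, E3) 𝓘(ℝ, E4) eN y) :=
      mfderiv_comp y (hΦ₀d y) (heNs.mdifferentiableAt (by simp))
    rw [hfun, h2, hdeN y] at h1
    exact (DFunLike.congr_fun h1 u).symm
  /- ## the Kerr normal representative and the normal identification (where (H8) enters) -/
  set NK : E3 → E4 := fun z => (√(1 + 2 * Kerr.scalarH M a (E4.ofTimeSpace 0 z)))⁻¹ •
    Kerr.timeVector M a (E4.ofTimeSpace 0 z) with hNK
  have hνNK : ∀ y : slabW M a, (νN M a y : E4) = NK (y : E3) := fun y => rfl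
  obtain ⟨⟨hKn, hKu⟩, hKf⟩ := Kerr.isFutureUnitNormal_sliceNormal_holds M a M hM.le
  have hKsp := Kerr.isSpacelikeImmersion_sliceEmbed_holds M a M hM.le
  have hnormal : ∀ y : slabW M a,
      mfderiv 𝓘(ℝ, E4) (𝓡 4) Φ₀ (eN y) (Λ (NK (y : E3))) = 𝒱.normal (ΦN y) := by
    intro y
    have hr0 : 0 < Kerr.radius a (E4.ofTimeSpace 0 (y : E3)) :=
      Kerr.radius_pos_of_mem_region (Kerr.mem_slice_iff_ofTimeSpace_mem_region.1 y.1.2)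
    refine TimeOrientation.eq_of_isFutureUnitNormal 𝒱.timeOrientation (q := 𝒱.embed (ΦN y))
      (q' := Φ₀ (eN y)) (hcomp y) (mfderiv 𝓘(ℝ, E3) (𝓡 4) (𝒱.embed ∘ ΦN) y) ?_ ?_ ?_ ?_ ?_ ?_ ?_ ?_
    · -- the image of `d(ι ∘ Φ_N)` is spacelike
      intro u hu
      have e : mfderiv 𝓘(ℝ, E3) (𝓡 4) (𝒱.embed ∘ ΦN) y u =
          mfderiv (𝓡 3) (𝓡 4) 𝒱.embed (ΦN y) (mfderiv (𝓡 3) (𝓡 3) ΦN y u) := by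
        rw [mfderiv_comp y (𝒱.mdifferentiable_embed _) (hΦNd y)]; rfl
      show 0 < 𝒱.metric.val (𝒱.embed (ΦN y)) (mfderiv 𝓘(ℝ, E3) (𝓡 4) (𝒱.embed ∘ ΦN) y u)
        (mfderiv 𝓘(ℝ, E3) (𝓡 4) (𝒱.embed ∘ ΦN) y u)
      rw [e, hd y u, hcomp y, hiso, hbilK]
      have h := hKsp.2 y.1 u hu
      rw [PseudoRiemannianMetric.inducedBilin_apply, Kerr.mfderiv_sliceEmbed] at h
      exact h
    · show Module.finrank ℝ E3 + 1 = Module.finrank ℝ E4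
      simp [finrank_euclideanSpace]
    · -- `ν ⊥ d(ι ∘ Φ_N)`
      intro u
      have e : mfderiv 𝓘(ℝ, E3) (𝓡 4) (𝒱.embed ∘ ΦN) y u =
          mfderiv (𝓡 3) (𝓡 4) 𝒱.embed (ΦN y) (mfderiv (𝓡 3) (𝓡 3) ΦN y u) := by
        rw [mfderiv_comp y (𝒱.mdifferentiable_embed _) (hΦNd y)]; rfl
      show 𝒱.metric.val (𝒱.embed (ΦN y)) (𝒱.normal (ΦN y))
        (mfderiv 𝓘(ℝ, E3) (𝓡 4) (𝒱.embed ∘ ΦN) y u) = 0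
      rw [e]
      exact 𝒱.isFutureUnitNormal.1.1 (ΦN y) _
    · exact 𝒱.isFutureUnitNormal.1.2 (ΦN y)
    · exact 𝒱.isFutureUnitNormal.2 (ΦN y)
    · -- `dΦ₀ (Λ N_K) ⊥ d(ι ∘ Φ_N)` (Kerr normal ⊥ slice, transported by the exact chart)
      intro u
      have e : mfderiv 𝓘(ℝ, E3) (𝓡 4) (𝒱.embed ∘ ΦN) y u =
          mfderiv (𝓡 3) (𝓡 4) 𝒱.embed (ΦN y) (mfderiv (𝓡 3) (𝓡 3) ΦN y u) := by
        rw [mfderiv_comp y (𝒱.mdifferentiable_embed _) (hΦNd y)]; rfl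
      show 𝒱.metric.val (Φ₀ (eN y)) (mfderiv 𝓘(ℝ, E4) (𝓡 4) Φ₀ (eN y) (Λ (NK (y : E3))))
        (mfderiv 𝓘(ℝ, E3) (𝓡 4) (𝒱.embed ∘ ΦN) y u) = 0
      rw [e, hd y u, hiso, hbilK]
      have h := hKn y.1 u
      rw [Kerr.mfderiv_sliceEmbed] at h
      exact h
    · -- unit
      rw [hiso, hbilK]
      exact hKu y.1
    · -- future-directed: (H8) and positivity of the lapse factor
      have hpos : 0 < (√(1 + 2 * Kerr.scalarH M a (E4.ofTimeSpace 0 (y : E3))))⁻¹ := by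
        have : 0 < 1 + 2 * Kerr.scalarH M a (E4.ofTimeSpace 0 (y : E3)) := by
          linarith [Kerr.scalarH_nonneg hM.le a (E4.ofTimeSpace 0 (y : E3))]
        exact inv_pos.2 (Real.sqrt_pos.2 this)
      have hH8 := hor (eN y) (hslabmem y)
      rw [show P (eN y).1 = E4.ofTimeSpace 0 (y : E3) from hPA _] at hH8
      have e : Λ (NK (y : E3)) = (√(1 + 2 * Kerr.scalarH M a (E4.ofTimeSpace 0 (y : E3))))⁻¹ •
          Λ (Kerr.timeVector M a (E4.ofTimeSpace 0 (y : E3))) := by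
        simp only [hNK, map_smul]
      rw [e]
      convert hH8.smul hpos using 1
      exact (mfderiv 𝓘(ℝ, E4) (𝓡 4) Φ₀ (eN y)).map_smul _ _
  /- ## Step 1: the left-hand side as the second fundamental form of `ι ∘ Φ_N` -/
  set g := 𝒱.metric.toPseudoRiemannianMetric with hg_def
  have h_lhs : D.k (ΦN y) (mfderiv (𝓡 3) (𝓡 3) ΦN y v) (mfderiv (𝓡 3) (𝓡 3) ΦN y w) =
      g.secondFundamentalForm 𝓘(ℝ, E3) (𝒱.embed ∘ ΦN) (fun u => 𝒱.normal (ΦN u)) y v w := by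
    rw [g.secondFundamentalForm_comp_right (f := 𝒱.embed) (ν := 𝒱.normal) (Ψ := ΦN)
      BoundarylessManifold.isInteriorPoint BoundarylessManifold.isInteriorPoint
      (𝒱.mdifferentiableAt_embed_normal (ΦN y)) (hΦNd y) v w]
    have hk := 𝒱.induced_k (ΦN y)
    rw [hk, InitialDataSet.kBilin_apply]
  /- ## Step 2: the layer as a chart domain of `E4`, the chart `Φ_L`, its components `G̃` -/
  set layer : Set B.domain := {x : B.domain | -1 < B.time x.1 ∧ B.time x.1 < 1 ∧ B.radius x.1 < 3 * M + 1}
    with hlayer_def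
  set LE : Opens E4 := ⟨Subtype.val '' layer, B.domain.2.isOpenMap_subtype_val _ hLo⟩ with hLE
  have hLEsub : ∀ z : LE, (z : E4) ∈ (B.domain : Set E4) := fun z => by
    obtain ⟨x, -, hx⟩ := z.2; rw [← hx]; exact x.2
  have hLElayer : ∀ z : LE, (⟨z.1, hLEsub z⟩ : B.domain) ∈ layer := fun z => by
    obtain ⟨x, hx, hxz⟩ := z.2
    have : (⟨z.1, hLEsub z⟩ : B.domain) = x := Subtype.ext hxz.symm
    rw [this]; exact hx
  set jL : LE → B.domain := fun z => ⟨z.1, hLEsub z⟩ with hjL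
  have hjLs : ContMDiff 𝓘(ℝ, E4) 𝓘(ℝ, E4) ∞ jL := by
    rw [← ContMDiff.subtypeVal_comp_iff]; exact contMDiff_subtype_val
  have hdjL : ∀ z : LE, mfderiv 𝓘(ℝ, E4) 𝓘(ℝ, E4) jL z = ContinuousLinearMap.id ℝ E4 := fun z => by
    rw [OpensChart.mfderiv_codRestrict (U' := B.domain) (φ := jL) (f := (Subtype.val : LE → E4))
      (fun _ => rfl) ((contMDiff_subtype_val (n := ∞)).mdifferentiableAt (by simp)), mfderiv_subtypeVal]
  set ΦL : LE → 𝒱.carrier := Φ₀ ∘ jL with hΦL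
  have hΦLs : ContMDiff 𝓘(ℝ, E4) (𝓡 4) ∞ ΦL := hΦ.1.comp_contMDiff hjLs hLElayer
  have hdΦL : ∀ z : LE, mfderiv 𝓘(ℝ, E4) (𝓡 4) ΦL z = mfderiv 𝓘(ℝ, E4) (𝓡 4) Φ₀ (jL z) := fun z => by
    have hd0 : MDifferentiableAt 𝓘(ℝ, E4) (𝓡 4) Φ₀ (jL z) :=
      ((hΦ.1 _ (hLElayer z)).contMDiffAt (hLo.mem_nhds (hLElayer z))).mdifferentiableAt (by simp)
    rw [hΦL, mfderiv_comp z hd0 (hjLs.mdifferentiableAt (by simp)), hdjL]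
    exact ContinuousLinearMap.comp_id _
  set BL : ModelBackground := ⟨LE, B.bilin, B.time, B.radius⟩ with hBL
  -- the two deviations agree on the layer
  have hdevL : ∀ z : LE, 𝒱.toSpacetime.deviation BL ΦL z = 𝒱.toSpacetime.deviation B Φ₀ (jL z) := by
    intro z
    ext u u'
    rw [Spacetime.deviation_apply, Spacetime.deviation_apply, hdΦL]
    rfl
  have hdevLext : ∀ z : LE,
      𝒱.toSpacetime.deviationExtend BL ΦL =ᶠ[𝓝 (z : E4)] 𝒱.toSpacetime.deviationExtend B Φ₀ := by
    intro z
    filter_upwards [LE.2.mem_nhds z.2] with q hq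
    rw [show q = ((⟨q, hq⟩ : LE) : E4) from rfl, Spacetime.deviationExtend_coe, hdevL,
      show ((⟨q, hq⟩ : LE) : E4) = ((jL ⟨q, hq⟩ : B.domain) : E4) from rfl, Spacetime.deviationExtend_coe]
  -- the components `G̃ = (Φ_L^* g)` extended, smooth on the layer
  set Gt : E4 → E4 →L[ℝ] E4 →L[ℝ] ℝ := fun q => 𝒱.toSpacetime.deviationExtend BL ΦL q + B.bilin q
    with hGt
  have hGtval : ∀ (z : LE) (u u' : E4), Gt z.1 u u' =
      𝒱.metric.val (ΦL z) (mfderiv 𝓘(ℝ, E4) (𝓡 4) ΦL z u) (mfderiv 𝓘(ℝ, E4) (𝓡 4) ΦL z u') := by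
    intro z u u'
    simp only [hGt]
    rw [add_apply, add_apply, Spacetime.deviationExtend_coe,
      Spacetime.deviation_apply]
    show _ - B.bilin z.1 u u' + B.bilin z.1 u u' = _
    ring
  have hGts : ∀ z : LE, ContDiffAt ℝ ∞ Gt z := fun z => by
    have hr : 0 < Kerr.radius a (poincareInv mo.1 mo.2 (z : E4)) :=
      Kerr.radius_pos_of_mem_region (hPreg (jL z))
    have hb : ContDiffAt ℝ ∞ B.bilin (z : E4) := by rw [hbil]; exact contDiffAt_boostedKerrBilin _ _ _ _ hr
    exact (𝒱.toSpacetime.contDiffAt_deviationExtend_model BL hΦLs z hb).add hb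
  -- the slab point
  have hx₀LE : (eN y : E4) ∈ (LE : Set E4) := ⟨eN y, hlayer y, rfl⟩
  set x₀ : LE := ⟨(eN y : E4), hx₀LE⟩ with hx₀
  have hjx₀ : jL x₀ = eN y := Subtype.ext rfl
  have hGt0 : Gt (x₀ : E4) = B.bilin (eN y : E4) := by
    ext u u'
    rw [hGtval, hdΦL, hjx₀, show ΦL x₀ = Φ₀ (eN y) from congrArg Φ₀ hjx₀]
    exact hiso y u u'
  -- nondegeneracy bound of `g_B` at the slab point, and the sub-layer `O`
  have hB0inj : Injective (B.bilin (eN y : E4) : E4 →L[ℝ] E4 →L[ℝ] ℝ) := by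
    intro u₁ u₂ h
    have key : ∀ w' : E4, Kerr.bilin M a (E4.ofTimeSpace 0 (y : E3)) (Λ.symm (u₁ - u₂)) w' = 0 := by
      intro w'
      have e := congrArg (fun T : E4 →L[ℝ] ℝ => T (Λ w')) h
      rw [← hbilK, ContinuousLinearEquiv.apply_symm_apply, map_sub, sub_apply, sub_eq_zero]
      exact e
    have hr0 : 0 < Kerr.radius a (E4.ofTimeSpace 0 (y : E3)) :=
      Kerr.radius_pos_of_mem_region (Kerr.mem_slice_iff_ofTimeSpace_mem_region.1 y.1.2)
    have h0 := Kerr.bilin_nondegenerate M a hr0 _ key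
    have : u₁ - u₂ = 0 := by simpa using congrArg Λ h0
    exact sub_eq_zero.1 this
  obtain ⟨c, hc, hcb⟩ := exists_bound_of_injective _ hB0inj
  have hGtcont : ContinuousOn Gt (LE : Set E4) := fun q hq => (hGts ⟨q, hq⟩).continuousAt.continuousWithinAt
  set Oset : Set E4 := (LE : Set E4) ∩ Gt ⁻¹' Metric.ball (Gt (x₀ : E4)) (c / 2) with hOset
  have hOopen : IsOpen Oset := hGtcont.isOpen_inter_preimage LE.2 Metric.isOpen_ball
  set O : Opens E4 := ⟨Oset, hOopen⟩ with hO
  have hOx₀ : (x₀ : E4) ∈ O := ⟨x₀.2, Metric.mem_ball_self (by positivity)⟩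
  set jO : O → LE := fun z => ⟨z.1, z.2.1⟩ with hjO
  have hjOs : ContMDiff 𝓘(ℝ, E4) 𝓘(ℝ, E4) ∞ jO := by
    rw [← ContMDiff.subtypeVal_comp_iff]; exact contMDiff_subtype_val
  have hdjO : ∀ z : O, mfderiv 𝓘(ℝ, E4) 𝓘(ℝ, E4) jO z = ContinuousLinearMap.id ℝ E4 := fun z => by
    rw [OpensChart.mfderiv_codRestrict (U' := LE) (φ := jO) (f := (Subtype.val : O → E4))
      (fun _ => rfl) ((contMDiff_subtype_val (n := ∞)).mdifferentiableAt (by simp)), mfderiv_subtypeVal]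
  set ΦO : O → 𝒱.carrier := ΦL ∘ jO with hΦO
  have hΦOs : ContMDiff 𝓘(ℝ, E4) (𝓡 4) ∞ ΦO := hΦLs.comp hjOs
  have hΦOs' : ContMDiff 𝓘(ℝ, E4) (𝓡 4) ((((⊤ : ℕ∞) : WithTop ℕ∞)) + 1) ΦO := hΦOs
  have hdΦO : ∀ z : O, mfderiv 𝓘(ℝ, E4) (𝓡 4) ΦO z = mfderiv 𝓘(ℝ, E4) (𝓡 4) ΦL (jO z) := fun z => by
    rw [hΦO, mfderiv_comp z (hΦLs.mdifferentiableAt (by simp)) (hjOs.mdifferentiableAt (by simp)), hdjO]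
    exact ContinuousLinearMap.comp_id _
  have hΦO' : ∀ z : O, Injective (mfderiv 𝓘(ℝ, E4) (𝓡 4) ΦO z) := by
    intro z
    refine (injective_iff_map_eq_zero (mfderiv 𝓘(ℝ, E4) (𝓡 4) ΦO z)).2 fun u hu => ?_
    have hz : ‖Gt z.1 - Gt (x₀ : E4)‖ < c := by
      have hz' : dist (Gt z.1) (Gt x₀) < c / 2 := z.2.2
      rw [dist_eq_norm] at hz'
      linarith
    have hGB : ∀ u : E4, c * ‖u‖ ≤ ‖Gt (x₀ : E4) u‖ := by rw [hGt0]; exact hcb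
    have hu' : mfderiv 𝓘(ℝ, E4) (𝓡 4) ΦL (jO z) u = 0 := by rw [← hdΦO]; exact hu
    exact nondegenerate_of_norm_sub_lt hGB hz u fun w' => by
      rw [show Gt z.1 = Gt (jO z).1 from rfl, hGtval, hu', map_zero, zero_apply]
  /- ## Step 3: the pulled-back metric `g̃ = Φ_O^* g` on `O` and its components -/
  set gt := g.comap PseudoRiemannianMetric.contMDiff_pullbackBilin_holds ΦO hΦOs' hΦO' rfl with hgt
  haveI hgtLC : gt.HasLeviCivita := gt.hasLeviCivita
  have hGtO : ∀ z : O, gt.val z = Gt z.1 := fun z => by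
    ext u u'
    rw [hgt, PseudoRiemannianMetric.val_comap, pullbackBilin_apply, show Gt z.1 = Gt (jO z).1 from rfl]
    erw [hGtval, hdΦO]
    rfl
  /- ## Step 4: source localisation `slabN' = slabN ∩ A⁻¹(O)` and the maps `e_{N,T}`, `e_{N,B}` -/
  set SN : Set E3 := (slabN M a : Set E3) ∩ A ⁻¹' (O : Set E4) with hSN
  have hSNopen : IsOpen SN := (slabN M a).2.inter (hOopen.preimage hAs.continuous)
  set slabN' : Opens E3 := ⟨SN, hSNopen⟩ with hslabN'
  have hAy : A (y : E3) = (x₀ : E4) := rfl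
  have hu₀mem : (y : E3) ∈ slabN' := ⟨⟨y.1.2, y.2⟩, by show A (y : E3) ∈ Oset; rw [hAy]; exact hOx₀⟩
  set u₀ : slabN' := ⟨(y : E3), hu₀mem⟩ with hu₀
  -- the identity reparametrisation `slabN' → slabW`
  set Θ' : slabN' → slabW M a := fun u => ⟨⟨u.1, u.2.1.1⟩, u.2.1.2⟩ with hΘ'
  have hΘ's : ContMDiff 𝓘(ℝ, E3) 𝓘(ℝ, E3) ∞ Θ' := by
    have h1 : ContMDiff 𝓘(ℝ, E3) 𝓘(ℝ, E3) ∞ (fun u : slabN' => (⟨u.1, u.2.1.1⟩ : Kerr.slice a M)) := by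
      rw [← ContMDiff.subtypeVal_comp_iff]; exact contMDiff_subtype_val
    rw [← ContMDiff.subtypeVal_comp_iff]; exact h1
  have hΘ'mf : ∀ (u : slabN') (v' : E3), mfderiv 𝓘(ℝ, E3) 𝓘(ℝ, E3) Θ' u v' = v' := by
    intro u v'
    have hd0 : MDifferentiableAt 𝓘(ℝ, E3) 𝓘(ℝ, E3) (Subtype.val : slabN' → E3) u :=
      (contMDiff_subtype_val (n := ∞)).mdifferentiableAt (by simp)
    have hd1 : MDifferentiableAt 𝓘(ℝ, E3) 𝓘(ℝ, E3)
        (fun u : slabN' => (⟨u.1, u.2.1.1⟩ : Kerr.slice a M)) u :=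
      OpensChart.mdifferentiableAt_codRestrict (U' := Kerr.slice a M)
        (φ := fun u : slabN' => (⟨u.1, u.2.1.1⟩ : Kerr.slice a M))
        (f := (Subtype.val : slabN' → E3)) (fun _ => rfl) hd0
    rw [OpensChart.mfderiv_codRestrict (U' := slabW M a) (φ := Θ')
        (f := fun u : slabN' => (⟨u.1, u.2.1.1⟩ : Kerr.slice a M)) (fun _ => rfl) hd1,
      OpensChart.mfderiv_codRestrict (U' := Kerr.slice a M)
        (φ := fun u : slabN' => (⟨u.1, u.2.1.1⟩ : Kerr.slice a M))
        (f := (Subtype.val : slabN' → E3)) (fun _ => rfl) hd0,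
      mfderiv_subtypeVal]
    rfl
  have hΘ'd : ∀ u : slabN', MDifferentiableAt 𝓘(ℝ, E3) 𝓘(ℝ, E3) Θ' u := fun u =>
    (hΘ's u).mdifferentiableAt (by simp)
  set eNT : slabN' → O := fun u => ⟨A u.1, u.2.2⟩ with heNT
  set eNB : slabN' → B.domain := fun u => eN (Θ' u) with heNB
  have heNBval : ∀ u : slabN', (eNB u : E4) = A u.1 := fun u => rfl
  set ν₂ : slabN' → E4 := fun u => Λ (NK u.1) with hν₂
  have hAdiff : ∀ u : slabN', DifferentiableAt ℝ A u.1 := fun u => (hAd _).differentiableAt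
  have hNKdiff : ∀ u : slabN', DifferentiableAt ℝ (fun z => Λ (NK z)) u.1 := fun u => by
    have hr0 : 0 < Kerr.radius a (E4.ofTimeSpace 0 (u.1 : E3)) :=
      Kerr.radius_pos_of_mem_region (Kerr.mem_slice_iff_ofTimeSpace_mem_region.1 u.2.1.1)
    exact ((Λ : E4 →L[ℝ] E4).differentiableAt).comp _
      ((Kerr.contDiffAt_sliceNormalRep hM.le a hr0 (n := 1)).differentiableAt one_ne_zero)
  -- the LHS second fundamental form, reparametrised over `slabN'`
  have h_loc : g.secondFundamentalForm 𝓘(ℝ, E3) (𝒱.embed ∘ ΦN) (fun u => 𝒱.normal (ΦN u)) y v w =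
      g.secondFundamentalForm 𝓘(ℝ, E3) ((𝒱.embed ∘ ΦN) ∘ Θ')
        (fun u => 𝒱.normal (ΦN (Θ' u))) u₀ v w := by
    have h1 := g.secondFundamentalForm_comp_right (IX := 𝓘(ℝ, E3)) (IN := 𝓘(ℝ, E3))
      (f := 𝒱.embed ∘ ΦN) (ν := fun u => 𝒱.normal (ΦN u))
      (Ψ := Θ') (u := u₀) BoundarylessManifold.isInteriorPoint BoundarylessManifold.isInteriorPoint
      ((𝒱.mdifferentiableAt_embed_normal _).comp _ (hΦNd _)) (hΘ'd u₀) v w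
    rw [hΘ'mf, hΘ'mf] at h1
    exact h1.symm
  -- the incidences `j_L ∘ j_O ∘ e_{N,T} = e_{N,B} = e_N ∘ Θ'`
  have hjj : ∀ u : slabN', jL (jO (eNT u)) = eNB u := fun u => Subtype.ext rfl
  have h_congr : g.secondFundamentalForm 𝓘(ℝ, E3) ((𝒱.embed ∘ ΦN) ∘ Θ')
        (fun u => 𝒱.normal (ΦN (Θ' u))) u₀ =
      g.secondFundamentalForm 𝓘(ℝ, E3) (ΦO ∘ eNT)
        (fun u => mfderiv 𝓘(ℝ, E4) (𝓡 4) ΦO (eNT u) (ν₂ u)) u₀ := by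
    refine g.secondFundamentalForm_congr_pair (funext fun u => ?_) (fun u => ?_) u₀
    · show 𝒱.embed (ΦN (Θ' u)) = Φ₀ (jL (jO (eNT u)))
      rw [hcomp, hjj]
    · show 𝒱.normal (ΦN (Θ' u)) = mfderiv 𝓘(ℝ, E4) (𝓡 4) ΦO (eNT u) (Λ (NK u.1))
      rw [hdΦO, hdΦL, hjj]
      exact (hnormal (Θ' u)).symm
  have hνlift : MDifferentiableAt 𝓘(ℝ, E3) 𝓘(ℝ, E4).tangent
      (fun u => (TotalSpace.mk' E4 (eNT u) (ν₂ u) : TangentBundle 𝓘(ℝ, E4) O)) u₀ :=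
    OpensChart.mdifferentiableAt_lift_of_repr (f := eNT) (Φ := A) (fun _ => rfl) (ν := ν₂)
      (N := fun z => Λ (NK z)) (fun _ => rfl) (hAdiff u₀) (hNKdiff u₀)
  have h_comap : g.secondFundamentalForm 𝓘(ℝ, E3) (ΦO ∘ eNT)
        (fun u => mfderiv 𝓘(ℝ, E4) (𝓡 4) ΦO (eNT u) (ν₂ u)) u₀ =
      gt.secondFundamentalForm 𝓘(ℝ, E3) eNT ν₂ u₀ :=
    (g.secondFundamentalForm_comap PseudoRiemannianMetric.contMDiff_pullbackBilin_holds hΦOs' hΦO' rfl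
      (f := eNT) (ν := ν₂) BoundarylessManifold.isInteriorPoint hνlift).symm
  have hGtd : DifferentiableAt ℝ Gt (eNT u₀ : E4) := (hGts x₀).differentiableAt (by simp)
  have h_chartV : gt.secondFundamentalForm 𝓘(ℝ, E3) eNT ν₂ u₀ v w =
      gt.val (eNT u₀) (fderiv ℝ (fun z => Λ (NK z)) (y : E3) v +
        OpensChart.christoffel gt Gt (eNT u₀) (Λ (NK (y : E3))) (fderiv ℝ A (y : E3) v)) (fderiv ℝ A (y : E3) w) :=
    OpensChart.secondFundamentalForm_eq_of_repr (g := gt) (G := Gt) hGtO (f := eNT) (Φ := A)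
      (fun _ => rfl) (ν := ν₂) (N := fun z => Λ (NK z)) (fun _ => rfl) (hAdiff u₀) (hNKdiff u₀) hGtd v w
  /- ## Step 5: the Kerr side through the Poincaré isometry `P̂ : B.domain → Kerr.region` -/
  set gK := (Kerr.smoothMetric M a M).toPseudoRiemannianMetric with hgK
  set Pr : B.domain → Kerr.region a M := fun x => ⟨P x.1, hPreg x⟩ with hPr
  have hPrs0 : ContMDiff 𝓘(ℝ, E4) 𝓘(ℝ, E4) ∞ Pr := by
    rw [← ContMDiff.subtypeVal_comp_iff]
    intro x
    exact contMDiffAt_subtype_iff.2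
      (KerrSchildChart.contDiff_poincareInv mo.1 mo.2).contMDiff.contMDiffAt
  have hPrs : ContMDiff 𝓘(ℝ, E4) 𝓘(ℝ, E4) ((((⊤ : ℕ∞) : WithTop ℕ∞)) + 1) Pr := hPrs0
  have hdPr : ∀ x : B.domain, mfderiv 𝓘(ℝ, E4) 𝓘(ℝ, E4) Pr x = (Λ.symm : E4 →L[ℝ] E4) := by
    intro x
    have h1 : MDifferentiableAt 𝓘(ℝ, E4) 𝓘(ℝ, E4) (fun x : B.domain => P x.1) x := by
      have := (KerrSchildChart.contDiff_poincareInv mo.1 mo.2 (n := ∞)).contMDiff.contMDiffAt (x := x.1)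
      exact (contMDiffAt_subtype_iff.2 this).mdifferentiableAt (by simp)
    rw [OpensChart.mfderiv_codRestrict (U' := Kerr.region a M) (φ := Pr)
      (f := fun x : B.domain => P x.1) (fun _ => rfl) h1]
    rw [show (fun x : B.domain => P x.1) = P ∘ Subtype.val from rfl,
      mfderiv_comp_subtypeVal (((KerrSchildChart.contDiff_poincareInv mo.1 mo.2
        (n := ∞)).contMDiff.contMDiffAt (x := x.1)).mdifferentiableAt (by simp)), mfderiv_eq_fderiv,
      KerrSchildChart.fderiv_poincareInv]
  have hPr' : ∀ x : B.domain, Injective (mfderiv 𝓘(ℝ, E4) 𝓘(ℝ, E4) Pr x) := fun x => by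
    rw [hdPr]; exact Λ.symm.injective
  set gB := gK.comap PseudoRiemannianMetric.contMDiff_pullbackBilin_holds Pr hPrs hPr' rfl with hgB
  haveI hgBLC : gB.HasLeviCivita := gB.hasLeviCivita
  have hGB : ∀ x : B.domain, gB.val x = B.bilin x.1 := fun x => by
    have e : ∀ u u' : E4, gB.val x u u' = B.bilin x.1 u u' := fun u u' => by
      rw [hgB, PseudoRiemannianMetric.val_comap, pullbackBilin_apply, hdPr, hgK, Kerr.smoothMetric_val,
        hbil, boostedKerrBilin_apply]
      rfl
    exact ContinuousLinearMap.ext fun u => ContinuousLinearMap.ext fun u' => e u u'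
  -- RHS, reparametrised over `slabN'`
  have h_locK : gK.secondFundamentalForm 𝓘(ℝ, E3) (ψN M a) (νN M a) y v w =
      gK.secondFundamentalForm 𝓘(ℝ, E3) (ψN M a ∘ Θ') (fun u => νN M a (Θ' u)) u₀ v w := by
    have hνK : MDifferentiableAt 𝓘(ℝ, E3) 𝓘(ℝ, E4).tangent
        (fun x => (TotalSpace.mk' E4 (ψN M a x) (νN M a x) : TangentBundle 𝓘(ℝ, E4) (Kerr.region a M)))
        (Θ' u₀) := by
      have h := (Kerr.dataEmbedding M a M hM.le).mdifferentiableAt_embed_normal (Θ' u₀).1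
      exact h.comp (Θ' u₀) ((contMDiff_subtype_val (n := ∞)).mdifferentiableAt (by simp))
    have h1 := gK.secondFundamentalForm_comp_right (IX := 𝓘(ℝ, E3)) (IN := 𝓘(ℝ, E3))
      (f := ψN M a) (ν := νN M a) (Ψ := Θ') (u := u₀)
      BoundarylessManifold.isInteriorPoint BoundarylessManifold.isInteriorPoint hνK (hΘ'd u₀) v w
    rw [hΘ'mf, hΘ'mf] at h1
    exact h1.symm
  have h_congrK : gK.secondFundamentalForm 𝓘(ℝ, E3) (ψN M a ∘ Θ') (fun u => νN M a (Θ' u)) u₀ =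
      gK.secondFundamentalForm 𝓘(ℝ, E3) (Pr ∘ eNB)
        (fun u => mfderiv 𝓘(ℝ, E4) 𝓘(ℝ, E4) Pr (eNB u) (ν₂ u)) u₀ := by
    refine gK.secondFundamentalForm_congr_pair (funext fun u => Subtype.ext ?_) (fun u => ?_) u₀
    · show E4.ofTimeSpace 0 (u.1 : E3) = P (A u.1)
      rw [hPA]
    · show (νN M a (Θ' u) : E4) = mfderiv 𝓘(ℝ, E4) 𝓘(ℝ, E4) Pr (eNB u) (Λ (NK u.1))
      rw [hdPr]
      show NK u.1 = Λ.symm (Λ (NK u.1))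
      rw [ContinuousLinearEquiv.symm_apply_apply]
  have hνliftB : MDifferentiableAt 𝓘(ℝ, E3) 𝓘(ℝ, E4).tangent
      (fun u => (TotalSpace.mk' E4 (eNB u) (ν₂ u) : TangentBundle 𝓘(ℝ, E4) B.domain)) u₀ :=
    OpensChart.mdifferentiableAt_lift_of_repr (f := eNB) (Φ := A) heNBval (ν := ν₂)
      (N := fun z => Λ (NK z)) (fun _ => rfl) (hAdiff u₀) (hNKdiff u₀)
  have h_comapK : gK.secondFundamentalForm 𝓘(ℝ, E3) (Pr ∘ eNB)
        (fun u => mfderiv 𝓘(ℝ, E4) 𝓘(ℝ, E4) Pr (eNB u) (ν₂ u)) u₀ =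
      gB.secondFundamentalForm 𝓘(ℝ, E3) eNB ν₂ u₀ :=
    (gK.secondFundamentalForm_comap PseudoRiemannianMetric.contMDiff_pullbackBilin_holds hPrs hPr' rfl
      (f := eNB) (ν := ν₂) BoundarylessManifold.isInteriorPoint hνliftB).symm
  have hBd : DifferentiableAt ℝ B.bilin (eNB u₀ : E4) := by
    have hr : 0 < Kerr.radius a (poincareInv mo.1 mo.2 (eNB u₀ : E4)) :=
      Kerr.radius_pos_of_mem_region (hPreg (eNB u₀))
    rw [hbil]
    exact (contDiffAt_boostedKerrBilin _ _ _ _ hr (n := 1)).differentiableAt one_ne_zero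
  have h_chartK : gB.secondFundamentalForm 𝓘(ℝ, E3) eNB ν₂ u₀ v w =
      gB.val (eNB u₀) (fderiv ℝ (fun z => Λ (NK z)) (y : E3) v +
        OpensChart.christoffel gB B.bilin (eNB u₀) (Λ (NK (y : E3))) (fderiv ℝ A (y : E3) v)) (fderiv ℝ A (y : E3) w) :=
    OpensChart.secondFundamentalForm_eq_of_repr (g := gB) (G := B.bilin) hGB (f := eNB) (Φ := A)
      heNBval (ν := ν₂) (N := fun z => Λ (NK z)) (fun _ => rfl) (hAdiff u₀) (hNKdiff u₀) hBd v w
  /- ## Step 6: comparison of the two chart expressions through the order-`≤ 1` jet -/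
  -- values agree
  have hval : (gt.val (eNT u₀) : E4 →L[ℝ] E4 →L[ℝ] ℝ) = gB.val (eNB u₀) := by
    rw [hGtO, hGB]
    exact hGt0
  -- derivatives of the components agree: `fderiv (deviationExtend) = 0` at the slab point
  have hDdev : fderiv ℝ (𝒱.toSpacetime.deviationExtend BL ΦL) (x₀ : E4) = 0 := by
    have hdiffL : DifferentiableAt ℝ (𝒱.toSpacetime.deviationExtend BL ΦL) (x₀ : E4) := by
      have hr : 0 < Kerr.radius a (poincareInv mo.1 mo.2 (x₀ : E4)) :=
        Kerr.radius_pos_of_mem_region (hPreg (jL x₀))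
      have hb : ContDiffAt ℝ ∞ B.bilin (x₀ : E4) := by
        rw [hbil]; exact contDiffAt_boostedKerrBilin _ _ _ _ hr
      exact (𝒱.toSpacetime.contDiffAt_deviationExtend_model BL hΦLs x₀ hb).differentiableAt (by simp)
    -- order-1 exactness for the `B`-deviation, transported along the local agreement
    have h1B : iteratedFDeriv ℝ 1 (𝒱.toSpacetime.deviationExtend B Φ₀) (x₀ : E4) = 0 := by
      have hle := (enorm_iteratedFDeriv_le_supCkENorm (k := k') (m := 1) hk'
        (mem_image_of_mem Subtype.val (hslabmem y)) (𝒱.toSpacetime.deviationExtend B Φ₀)).trans hdev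
      have := le_antisymm hle zero_le
      rwa [enorm_eq_zero] at this
    have h1L : iteratedFDeriv ℝ 1 (𝒱.toSpacetime.deviationExtend BL ΦL) (x₀ : E4) = 0 := by
      rw [((hdevLext x₀).iteratedFDeriv ℝ 1).eq_of_nhds]; exact h1B
    ext u u' u''
    have e := congrArg (fun F => F (fun _ => u)) h1L
    simp only [iteratedFDeriv_one_apply, zero_apply] at e
    rw [e]
    rfl
  have hD : fderiv ℝ Gt (x₀ : E4) = fderiv ℝ B.bilin (x₀ : E4) := by
    have hr : 0 < Kerr.radius a (poincareInv mo.1 mo.2 (x₀ : E4)) :=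
      Kerr.radius_pos_of_mem_region (hPreg (jL x₀))
    have hb : DifferentiableAt ℝ B.bilin (x₀ : E4) := by
      rw [hbil]; exact (contDiffAt_boostedKerrBilin _ _ _ _ hr (n := 1)).differentiableAt one_ne_zero
    have hdL : DifferentiableAt ℝ (𝒱.toSpacetime.deviationExtend BL ΦL) (x₀ : E4) := by
      have hb' : ContDiffAt ℝ ∞ B.bilin (x₀ : E4) := by
        rw [hbil]; exact contDiffAt_boostedKerrBilin _ _ _ _ hr
      exact (𝒱.toSpacetime.contDiffAt_deviationExtend_model BL hΦLs x₀ hb').differentiableAt (by simp)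
    have e : Gt = 𝒱.toSpacetime.deviationExtend BL ΦL + B.bilin := by funext q; rfl
    rw [e, fderiv_add hdL hb, hDdev, zero_add]
  have hΓ : OpensChart.christoffel gt Gt (eNT u₀) (Λ (NK (y : E3))) (fderiv ℝ A (y : E3) v) =
      OpensChart.christoffel gB B.bilin (eNB u₀) (Λ (NK (y : E3))) (fderiv ℝ A (y : E3) v) :=
    OpensChart.christoffel_congr_point hval hD _ _
  -- assemble
  rw [h_lhs, h_loc, congrArg (fun K => K v w) h_congr, congrArg (fun K => K v w) h_comap, h_chartV,
    h_locK, congrArg (fun K => K v w) h_congrK, congrArg (fun K => K v w) h_comapK, h_chartK, hΓ]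
  exact DFunLike.congr_fun (DFunLike.congr_fun hval _) _


end Proof

end F1Route

end Summit.FinalStateConjecture.FinalStateConjecture.Theorems.BondiBartnikRigidity.DirectMethod

end


namespace Summit.FinalStateConjecture.FinalStateConjecture.Theorems.BondiBartnikRigidity.DirectMethod

set_option linter.dupNamespace false in
open Literature.Geometry.Lorentzian F1Route in
/-- **F1' (corrected slab-jet Cauchy rigidity), proved modulo the MGHD existence fact.**
`stub_slabCauchyRigidity' : choquetBruhat_geroch_exists_mghd_cauchy → F1Route.SlabCauchyRigidity'`. -/
theorem stub_slabCauchyRigidity' (hcbg : choquetBruhat_geroch_exists_mghd_cauchy) :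
    F1Route.SlabCauchyRigidity' :=
  F1Route.slabCauchyRigidity'_of (F1Route.subdataDevelopmentsEmbedLit_of_choquetBruhatGeroch hcbg)
    F1Route.subdevelopmentFuturePlacement_holds F1Route.slabSecondFormIdentity_holds
    F1Route.kerrSlabLensCauchy_holds

end Summit.FinalStateConjecture.FinalStateConjecture.Theorems.BondiBartnikRigidity.DirectMethod
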